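import Literature.MathematicalPhysics.QuantumFieldTheory.Balaban1983to89.B9SectBCodedChainR3
import Literature.MathematicalPhysics.QuantumFieldTheory.Balaban1983to89.B9SectBCodedChainR2
import Literature.MathematicalPhysics.QuantumFieldTheory.Balaban1983to89.B9RWSumsCompleteGeo9YNbr
import Literature.MathematicalPhysics.QuantumFieldTheory.Balaban1983to89.B9SectBL2GReadY
import Literature.MathematicalPhysics.QuantumFieldTheory.Balaban1983to89.B9SectBCodedClassR
import Literature.MathematicalPhysics.QuantumFieldTheory.Balaban1983to89.B9SectBCodedChainR4
import Literature.MathematicalPhysics.QuantumFieldTheory.Balaban1983to89.B9SectBL2GReadCodedY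
import Literature.MathematicalPhysics.QuantumFieldTheory.Balaban1983to89.B9SectBGClassLettersY
import Literature.MathematicalPhysics.QuantumFieldTheory.Balaban1983to89.B9SectBL2GCrossY
import Literature.MathematicalPhysics.QuantumFieldTheory.Balaban1983to89.B9SectBL2GFrameV7
import Literature.MathematicalPhysics.QuantumFieldTheory.Balaban1983to89.B9SectBL2GFrameCodedY
import Literature.MathematicalPhysics.QuantumFieldTheory.Balaban1983to89.B9SectBQSizesY
import Literature.MathematicalPhysics.QuantumFieldTheory.Balaban1983to89.B9SectBQSizesL2Y
import Literature.MathematicalPhysics.QuantumFieldTheory.Balaban1983to89.B9SectBL2GFrameV8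
import Literature.MathematicalPhysics.QuantumFieldTheory.Balaban1983to89.B9SectBQLettersL2Y
import Literature.MathematicalPhysics.QuantumFieldTheory.Balaban1983to89.B9SectBL2GFrameCodedV8Y
import Literature.MathematicalPhysics.QuantumFieldTheory.Balaban1983to89.B9SectBL2GStepAtLettersV3
import Literature.MathematicalPhysics.QuantumFieldTheory.Balaban1983to89.B9SectBKerLettersL2Y
import Literature.MathematicalPhysics.QuantumFieldTheory.Balaban1983to89.B9Ineq349L2ReadingsP
import Literature.MathematicalPhysics.QuantumFieldTheory.Balaban1983to89.B9Ineq368L2FP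
import Literature.MathematicalPhysics.QuantumFieldTheory.Balaban1983to89.B9SectBL2GRead377Y

/-!
# `Balaban1983to89.B9SectBCodedChainR7` — CASCADE-R BUNDLE 7∕7 (director-ym №279 GO-R; №277 (3) `hunitA` cure): the class-parametric twins
# `B9SectBL2GReadYR`, `B9SectBL2GReadCodedYR`, `B9SectBL2GCrossYR`, `B9SectBL2GFrameCodedYR`, `B9SectBQSizesL2YR`, `B9SectBL2GFrameCodedV8YR`, `B9SectBL2GRead377YR`

statement-level skeleton of published theorems with citation tags; proofs where landed; nothing here is a claim about the
Yang–Mills mass gap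

WHY A BUNDLE.  The minimal R-sub-path of №279 (3) is a 47-module dependency chain; post-accept olean builds are the latency of record today, so the
chain is filed as 7 layered modules instead of 47.  This module is the VERBATIM concatenation, in dependency order, of the 7 generated twin files
named above (each keeps its own namespace `…<Original>R`, its own honest twin header and a pointer to the original module documentation; consumers `open` the
namespaces exactly as they would the per-file twins).  Generated by dag-n06-c g16 (`mkbundle.py`, HOME `pub-ymgap-dag-n06-c/lean/g16/`).

v1.1 — DOC-ONLY EDITION (№288 (4) HEADER AUDIT; ref-E READ-13 HEADER-NIT; lit-balaban-r06 numerals).  No Lean token outside comments changes (every declaration byte-identical to v1).  The generator sentence «specialises definitionally ∕ VERBATIM» was FALSE for the declarations carrying the №277 re-keyed `hunitA` — here: `B9SectBL2GFrameCodedYR`: `l2GFrame₇CodedOn`, `stepL2Pos_KACU_frame_on`; `B9SectBQSizesL2YR`: `l2SizeAb_gFrame₅CodedOn`; `B9SectBL2GFrameCodedV8YR`: `l2GFrame₈CodedOn`, `stepL2Pos_KACU_frame₈_on`; `B9SectBL2GRead377YR`: `read377L2_gFrame₅CodedOn` — (weaker hypothesis: the twin IMPLIES the original at `P := extraY 𝔸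 G` via `fun j α₀ U hU => hunitA j U hU.1.1`); their twin headers now say so, the others (`B9SectBL2GReadYR`, `B9SectBL2GReadCodedYR`, `B9SectBL2GCrossYR`) mark the clause idle.  CAVEAT OF RECORD (LOCATED-18, director-ym №290 (1)): that class-keyed `hunitA` has no α₀-threshold and is uninhabitable at `SU(N)` as typed (certificate `B9Thm311ClassKeyedHunitANotInhabited`); the GUARDED twins `B9SectBCodedChainRG1∕RG2` ∕ `B9SectBStepUGuardedR` are the consumable objects.  Page numerals corrected per the [B9] page owner's receipt: «(3.80)–(3.86) p.407» → «(3.80)–(3.81) p.406, (3.82)–(3.86) p.407» (×2); «(3.12)–(3.15) p.393» → «(3.12)–(3.13) p.392, (3.14)–(3.15) p.393» (×1).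

HONEST SCOPE.  Re-typing bookkeeping; nothing of [B9] asserted beyond the originals; COUNT-NEUTRAL; N06 NOT discharged; nothing continuum ∕ OS ∕ mass gap ∕ Clay.
-/

/-!
# `Balaban1983to89.B9SectBL2GReadYR` — THE CLASS-PARAMETRIC TWIN of `B9SectBL2GReadY` (CASCADE-R, director-ym №279 GO-R; №277 (3) `hunitA` cure; dag-n06-d SOCKET-(α) class question)

statement-level skeleton of published theorems with citation tags; proofs where landed; nothing here is a claim about the
Yang–Mills mass gap

WHAT THIS FILE IS.  The original module `B9SectBL2GReadY` types its objects over MODULE 3's member carrier `bg9Y 𝔸 G x` (MODULE 2's small-cube class (3.35)).  This file RE-DECLARES, with UNCHANGED NAMES inside the namespace `…B9SectBL2GReadYR`, exactly its 4 class-dependent declarations over the CLASS-PARAMETRIC carrier `B9SectBCodedClassR.bg9YC 𝔸 G P x` (`P : RegExtraY …` = the two cube conditions of (3.35)∕(3.36) as a parameter; `bg9Y 𝔸 G x = bg9YC 𝔸 G (extraY 𝔸 G) x` by `rfl`, so every declaration here specialises definitionally to its original; at the record's reading of PRINT's class, `P := extraYPb 𝔸 G`, the displayed laws `hreg335P` ((3.35)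 on plaquettes) and the class-keyed `hunitA` become theorems).  The text is the original's VERBATIM under the token surgery `bg9Y 𝔸 G ↦ bg9YC 𝔸 G P`, `NAME ↦ NAME P` for the class-dependent names (P the first explicit argument), and — №277 — the binder `hunitA` re-keyed from «all G-valued U» to «all (3.35)-regular U of the carrier» (`∀ j α₀ U, (bg9YC 𝔸 G P (f j)).Reg335 c35 α₀ U → IsUnit (deltaAY …)`) — a clause IDLE in this twin (no `hunitA` here; v1.1).  Class-free declarations of the original are NOT copied: they are imported and used BY NAME (`open … hiding` the re-declared ones).  Generated by dag-n06-c g16's `gen.py` (HOME `pub-ymgap-dag-n06-c/lean/g16/`); the ORIGINAL MODULE DOCUMENTATION FOLLOWS VERBATIM and describes the mathematics.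

HONEST SCOPE.  Re-typing bookkeeping; nothing of [B9] asserted beyond the original; COUNT-NEUTRAL; N06 NOT discharged; nothing continuum ∕ OS ∕ mass gap ∕ Clay.  Cell `pub-ymgap` (D-0062), Track A node N06 [B9], seat `pub-ymgap-dag-n06-c` g16, 2026-08-29.
-/

/-! Module documentation: that of the original `Balaban1983to89.B9SectBL2GReadY` applies verbatim to this twin (not repeated here). -/

noncomputable section

namespace Literature.MathematicalPhysics.QuantumFieldTheory.Balaban1983to89.B9SectBL2GReadYR

open Literature.MathematicalPhysics.QuantumFieldTheory.Balaban1983to89.B9SectBCodedClassR (RegExtraY bg9YC)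
open Literature.MathematicalPhysics.QuantumFieldTheory.Balaban1983to89.B9SectBL2GReadY hiding l2Block_kernelFamilyB_of_KACU_base readGL2Y_KACU KACU_l2_prod_eq writeGL2Y_KACU

open Node00
open B6GlobalChartV1 (blkV1)
open B6Ineq2142KLevelV1 (β)
open B6KLevelCensusIndexV1 (KIdx)
open B6RandomWalk (blockPiece)
open B6RandomWalkL2 (l2n l2n_nonneg l2n_sq l2n_add_le l2n_sum_le l2n_smul l2n_mono HasL2Majorant hasL2Majorant_mono)
open B9Thm34Ext (toB6)
open B9FromB6 (L2Block pref6_nonneg)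
open B9GeoNormsKLevelV1 (geo9K geo9K_l2Norm_nonneg geo9K_dist_nonneg)
open B9GeoLemma21KLevelV1 (geo9K_dist_comm geo9K_dist_triangle geo9K_len_pos)
open B9Eq352DivFormLetters (conj conj_apply conj_mul coordEquiv coordEquiv_apply coordEquiv_symm_apply)
open B9CoReadingCoords (cdBₗ cdsBₗ cdBₗ_apply cdsBₗ_apply)
open B9SectBGpReadingsY (baseY coordEquiv_symm_eq_sum_liftY liftY_eq_liftY_unit coordEquiv_liftY real_smul_fun)
open B9SectBGpLettersY (decY decY_base)
open B9SectBL2DictionaryY (norm_le_sum_mul_sqrt_repr)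
open B9Thm314WholeExpansionReads (le_iSup_ball le_iSup_ball_iSup le_iSup_ball_iSup₂)
open B9PinMembersKLevelV1 (MemberY geo9Y bg9Y)
open B9Eq360DeltaPrimeAY (AfldY)
open B9SectBGpFrameCodedYR (codingYx codingYx_dec)
open B9SectBCodedCarrier (pullK)
open B9SectBCodedReadingsUR (KACU)
open B9SectBStepsKSCUR (KACU_members_base)
open B9RWSumsReadsNbr (nbr mem_nbr)
open B9RWSumsCompleteGeo9YNbr (len_le_of_dist_lt_M_geo9K)

variable {d ℓ : ℕ} {hd : 1 ≤ d + 1} {hL : Odd (ℓ + 1) ∧ 1 < ℓ + 1} {b₀ b₁ : ℝ} {Mstar : ℕ}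
variable {𝔸 : Type} [NormedRing 𝔸] (P : RegExtraY d ℓ hd hL b₀ b₁ Mstar 𝔸) [NormedAlgebra ℂ 𝔸] [CompleteSpace 𝔸]
variable {ι : Type} [Fintype ι]
variable (i : KIdx d ℓ hd hL b₀ b₁) (ιB : BlkY i → IBondY i) (b : Module.Basis ι ℝ 𝔸)

/-! ## §1 `ℓ²` tools on the bond carrier -/

section Tools

end Tools

/-! ## §2 ★ The generic `ℓ²` conj-`b` dictionary on the bond carrier -/

section Dictionary

variable [Fintype (geo9K i).Site] [DecidableEq (geo9K i).Site]

end Dictionary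

/-! ## §3 ★★ READ: the (3.46) block of def-Y's bond reading ⇒ the six block-`ℓ²` majorants of the conj-`b` words -/

section Read

variable {B : B9.Backgrounds} (cfg : B.Cfg → CfgY 𝔸 i) (O : BondOpY 𝔸 i) (par : BondParY 𝔸 i) {B₀ δ : ℝ} {U₁ : B.Cfg}
variable [Fintype (geo9K i).Site]

variable [DecidableEq (geo9K i).Site]

end Read

/-! ## §4 The coded bond reading `KACU` of the Sect.-B step of record: READ at a base, WRITE at a coded product -/

section Coded

variable (G : Subgroup 𝔸ˣ) (x : MemberY d ℓ hd hL b₀ b₁ Mstar) (OA : BondOpY 𝔸 x.toKIdx) (parB : BondParY 𝔸 x.toKIdx)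
  (C37 C38 : ℝ → CfgY 𝔸 x.toKIdx → AfldY 𝔸 x.toKIdx → Prop)

omit [Fintype ι] in
/-- at a base configuration the (3.46) block of the coded U-letter bond reading `KACU` IS the block of def-Y's one-configuration reading `kernelFamilyB`
(`B9SectBStepsKSCU.KACU_members_base`). [cite: Balaban1985BackgroundPropagators, Thm 3.3 p.399 with (3.46) p.398, bookkeeping] -/
theorem l2Block_kernelFamilyB_of_KACU_base {B₀ δ : ℝ} {U : CfgY 𝔸 x.toKIdx} (h : L2Block (KACU P G x OA parB C37 C38) B₀ δ (.base U)) :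
    L2Block (kernelFamilyB x.toKIdx (bg9YC 𝔸 G P x) (fun U => U) OA parB) B₀ δ U := by
  have h' : L2Block (pullK (codingYx P G x C37 C38) (kernelFamilyB x.toKIdx (bg9YC 𝔸 G P x) (fun U => U) OA parB)) B₀ δ (.base U) := by
    intro n lam hh y y' hc hs
    rw [← (KACU_members_base P G x OA parB C37 C38 U).2.2.2.2.1 n]
    exact h n lam hh y y' hc hs
  intro n lam hh y y' hc hs
  have h1 := h' n lam hh y y' hc hs
  have e : (pullK (codingYx P G x C37 C38) (kernelFamilyB x.toKIdx (bg9YC 𝔸 G P x) (fun U => U) OA parB)).l2 n (.base U) =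
      (kernelFamilyB x.toKIdx (bg9YC 𝔸 G P x) (fun U => U) OA parB).l2 n U := by
    show (kernelFamilyB x.toKIdx (bg9YC 𝔸 G P x) (fun U => U) OA parB).l2 n ((codingYx P G x C37 C38).dec (.base U)) = _
    rw [codingYx_dec]; rfl
  rw [e] at h1
  exact h1

variable [Fintype (geo9K x.toKIdx).Site] [DecidableEq (geo9K x.toKIdx).Site] {Rr : ℝ} {Hp : Prop} (ιB : BlkY x.toKIdx → IBondY x.toKIdx)

/-- ★★ **THE SIX (3.46) BLOCK-`ℓ²` MAJORANTS OF THE BOND LETTER `OA(U)` READ FROM `KACU` AT A BASE** (def-Y's letters `OA(U)`, `cdBₗ U ν`, `cdsBₗ U ν` in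
real coordinates on `FBondY × ι`, block map `ι_B ∘ blkV1`; constant `c_L·B₀` with `c_L = √|ι|·M₂·Σ_j‖b_j‖`, profiles `ℓ², ℓ, ℓ, 1, 1, 1`, SAME rate; stated
over `geo9K x.toKIdx = geo9Y x` by `rfl`). [cite: Balaban1985BackgroundPropagators, Thm 3.3 p.399 with (3.46) p.398, Thm 3.4 p.400; Balaban1984PropagatorsII, Prop. 2.6 (2.140) p.247, (2.51) p.232] -/
theorem readGL2Y_KACU [FiniteDimensional ℝ 𝔸] (hι : ∀ s, β x.toKIdx.hN x.toKIdx.D x.toKIdx.hk (ιB s) = s)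
    {M₂ : ℝ} (hM₂ : 0 ≤ M₂) (hrepr : ∀ (v : 𝔸) (j : ι), |b.repr v j| ≤ M₂ * ‖v‖)
    {B₀ δ : ℝ} (hB₀ : 0 ≤ B₀) {U : CfgY 𝔸 x.toKIdx} (h : L2Block (KACU P G x OA parB C37 C38) B₀ δ (.base U)) :
    let i := x.toKIdx
    let cL : ℝ := Real.sqrt (Fintype.card ι) * M₂ * ∑ j, ‖b j‖
    let K : Fin 6 → IBondY i → IBondY i → ℝ := fun n a a' => cL * (B₀ * B9.pref6 ((geo9K i).len a) n * Real.exp (-(δ * (geo9K i).dist a a')))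
    HasL2Majorant (g := toB6 (geo9K i) Rr Hp) (fun p : FBondY i × ι => ιB (blkV1 i.hN i.D p.1)) (conj b ((OA U).restrictScalars ℝ)) (K 0) ∧
      (∀ ν, HasL2Majorant (g := toB6 (geo9K i) Rr Hp) (fun p : FBondY i × ι => ιB (blkV1 i.hN i.D p.1))
        (conj b (cdBₗ i U ν ∘ₗ (OA U).restrictScalars ℝ)) (K 1)) ∧
      (∀ ν, HasL2Majorant (g := toB6 (geo9K i) Rr Hp) (fun p : FBondY i × ι => ιB (blkV1 i.hN i.D p.1))
        (conj b ((OA U).restrictScalars ℝ ∘ₗ cdsBₗ i U ν)) (K 2)) ∧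
      (∀ ν μ, HasL2Majorant (g := toB6 (geo9K i) Rr Hp) (fun p : FBondY i × ι => ιB (blkV1 i.hN i.D p.1))
        (conj b (cdBₗ i U ν ∘ₗ (OA U).restrictScalars ℝ ∘ₗ cdsBₗ i U μ)) (K 3)) ∧
      (∀ ν μ, HasL2Majorant (g := toB6 (geo9K i) Rr Hp) (fun p : FBondY i × ι => ιB (blkV1 i.hN i.D p.1))
        (conj b (cdBₗ i U ν ∘ₗ cdBₗ i U μ ∘ₗ (OA U).restrictScalars ℝ)) (K 4)) ∧
      (∀ ν μ, HasL2Majorant (g := toB6 (geo9K i) Rr Hp) (fun p : FBondY i × ι => ιB (blkV1 i.hN i.D p.1))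
        (conj b ((OA U).restrictScalars ℝ ∘ₗ cdsBₗ i U ν ∘ₗ cdsBₗ i U μ)) (K 5)) :=
  hasL2Majorant_conjB_words_of_l2BlockB (B := bg9YC 𝔸 G P x) (U₁ := U) x.toKIdx ιB b (fun U => U) OA parB hι hM₂ hrepr Rr Hp hB₀
    (l2Block_kernelFamilyB_of_KACU_base P G x OA parB C37 C38 h)

omit [Fintype (geo9K x.toKIdx).Site] [DecidableEq (geo9K x.toKIdx).Site] [Fintype ι] in
/-- at a coded product the (3.46) members of `KACU` (U-letters: differences at the base `U`, operator at the decoded product `W`) ARE those of def-Y's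
one-configuration reading of the CONSTANT letter `OA(W)` over the coded carrier read through `baseY` (`rfl`). [cite: Balaban1985BackgroundPropagators, Thm 3.4 p.400, (3.46) p.398, bookkeeping] -/
theorem KACU_l2_prod_eq (n : Fin 6) (U : CfgY 𝔸 x.toKIdx) (a : AfldY 𝔸 x.toKIdx) :
    (KACU P G x OA parB C37 C38).l2 n (.prod U a) =
      (kernelFamilyB x.toKIdx (codingYx P G x C37 C38).bg (baseY x.toKIdx) (fun _ => OA (decY x.toKIdx (.prod U a))) parB).l2 n (.prod U a) := rfl

/-- ★★ **WRITE FOR `KACU` AT A CODED PRODUCT, THE `L²` MEMBER** (U-letters: covariant differences at the BASE `U`, the operator at the decoded product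
`W = e^{iηa}·U`): block-`ℓ²` majorants `B_c·pref6(ℓ(a))_n·e^{−δd}` of `conj b Gb`, `conj b D_ν * conj b Gb`, `conj b Gb * conj b D*_ν`,
`conj b D_ν * conj b Gb * conj b D*_μ`, `conj b D_ν * conj b D_μ * conj b Gb`, `conj b Gb * conj b D*_ν * conj b D*_μ` — `Gb`, `D_ν`, `D*_ν` any ℝ-linear maps
agreeing pointwise with `OA(W)`, `∇_{U,ν}`, `∇*_{U,ν}` — give `L2Block (KACU …) (c_W·B_c) δ (prod U a)` at the SAME rate, `c_W = m_N·c_L·L²·e^{δ}` (`m_N` a bound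
of the radius-1 neighbourhoods of the index bonds; the reading's cut-offs live within torus distance `1` of `Δ(y)`).
[cite: Balaban1985BackgroundPropagators, Thm 3.3 p.399 with (3.46) p.398, Thm 3.4 p.400, p.403 («of course with different constants»); Balaban1984PropagatorsII, Prop. 2.6 (2.140) p.247, (2.51)–(2.52) p.232] -/
theorem writeGL2Y_KACU (hι : ∀ s, β x.toKIdx.hN x.toKIdx.D x.toKIdx.hk (ιB s) = s)
    {M₂ : ℝ} (hM₂ : 0 ≤ M₂) (hrepr : ∀ (v : 𝔸) (j : ι), |b.repr v j| ≤ M₂ * ‖v‖)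
    {mN : ℕ} (hnbr : ∀ y : IBondY x.toKIdx, (nbr (geo9K x.toKIdx) 1 y).card ≤ mN)
    (U : CfgY 𝔸 x.toKIdx) (a : AfldY 𝔸 x.toKIdx)
    (Gb : Module.End ℝ (FBondY x.toKIdx → 𝔸)) (hGb : ∀ Λ, Gb Λ = OA (decY x.toKIdx (.prod U a)) Λ)
    (D Ds : Fin (d + 1) → Module.End ℝ (FBondY x.toKIdx → 𝔸)) (hD : ∀ ν Λ, D ν Λ = cdB x.toKIdx U ν Λ)
    (hDs : ∀ ν Λ, Ds ν Λ = cdsB x.toKIdx U ν Λ) {Bc δ : ℝ} (hBc : 0 ≤ Bc) (hδ : 0 ≤ δ)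
    (h0 : HasL2Majorant (g := toB6 (geo9K x.toKIdx) Rr Hp) (fun p : FBondY x.toKIdx × ι => ιB (blkV1 x.toKIdx.hN x.toKIdx.D p.1)) (conj b Gb)
      (fun a a' => Bc * (geo9K x.toKIdx).len a ^ 2 * Real.exp (-(δ * (geo9K x.toKIdx).dist a a'))))
    (h1 : ∀ ν, HasL2Majorant (g := toB6 (geo9K x.toKIdx) Rr Hp) (fun p : FBondY x.toKIdx × ι => ιB (blkV1 x.toKIdx.hN x.toKIdx.D p.1))
      (conj b (D ν) * conj b Gb) (fun a a' => Bc * (geo9K x.toKIdx).len a * Real.exp (-(δ * (geo9K x.toKIdx).dist a a'))))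
    (h2 : ∀ ν, HasL2Majorant (g := toB6 (geo9K x.toKIdx) Rr Hp) (fun p : FBondY x.toKIdx × ι => ιB (blkV1 x.toKIdx.hN x.toKIdx.D p.1))
      (conj b Gb * conj b (Ds ν)) (fun a a' => Bc * (geo9K x.toKIdx).len a * Real.exp (-(δ * (geo9K x.toKIdx).dist a a'))))
    (h3 : ∀ ν μ, HasL2Majorant (g := toB6 (geo9K x.toKIdx) Rr Hp) (fun p : FBondY x.toKIdx × ι => ιB (blkV1 x.toKIdx.hN x.toKIdx.D p.1))
      (conj b (D ν) * conj b Gb * conj b (Ds μ)) (fun a a' => Bc * 1 * Real.exp (-(δ * (geo9K x.toKIdx).dist a a'))))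
    (h4 : ∀ ν μ, HasL2Majorant (g := toB6 (geo9K x.toKIdx) Rr Hp) (fun p : FBondY x.toKIdx × ι => ιB (blkV1 x.toKIdx.hN x.toKIdx.D p.1))
      (conj b (D ν) * conj b (D μ) * conj b Gb) (fun a a' => Bc * 1 * Real.exp (-(δ * (geo9K x.toKIdx).dist a a'))))
    (h5 : ∀ ν μ, HasL2Majorant (g := toB6 (geo9K x.toKIdx) Rr Hp) (fun p : FBondY x.toKIdx × ι => ιB (blkV1 x.toKIdx.hN x.toKIdx.D p.1))
      (conj b Gb * conj b (Ds ν) * conj b (Ds μ)) (fun a a' => Bc * 1 * Real.exp (-(δ * (geo9K x.toKIdx).dist a a')))) :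
    L2Block (KACU P G x OA parB C37 C38)
      ((mN : ℝ) * (Real.sqrt (Fintype.card ι) * M₂ * ∑ j, ‖b j‖) * (((ℓ + 1 : ℕ) : ℝ)) ^ 2 * Real.exp δ * Bc) δ (.prod U a) := by
  classical
  set cL : ℝ := Real.sqrt (Fintype.card ι) * M₂ * ∑ j, ‖b j‖ with hcL
  set L2 : ℝ := (((ℓ + 1 : ℕ) : ℝ)) ^ 2 with hL2
  set W := decY x.toKIdx (.prod U a) with hW
  have hSb : 0 ≤ ∑ j, ‖b j‖ := Finset.sum_nonneg fun _ _ => norm_nonneg _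
  have hcL0 : 0 ≤ cL := by positivity
  -- the six words as ONE ℝ-linear map per member∕direction, agreeing pointwise with the 𝔸-side words, with their conj-`b` majorants
  have hlen0 : ∀ y : IBondY x.toKIdx, 0 < (geo9K x.toKIdx).len y := geo9K_len_pos x.toKIdx
  intro n lam hh y y' hc hs
  -- only bond data carry a non-zero member
  rcases lam with f | J
  · rcases hh with g | g <;>
    · show (0 : ℝ) ≤ _
      exact mul_nonneg (mul_nonneg (mul_nonneg (mul_nonneg (by positivity) (pref6_nonneg (hlen0 y).le n))
        (B9GeoNormsKLevelV1.geo9K_cutSup_nonneg x.toKIdx _)) (Real.exp_nonneg _)) (geo9K_l2Norm_nonneg x.toKIdx _)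
  rcases hh with g | hh
  · show (0 : ℝ) ≤ _
    exact mul_nonneg (mul_nonneg (mul_nonneg (mul_nonneg (by positivity) (pref6_nonneg (hlen0 y).le n))
      (B9GeoNormsKLevelV1.geo9K_cutSup_nonneg x.toKIdx _)) (Real.exp_nonneg _)) (geo9K_l2Norm_nonneg x.toKIdx _)
  -- bond data `(J, hh)`: the source vanishes off the labelled block `ιB (β y′)`, the cut-off lives on the labelled blocks of `nbr 1 y`
  set yL : IBondY x.toKIdx := ιB (β x.toKIdx.hN x.toKIdx.D x.toKIdx.hk y') with hyL
  have hoff : ∀ q, ιB (blkV1 x.toKIdx.hN x.toKIdx.D q) ≠ yL → J q = 0 := fun q hq => by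
    by_contra hJ; exact hq (by rw [hyL, ← hs q hJ])
  set s : ℝ := (geo9K x.toKIdx).cutSup (.inr hh) with hsdef
  have hs0 : 0 ≤ s := cutSup_inr_nonneg x.toKIdx hh
  have hhs : ∀ q, |hh q| ≤ s := abs_le_cutSup_inr x.toKIdx hh
  set N := nbr (geo9K x.toKIdx) 1 y with hN
  have hNmem : ∀ q, hh q ≠ 0 → ιB (blkV1 x.toKIdx.hN x.toKIdx.D q) ∈ N := label_mem_nbr_of_cutIn x.toKIdx ιB hι hc
  -- geometry of a neighbour label `y″ ∈ N`: `d(y″, yL) ≥ d(y, y′) − 1`, profiles comparable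
  have hgeo : ∀ y'' ∈ N, Real.exp (-(δ * (geo9K x.toKIdx).dist y'' yL)) ≤ Real.exp δ * Real.exp (-(δ * (geo9K x.toKIdx).dist y y')) := by
    intro y'' hy''
    rw [mem_nbr] at hy''
    rw [← Real.exp_add]
    refine Real.exp_le_exp.2 ?_
    have hdL : (geo9K x.toKIdx).dist y'' yL = (geo9K x.toKIdx).dist y'' y' := by
      show ((B6Geom246MultiLevelTorus.bondT x.toKIdx.D).dist (β x.toKIdx.hN x.toKIdx.D x.toKIdx.hk y'') (β x.toKIdx.hN x.toKIdx.D x.toKIdx.hk (ιB (β x.toKIdx.hN x.toKIdx.D x.toKIdx.hk y'))) : ℝ) =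
        ((B6Geom246MultiLevelTorus.bondT x.toKIdx.D).dist (β x.toKIdx.hN x.toKIdx.D x.toKIdx.hk y'') (β x.toKIdx.hN x.toKIdx.D x.toKIdx.hk y') : ℝ)
      rw [hι]
    have htri : (geo9K x.toKIdx).dist y y' ≤ (geo9K x.toKIdx).dist y y'' + (geo9K x.toKIdx).dist y'' y' := geo9K_dist_triangle x.toKIdx y y'' y'
    rw [geo9K_dist_comm x.toKIdx y y''] at htri
    rw [hdL]; nlinarith
  -- the bound of one piece `hh·1_{y″}` against a conj-`b` majorant of profile `w`
  have piece : ∀ (T : Module.End ℝ (FBondY x.toKIdx → 𝔸)) (w : IBondY x.toKIdx → ℝ), (∀ a, 0 ≤ w a) →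
      (∀ y'' ∈ N, w y'' ≤ L2 * B9.pref6 ((geo9K x.toKIdx).len y) n) →
      HasL2Majorant (g := toB6 (geo9K x.toKIdx) Rr Hp) (fun p : FBondY x.toKIdx × ι => ιB (blkV1 x.toKIdx.hN x.toKIdx.D p.1)) (conj b T)
        (fun a a' => Bc * w a * Real.exp (-(δ * (geo9K x.toKIdx).dist a a'))) →
      ∀ E : BallY 𝔸, l2OfY hh (T (liftY J (E : 𝔸))) ≤
        (mN : ℝ) * cL * L2 * Real.exp δ * Bc * B9.pref6 ((geo9K x.toKIdx).len y) n * s * Real.exp (-(δ * (geo9K x.toKIdx).dist y y')) *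
          (geo9K x.toKIdx).l2Norm (.inr J) := by
    intro T w hw hwle hT E
    have hE : ‖(E : 𝔸)‖ ≤ 1 := mem_closedBall_zero_iff.1 E.2
    have hsplit := l2OfYB_le_sum_pieces x.toKIdx ιB hh (T (liftY J (E : 𝔸))) N hNmem
    have hterm : ∀ y'' ∈ N, l2OfY (fun q => hh q * indB x.toKIdx ιB y'' q) (T (liftY J (E : 𝔸))) ≤
        cL * (Bc * (L2 * B9.pref6 ((geo9K x.toKIdx).len y) n) * (Real.exp δ * Real.exp (-(δ * (geo9K x.toKIdx).dist y y')))) * s *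
          (geo9K x.toKIdx).l2Norm (.inr J) := by
      intro y'' hy''
      have hK0 : 0 ≤ Bc * w y'' * Real.exp (-(δ * (geo9K x.toKIdx).dist y'' yL)) := mul_nonneg (mul_nonneg hBc (hw y'')) (Real.exp_nonneg _)
      have hcut : ∀ q, ιB (blkV1 x.toKIdx.hN x.toKIdx.D q) ≠ y'' → hh q * indB x.toKIdx ιB y'' q = 0 := fun q hq => by
        unfold indB; rw [if_neg hq, mul_zero]
      have hhs' : ∀ q, |hh q * indB x.toKIdx ιB y'' q| ≤ s := fun q => by
        obtain ⟨h0, h1⟩ := indB_nonneg_le_one x.toKIdx ιB y'' q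
        rw [abs_mul, abs_of_nonneg h0]
        exact (mul_le_of_le_one_right (abs_nonneg _) h1).trans (hhs q)
      have hb := l2OfY_liftY_le_of_hasL2Majorant_conjB x.toKIdx ιB b hM₂ hrepr Rr Hp T _ hT J (E : 𝔸) _ y'' yL hE hK0 hs0 hoff hcut hhs'
      refine hb.trans ?_
      have hl2 : 0 ≤ (geo9K x.toKIdx).l2Norm (.inr J) := geo9K_l2Norm_nonneg x.toKIdx _
      refine mul_le_mul_of_nonneg_right (mul_le_mul_of_nonneg_right (mul_le_mul_of_nonneg_left ?_ hcL0) hs0) hl2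
      exact mul_le_mul (mul_le_mul_of_nonneg_left (hwle y'' hy'') hBc) (hgeo y'' hy'') (Real.exp_nonneg _)
        (mul_nonneg hBc (mul_nonneg (by positivity) (pref6_nonneg (hlen0 y).le n)))
    have hcard : ((N.card : ℕ) : ℝ) ≤ (mN : ℝ) := by exact_mod_cast hnbr y
    have hT0 : 0 ≤ cL * (Bc * (L2 * B9.pref6 ((geo9K x.toKIdx).len y) n) * (Real.exp δ * Real.exp (-(δ * (geo9K x.toKIdx).dist y y')))) * s *
        (geo9K x.toKIdx).l2Norm (.inr J) :=
      mul_nonneg (mul_nonneg (mul_nonneg hcL0 (mul_nonneg (mul_nonneg hBc (mul_nonneg (by positivity) (pref6_nonneg (hlen0 y).le n)))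
        (by positivity))) hs0) (geo9K_l2Norm_nonneg x.toKIdx _)
    calc l2OfY hh (T (liftY J (E : 𝔸))) ≤ ∑ y'' ∈ N, l2OfY (fun q => hh q * indB x.toKIdx ιB y'' q) (T (liftY J (E : 𝔸))) := hsplit
      _ ≤ ∑ _y'' ∈ N, cL * (Bc * (L2 * B9.pref6 ((geo9K x.toKIdx).len y) n) * (Real.exp δ * Real.exp (-(δ * (geo9K x.toKIdx).dist y y')))) * s *
            (geo9K x.toKIdx).l2Norm (.inr J) := Finset.sum_le_sum hterm
      _ = (N.card : ℝ) * (cL * (Bc * (L2 * B9.pref6 ((geo9K x.toKIdx).len y) n) * (Real.exp δ * Real.exp (-(δ * (geo9K x.toKIdx).dist y y')))) * s *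
            (geo9K x.toKIdx).l2Norm (.inr J)) := by rw [Finset.sum_const, nsmul_eq_mul]
      _ ≤ (mN : ℝ) * (cL * (Bc * (L2 * B9.pref6 ((geo9K x.toKIdx).len y) n) * (Real.exp δ * Real.exp (-(δ * (geo9K x.toKIdx).dist y y')))) * s *
            (geo9K x.toKIdx).l2Norm (.inr J)) := mul_le_mul_of_nonneg_right hcard hT0
      _ = _ := by ring
  -- profile bookkeeping for the weights `ℓ², ℓ, 1` of the hypotheses against `pref6`
  have hw2 : ∀ y'' ∈ N, n = 0 → (geo9K x.toKIdx).len y'' ^ 2 ≤ L2 * B9.pref6 ((geo9K x.toKIdx).len y) n := by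
    intro y'' hy'' hn; subst hn; rw [mem_nbr] at hy''; exact pref6_nbr_le x hy'' 0
  have hw1 : ∀ y'' ∈ N, (n = 1 ∨ n = 2) → (geo9K x.toKIdx).len y'' ≤ L2 * B9.pref6 ((geo9K x.toKIdx).len y) n := by
    intro y'' hy'' hn; rw [mem_nbr] at hy''
    rcases hn with hn | hn <;> subst hn
    · exact pref6_nbr_le x hy'' 1
    · exact pref6_nbr_le x hy'' 2
  have hw0 : ∀ y'' ∈ N, (n = 3 ∨ n = 4 ∨ n = 5) → (1 : ℝ) ≤ L2 * B9.pref6 ((geo9K x.toKIdx).len y) n := by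
    intro y'' hy'' hn; rw [mem_nbr] at hy''
    rcases hn with hn | hn | hn <;> subst hn
    · exact pref6_nbr_le x hy'' 3
    · exact pref6_nbr_le x hy'' 4
    · exact pref6_nbr_le x hy'' 5
  -- the bound to prove, member by member
  have hRHS0 : 0 ≤ (mN : ℝ) * cL * L2 * Real.exp δ * Bc * B9.pref6 ((geo9K x.toKIdx).len y) n * s * Real.exp (-(δ * (geo9K x.toKIdx).dist y y')) *
      (geo9K x.toKIdx).l2Norm (.inr J) :=
    mul_nonneg (mul_nonneg (mul_nonneg (mul_nonneg (by positivity) (pref6_nonneg (hlen0 y).le n)) hs0) (Real.exp_nonneg _))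
      (geo9K_l2Norm_nonneg x.toKIdx _)
  show (KACU P G x OA parB C37 C38).l2 n (.prod U a) (.inr J) (.inr hh) ≤
    (mN : ℝ) * cL * L2 * Real.exp δ * Bc * B9.pref6 ((geo9K x.toKIdx).len y) n * s * Real.exp (-(δ * (geo9K x.toKIdx).dist y y')) * (geo9K x.toKIdx).l2Norm (.inr J)
  rw [KACU_l2_prod_eq, kernelFamilyB_l2_inr]
  -- the letters at the coded product: operator `OA(W)`, differences at `baseY (prod U a) = U` (`rfl`)
  -- pointwise agreement of the ℝ-linear words with the 𝔸-side words
  have eG : ∀ Λ, OA W Λ = Gb Λ := fun Λ => (hGb Λ).symm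
  have eD : ∀ ν Λ, cdB x.toKIdx U ν Λ = D ν Λ := fun ν Λ => (hD ν Λ).symm
  have eDs : ∀ ν Λ, cdsB x.toKIdx U ν Λ = Ds ν Λ := fun ν Λ => (hDs ν Λ).symm
  refine iSup_ball_le (fun E => ?_) hRHS0
  fin_cases n
  · show l2OfY hh (OA W (liftY J (E : 𝔸))) ≤ _
    rw [eG]
    exact piece Gb (fun a => (geo9K x.toKIdx).len a ^ 2) (fun a => sq_nonneg _) (fun y'' hy'' => hw2 y'' hy'' rfl) h0 E
  · show (⨆ ν : Fin (d + 1), l2OfY hh (cdB x.toKIdx U ν (OA W (liftY J (E : 𝔸))))) ≤ _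
    refine Real.iSup_le (fun ν => ?_) hRHS0
    rw [eG, eD]
    have hT := h1 ν
    rw [← B9Eq352DivFormLetters.conj_mul] at hT
    exact piece (D ν * Gb) (fun a => (geo9K x.toKIdx).len a) (fun a => (hlen0 a).le) (fun y'' hy'' => hw1 y'' hy'' (Or.inl rfl)) hT E
  · show (⨆ ν : Fin (d + 1), l2OfY hh (OA W (cdsB x.toKIdx U ν (liftY J (E : 𝔸))))) ≤ _
    refine Real.iSup_le (fun ν => ?_) hRHS0
    rw [eDs, eG]
    have hT := h2 ν
    rw [← B9Eq352DivFormLetters.conj_mul] at hT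
    exact piece (Gb * Ds ν) (fun a => (geo9K x.toKIdx).len a) (fun a => (hlen0 a).le) (fun y'' hy'' => hw1 y'' hy'' (Or.inr rfl)) hT E
  · show (⨆ ν : Fin (d + 1), ⨆ μ : Fin (d + 1), l2OfY hh (cdB x.toKIdx U ν (OA W (cdsB x.toKIdx U μ (liftY J (E : 𝔸)))))) ≤ _
    refine Real.iSup_le (fun ν => Real.iSup_le (fun μ => ?_) hRHS0) hRHS0
    rw [eDs, eG, eD]
    have hT := h3 ν μ
    rw [← B9Eq352DivFormLetters.conj_mul, ← B9Eq352DivFormLetters.conj_mul] at hT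
    exact piece (D ν * Gb * Ds μ) (fun _ => (1 : ℝ)) (fun _ => zero_le_one) (fun y'' hy'' => hw0 y'' hy'' (Or.inl rfl))
      (hasL2Majorant_mono (g := toB6 (geo9K x.toKIdx) Rr Hp) _ hT fun a a' => le_of_eq (by ring)) E
  · show (⨆ ν : Fin (d + 1), ⨆ μ : Fin (d + 1), l2OfY hh (cdB x.toKIdx U ν (cdB x.toKIdx U μ (OA W (liftY J (E : 𝔸)))))) ≤ _
    refine Real.iSup_le (fun ν => Real.iSup_le (fun μ => ?_) hRHS0) hRHS0
    rw [eG, eD, eD]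
    have hT := h4 ν μ
    rw [← B9Eq352DivFormLetters.conj_mul, ← B9Eq352DivFormLetters.conj_mul] at hT
    exact piece (D ν * D μ * Gb) (fun _ => (1 : ℝ)) (fun _ => zero_le_one) (fun y'' hy'' => hw0 y'' hy'' (Or.inr (Or.inl rfl)))
      (hasL2Majorant_mono (g := toB6 (geo9K x.toKIdx) Rr Hp) _ hT fun a a' => le_of_eq (by ring)) E
  · show (⨆ ν : Fin (d + 1), ⨆ μ : Fin (d + 1), l2OfY hh (OA W (cdsB x.toKIdx U ν (cdsB x.toKIdx U μ (liftY J (E : 𝔸)))))) ≤ _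
    refine Real.iSup_le (fun ν => Real.iSup_le (fun μ => ?_) hRHS0) hRHS0
    rw [eDs, eDs, eG]
    have hT := h5 ν μ
    rw [← B9Eq352DivFormLetters.conj_mul, ← B9Eq352DivFormLetters.conj_mul] at hT
    exact piece (Gb * Ds ν * Ds μ) (fun _ => (1 : ℝ)) (fun _ => zero_le_one) (fun y'' hy'' => hw0 y'' hy'' (Or.inr (Or.inr rfl)))
      (hasL2Majorant_mono (g := toB6 (geo9K x.toKIdx) Rr Hp) _ hT fun a a' => le_of_eq (by ring)) E

end Coded

end Literature.MathematicalPhysics.QuantumFieldTheory.Balaban1983to89.B9SectBL2GReadYR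

end

/-!
# `Balaban1983to89.B9SectBL2GReadCodedYR` — THE CLASS-PARAMETRIC TWIN of `B9SectBL2GReadCodedY` (CASCADE-R, director-ym №279 GO-R; №277 (3) `hunitA` cure; dag-n06-d SOCKET-(α) class question)

statement-level skeleton of published theorems with citation tags; proofs where landed; nothing here is a claim about the
Yang–Mills mass gap

WHAT THIS FILE IS.  The original module `B9SectBL2GReadCodedY` types its objects over MODULE 3's member carrier `bg9Y 𝔸 G x` (MODULE 2's small-cube class (3.35)).  This file RE-DECLARES, with UNCHANGED NAMES inside the namespace `…B9SectBL2GReadCodedYR`, exactly its 2 class-dependent declarations over the CLASS-PARAMETRIC carrier `B9SectBCodedClassR.bg9YC 𝔸 G P x` (`P : RegExtraY …` = the two cube conditions of (3.35)∕(3.36) as a parameter; `bg9Y 𝔸 G x = bg9YC 𝔸 G (extraY 𝔸 G) x` by `rfl`, so every declaration here specialises definitionally to its original; at the record's reading of PRINT's class, `P := extraYPb 𝔸 G`, the displayed laws `hreg335P` ((3.35) on plaquettes) and the class-keyed `hunitA` become theorems).  The text is the original's VERBATIM under the token surgery `bg9Y 𝔸 G ↦ bg9YC 𝔸 G P`, `NAME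 ↦ NAME P` for the class-dependent names (P the first explicit argument), and — №277 — the binder `hunitA` re-keyed from «all G-valued U» to «all (3.35)-regular U of the carrier» (`∀ j α₀ U, (bg9YC 𝔸 G P (f j)).Reg335 c35 α₀ U → IsUnit (deltaAY …)`) — a clause IDLE in this twin (no `hunitA` here; v1.1).  Class-free declarations of the original are NOT copied: they are imported and used BY NAME (`open … hiding` the re-declared ones).  Generated by dag-n06-c g16's `gen.py` (HOME `pub-ymgap-dag-n06-c/lean/g16/`); the ORIGINAL MODULE DOCUMENTATION FOLLOWS VERBATIM and describes the mathematics.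

HONEST SCOPE.  Re-typing bookkeeping; nothing of [B9] asserted beyond the original; COUNT-NEUTRAL; N06 NOT discharged; nothing continuum ∕ OS ∕ mass gap ∕ Clay.  Cell `pub-ymgap` (D-0062), Track A node N06 [B9], seat `pub-ymgap-dag-n06-c` g16, 2026-08-29.
-/

/-! Module documentation: that of the original `Balaban1983to89.B9SectBL2GReadCodedY` applies verbatim to this twin (not repeated here). -/

noncomputable section

namespace Literature.MathematicalPhysics.QuantumFieldTheory.Balaban1983to89.B9SectBL2GReadCodedYR

open Literature.MathematicalPhysics.QuantumFieldTheory.Balaban1983to89.B9SectBCodedClassR (RegExtraY bg9YC)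
open Literature.MathematicalPhysics.QuantumFieldTheory.Balaban1983to89.B9SectBL2GReadCodedY hiding readGL2_GbC_printed writeGL2_GbC

open B6Ineq2142KLevelV1 (β)
open B6GlobalChartV1 (blkV1)
open B6KLevelCensusIndexV1 (KIdx kGeo)
open B6RandomWalk (blockPiece)
open B6RandomWalkL2 (l2n l2n_sq l2n_smul HasL2Majorant hasL2Majorant_mono)
open B9Thm34Ext (toB6)
open B9FromB6 (L2Block)
open B9GeoNormsKLevelV1 (geo9K)
open B9Eq352DivFormLetters (conj coordEquiv conj_apply conj_neg)
open B9Eq352GradLetters (diffLetter)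
open B9Eq371GradLetters (bT bU)
open B9CoReadingCoords (cdBₗ cdsBₗ cdBₗ_apply cdsBₗ_apply)
open B9PinMembersKLevelV1 (MemberY geo9Y bg9Y)
open B9Eq360DeltaPrimeAY (AfldY)
open B9SectBGpFrameCodedYR (codingYx)
open B9SectBGpLettersY (GVal decY decY_base coordC blkC)
open B9SectBL2DictionaryY (coordC_base_eq)
open B9SectBCodedCarrier (CCfg)
open B9SectBCodedReadingsUR (KACU)
open B9SectBGWordDeltaAY (bondOpCoordsRY bondOpCoordsRY_apply GbC)
open B9SectBGReadCodedY (bondReindexY blkC_bondReindexY conj_bondOpCoordsRY_apply bondOpCoordsRY_mul bondOpCoordsRY_cdBₗ bondOpCoordsRY_cdsBₗ diffLetter_abs_eq eta_inv_eq_abs_cf GbC_eq_conj_bondOpCoordsRY)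
open B9SectBL2GReadYR (readGL2Y_KACU writeGL2Y_KACU)
open B9RWSumsReadsNbr (nbr)
open Node00 (SiteY BlkY FBondY IBondY CfgY BondOpY BondParY UboxY shiftY cdB cdsB GAY GpY SiteParY)

variable {d ℓ : ℕ} {hd : 1 ≤ d + 1} {hL : Odd (ℓ + 1) ∧ 1 < ℓ + 1} {b₀ b₁ : ℝ} {Mstar : ℕ}
variable {𝔸 : Type} [NormedRing 𝔸] (P : RegExtraY d ℓ hd hL b₀ b₁ Mstar 𝔸) [NormedAlgebra ℂ 𝔸] [CompleteSpace 𝔸]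
variable {ι : Type} [Fintype ι]

/-! ## §1 The `ℓ²` reindexing, signs and units -/

section Reindex

variable {g : B6.Geometry} {X X' : Type} [Fintype X] [Fintype X']

end Reindex

/-! ## §2 The two carrier transports -/

section Bond

variable (i : KIdx d ℓ hd hL b₀ b₁) (b : Module.Basis ι ℝ 𝔸) {Rr : ℝ} {Hp : Prop} [Fintype (geo9K i).Site] (ιB : BlkY i → IBondY i)

end Bond

/-! ## §3 The signs of def-Y's difference letters against r06's at the constant `|c_f|` -/

section Signs

variable (i : KIdx d ℓ hd hL b₀ b₁) (b : Module.Basis ι ℝ 𝔸)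

end Signs

/-! ## §4 ★★ The printed-orientation halves of the fields `readGL2` ∕ `writeGL2` at the letters `GbC` -/

section Fields

variable (G : Subgroup 𝔸ˣ) (x : MemberY d ℓ hd hL b₀ b₁ Mstar) (parS : SiteParY 𝔸 x.toKIdx) (parB : BondParY 𝔸 x.toKIdx)
  (b : Module.Basis ι ℝ 𝔸) (ιB : BlkY x.toKIdx → IBondY x.toKIdx) (C37 C38 : ℝ → CfgY 𝔸 x.toKIdx → AfldY 𝔸 x.toKIdx → Prop)
  [Fintype (geo9Y x).Site] [DecidableEq (geo9Y x).Site] {Rr : ℝ} {Hp : Prop}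

/-- ★★ **FIELD `readGL2` OF THE `L²` FRAME AT NODE 00's LETTERS, PRINT's ORIENTATIONS** (at a `G`-valued base `U`): the (3.46) block of
`KACU G x (GAY parS parB (GpY parS)) parB C37 C38` at `base U` with `(B₀, δ)` gives block-ℓ² majorants on `(κ × SiteY) × ι` with `(c_L·B₀, δ)`, `c_L =
√|ι|·M₂·Σ_j‖b_j‖`, of `GbC` (weight `ℓ²`), `∇♯_{inl ν}·GbC`, `GbC·∇♯_{inr ν}` (weight `ℓ`), `∇♯_{inl ν}·GbC·∇♯_{inr μ}`, `∇♯_{inl ν}·∇♯_{inl μ}·GbC`,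
`GbC·∇♯_{inr ν}·∇♯_{inr μ}` (weight `1`) — the six printed words; letters `∇♯_k = conj b (diffLetter (bT shiftY) (bU (coordC (base U))) η⁻¹ k)`.
[cite: Balaban1985BackgroundPropagators, Thm 3.3 p.399 with (3.46) p.398, Thm 3.4 p.400; Balaban1984PropagatorsII, Prop. 2.6 (2.140) p.247, (2.51) p.232] -/
theorem readGL2_GbC_printed [FiniteDimensional ℝ 𝔸] (hι : ∀ s, β x.toKIdx.hN x.toKIdx.D x.toKIdx.hk (ιB s) = s)
    {M₂ : ℝ} (hM₂ : 0 ≤ M₂) (hrepr : ∀ (v : 𝔸) (j : ι), |b.repr v j| ≤ M₂ * ‖v‖) (U : CfgY 𝔸 x.toKIdx) (hUG : GVal G x.toKIdx U)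
    {B₀ δ : ℝ} (hB₀ : 0 ≤ B₀) (hL2 : L2Block (KACU P G x (GAY x.toKIdx parS parB (GpY x.toKIdx parS)) parB C37 C38) B₀ δ (.base U)) :
    HasL2Majorant (g := toB6 (geo9Y x) Rr Hp) (fun q : (Fin (d + 1) × SiteY x.toKIdx) × ι => blkC x.toKIdx ιB q.1.2) (GbC x.toKIdx parS parB b (.base U)) (fun a a' => (Real.sqrt (Fintype.card ι) * M₂ * ∑ j, ‖b j‖) * B₀ * (geo9Y x).len a ^ 2 * Real.exp (-(δ * (geo9Y x).dist a a'))) ∧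
      (∀ ν, HasL2Majorant (g := toB6 (geo9Y x) Rr Hp) (fun q : (Fin (d + 1) × SiteY x.toKIdx) × ι => blkC x.toKIdx ιB q.1.2)
        (conj b (diffLetter (bT (shiftY x.toKIdx)) (bU (coordC G x.toKIdx (.base U))) (((((geo9Y x).eta : ℂ)))⁻¹) (Sum.inl ν)) * GbC x.toKIdx parS parB b (.base U)) (fun a a' => (Real.sqrt (Fintype.card ι) * M₂ * ∑ j, ‖b j‖) * B₀ * (geo9Y x).len a * Real.exp (-(δ * (geo9Y x).dist a a')))) ∧
      (∀ ν, HasL2Majorant (g := toB6 (geo9Y x) Rr Hp) (fun q : (Fin (d + 1) × SiteY x.toKIdx) × ι => blkC x.toKIdx ιB q.1.2)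
        (GbC x.toKIdx parS parB b (.base U) * conj b (diffLetter (bT (shiftY x.toKIdx)) (bU (coordC G x.toKIdx (.base U))) (((((geo9Y x).eta : ℂ)))⁻¹) (Sum.inr ν))) (fun a a' => (Real.sqrt (Fintype.card ι) * M₂ * ∑ j, ‖b j‖) * B₀ * (geo9Y x).len a * Real.exp (-(δ * (geo9Y x).dist a a')))) ∧
      (∀ ν μ, HasL2Majorant (g := toB6 (geo9Y x) Rr Hp) (fun q : (Fin (d + 1) × SiteY x.toKIdx) × ι => blkC x.toKIdx ιB q.1.2)
        (conj b (diffLetter (bT (shiftY x.toKIdx)) (bU (coordC G x.toKIdx (.base U))) (((((geo9Y x).eta : ℂ)))⁻¹) (Sum.inl ν)) * GbC x.toKIdx parS parB b (.base U) *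
          conj b (diffLetter (bT (shiftY x.toKIdx)) (bU (coordC G x.toKIdx (.base U))) (((((geo9Y x).eta : ℂ)))⁻¹) (Sum.inr μ))) (fun a a' => (Real.sqrt (Fintype.card ι) * M₂ * ∑ j, ‖b j‖) * B₀ * 1 * Real.exp (-(δ * (geo9Y x).dist a a')))) ∧
      (∀ ν μ, HasL2Majorant (g := toB6 (geo9Y x) Rr Hp) (fun q : (Fin (d + 1) × SiteY x.toKIdx) × ι => blkC x.toKIdx ιB q.1.2)
        (conj b (diffLetter (bT (shiftY x.toKIdx)) (bU (coordC G x.toKIdx (.base U))) (((((geo9Y x).eta : ℂ)))⁻¹) (Sum.inl ν)) *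
          conj b (diffLetter (bT (shiftY x.toKIdx)) (bU (coordC G x.toKIdx (.base U))) (((((geo9Y x).eta : ℂ)))⁻¹) (Sum.inl μ)) * GbC x.toKIdx parS parB b (.base U)) (fun a a' => (Real.sqrt (Fintype.card ι) * M₂ * ∑ j, ‖b j‖) * B₀ * 1 * Real.exp (-(δ * (geo9Y x).dist a a')))) ∧
      (∀ ν μ, HasL2Majorant (g := toB6 (geo9Y x) Rr Hp) (fun q : (Fin (d + 1) × SiteY x.toKIdx) × ι => blkC x.toKIdx ιB q.1.2)
        (GbC x.toKIdx parS parB b (.base U) * conj b (diffLetter (bT (shiftY x.toKIdx)) (bU (coordC G x.toKIdx (.base U))) (((((geo9Y x).eta : ℂ)))⁻¹) (Sum.inr ν)) *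
          conj b (diffLetter (bT (shiftY x.toKIdx)) (bU (coordC G x.toKIdx (.base U))) (((((geo9Y x).eta : ℂ)))⁻¹) (Sum.inr μ))) (fun a a' => (Real.sqrt (Fintype.card ι) * M₂ * ∑ j, ‖b j‖) * B₀ * 1 * Real.exp (-(δ * (geo9Y x).dist a a')))) := by
  letI : Fintype (geo9K x.toKIdx).Site := ‹Fintype (geo9Y x).Site›
  letI : DecidableEq (geo9K x.toKIdx).Site := ‹DecidableEq (geo9Y x).Site›
  obtain ⟨h0, h1, h2, h3, h4, h5⟩ := readGL2Y_KACU P (Rr := Rr) (Hp := Hp) b G x (GAY x.toKIdx parS parB (GpY x.toKIdx parS)) parB C37 C38 ιB hι hM₂ hrepr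
    hB₀ hL2
  have hco : coordC G x.toKIdx (.base U) = UboxY x.toKIdx U := coordC_base_eq G x hUG
  have hη : (((((geo9Y x).eta : ℂ))))⁻¹ = ((|x.toKIdx.cf| : ℝ) : ℂ) := eta_inv_eq_abs_cf x.toKIdx
  have hGb : GbC x.toKIdx parS parB b (.base U) = conj b (bondOpCoordsRY x.toKIdx ((GAY x.toKIdx parS parB (GpY x.toKIdx parS) U).restrictScalars ℝ)) := by
    have h := GbC_eq_conj_bondOpCoordsRY x parS parB b (.base U)
    rw [decY_base] at h
    exact h
  -- def-Y's difference letters against the frame's, with their signs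
  have hDl : ∀ ν, ∃ ε : ℝ, |ε| = 1 ∧ conj b (bondOpCoordsRY x.toKIdx (cdBₗ x.toKIdx U ν)) =
      ε • conj b (diffLetter (bT (shiftY x.toKIdx)) (bU (coordC G x.toKIdx (.base U))) (((((geo9Y x).eta : ℂ)))⁻¹) (Sum.inl ν)) := fun ν => by
    rw [hco, hη]; exact exists_sign_cdBₗ x.toKIdx b U ν
  have hDr : ∀ ν, ∃ ε : ℝ, |ε| = 1 ∧ conj b (bondOpCoordsRY x.toKIdx (cdsBₗ x.toKIdx U ν)) =
      ε • conj b (diffLetter (bT (shiftY x.toKIdx)) (bU (coordC G x.toKIdx (.base U))) (((((geo9Y x).eta : ℂ)))⁻¹) (Sum.inr ν)) := fun ν => by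
    rw [hco, hη]; exact exists_sign_cdsBₗ x.toKIdx b U ν
  -- reshaping of the kernels `cL * (B₀ * pref6 n * e)` into the frame's `cL * B₀ * w * e`
  have hK : ∀ (w : IBondY x.toKIdx → ℝ) (n : Fin 6), (∀ a, B9.pref6 ((geo9Y x).len a) n = w a) →
      ∀ {T : Module.End ℝ ((Fin (d + 1) × SiteY x.toKIdx) × ι → ℝ)} {K : IBondY x.toKIdx → IBondY x.toKIdx → ℝ},
      (∀ a a', K a a' = (Real.sqrt (Fintype.card ι) * M₂ * ∑ j, ‖b j‖) *
        (B₀ * B9.pref6 ((geo9K x.toKIdx).len a) n * Real.exp (-(δ * (geo9K x.toKIdx).dist a a')))) →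
      HasL2Majorant (g := toB6 (geo9Y x) Rr Hp) (fun q : (Fin (d + 1) × SiteY x.toKIdx) × ι => blkC x.toKIdx ιB q.1.2) T K →
      HasL2Majorant (g := toB6 (geo9Y x) Rr Hp) (fun q : (Fin (d + 1) × SiteY x.toKIdx) × ι => blkC x.toKIdx ιB q.1.2) T
        (fun a a' => (Real.sqrt (Fintype.card ι) * M₂ * ∑ j, ‖b j‖) * B₀ * w a * Real.exp (-(δ * (geo9Y x).dist a a'))) := by
    intro w n hw T K hKe h
    refine hasL2Majorant_mono (g := toB6 (geo9Y x) Rr Hp) _ h fun a a' => le_of_eq ?_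
    rw [hKe, ← hw a]
    show _ = (Real.sqrt (Fintype.card ι) * M₂ * ∑ j, ‖b j‖) * B₀ * B9.pref6 ((geo9K x.toKIdx).len a) n *
      Real.exp (-(δ * (geo9K x.toKIdx).dist a a'))
    ring
  refine ⟨?_, fun ν => ?_, fun ν => ?_, fun ν μ => ?_, fun ν μ => ?_, fun ν μ => ?_⟩
  · rw [hGb]
    exact hK (fun a => (geo9Y x).len a ^ 2) 0 (fun a => rfl) (fun a a' => rfl) (hasL2Majorant_conj_bondOpCoordsRY x.toKIdx b ιB _ h0)
  · obtain ⟨ε, hε, hD⟩ := hDl ν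
    have h := hasL2Majorant_conj_bondOpCoordsRY x.toKIdx b ιB _ (h1 ν)
    rw [← Module.End.mul_eq_comp, bondOpCoordsRY_mul, B9Eq352DivFormLetters.conj_mul, hD, ← hGb] at h
    simp only [smul_mul_assoc] at h
    exact hK (fun a => (geo9Y x).len a) 1 (fun a => rfl) (fun a a' => rfl) (hasL2Majorant_smul_unit _ hε h)
  · obtain ⟨ε, hε, hD⟩ := hDr ν
    have h := hasL2Majorant_conj_bondOpCoordsRY x.toKIdx b ιB _ (h2 ν)
    rw [← Module.End.mul_eq_comp, bondOpCoordsRY_mul, B9Eq352DivFormLetters.conj_mul, hD, ← hGb] at h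
    simp only [mul_smul_comm] at h
    exact hK (fun a => (geo9Y x).len a) 2 (fun a => rfl) (fun a a' => rfl) (hasL2Majorant_smul_unit _ hε h)
  · obtain ⟨ε, hε, hD⟩ := hDl ν
    obtain ⟨ε', hε', hD'⟩ := hDr μ
    have h := hasL2Majorant_conj_bondOpCoordsRY x.toKIdx b ιB _ (h3 ν μ)
    rw [← Module.End.mul_eq_comp, ← Module.End.mul_eq_comp, bondOpCoordsRY_mul, bondOpCoordsRY_mul, B9Eq352DivFormLetters.conj_mul,
      B9Eq352DivFormLetters.conj_mul, hD, hD', ← hGb] at h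
    simp only [smul_mul_assoc, mul_smul_comm, smul_smul, ← mul_assoc] at h
    exact hK (fun _ => (1 : ℝ)) 3 (fun a => rfl) (fun a a' => by ring) (hasL2Majorant_smul_unit₂ _ (by assumption) (by assumption) h)
  · obtain ⟨ε, hε, hD⟩ := hDl ν
    obtain ⟨ε', hε', hD'⟩ := hDl μ
    have h := hasL2Majorant_conj_bondOpCoordsRY x.toKIdx b ιB _ (h4 ν μ)
    rw [← Module.End.mul_eq_comp, ← Module.End.mul_eq_comp, bondOpCoordsRY_mul, bondOpCoordsRY_mul, B9Eq352DivFormLetters.conj_mul,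
      B9Eq352DivFormLetters.conj_mul, hD, hD', ← hGb] at h
    simp only [smul_mul_assoc, mul_smul_comm, smul_smul, ← mul_assoc] at h
    exact hK (fun _ => (1 : ℝ)) 4 (fun a => rfl) (fun a a' => by ring) (hasL2Majorant_smul_unit₂ _ (by assumption) (by assumption) h)
  · obtain ⟨ε, hε, hD⟩ := hDr ν
    obtain ⟨ε', hε', hD'⟩ := hDr μ
    have h := hasL2Majorant_conj_bondOpCoordsRY x.toKIdx b ιB _ (h5 ν μ)
    rw [← Module.End.mul_eq_comp, ← Module.End.mul_eq_comp, bondOpCoordsRY_mul, bondOpCoordsRY_mul, B9Eq352DivFormLetters.conj_mul,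
      B9Eq352DivFormLetters.conj_mul, hD, hD', ← hGb] at h
    simp only [smul_mul_assoc, mul_smul_comm, smul_smul, ← mul_assoc] at h
    exact hK (fun _ => (1 : ℝ)) 5 (fun a => rfl) (fun a a' => by ring) (hasL2Majorant_smul_unit₂ _ (by assumption) (by assumption) h)

/-- ★★ **FIELD `writeGL2` OF THE `L²` FRAME AT NODE 00's LETTERS, PRINT's ORIENTATIONS**: at a (base `U`, multiplier `a`) pair with `U` `G`-valued, block-ℓ²
majorants at the coded product (`GbC (prod U a)`; difference letters `∇♯_k` at the BASE) with `(B, δ)` of the six printed words give the (3.46) block of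
`KACU` at `prod U a` with `(c_W·B, δ)`, `c_W = m_N·c_L·L²·e^{δ}` (gen 14's writer `writeGL2Y_KACU` transported).
[cite: Balaban1985BackgroundPropagators, Thm 3.4 p.400 with (3.46) p.398, p.403; Balaban1984PropagatorsII, Prop. 2.6 (2.140) p.247, (2.51) p.232] -/
theorem writeGL2_GbC (hι : ∀ s, β x.toKIdx.hN x.toKIdx.D x.toKIdx.hk (ιB s) = s)
    {M₂ : ℝ} (hM₂ : 0 ≤ M₂) (hrepr : ∀ (v : 𝔸) (j : ι), |b.repr v j| ≤ M₂ * ‖v‖)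
    {mN : ℕ} (hnbr : ∀ y : IBondY x.toKIdx, (nbr (geo9Y x) 1 y).card ≤ mN)
    (U : CfgY 𝔸 x.toKIdx) (hUG : GVal G x.toKIdx U) (a : AfldY 𝔸 x.toKIdx) {B δ : ℝ} (hB : 0 ≤ B) (hδ : 0 ≤ δ)
    (h0 : HasL2Majorant (g := toB6 (geo9Y x) Rr Hp) (fun q : (Fin (d + 1) × SiteY x.toKIdx) × ι => blkC x.toKIdx ιB q.1.2) (GbC x.toKIdx parS parB b (.prod U a)) (fun a a' => B * (geo9Y x).len a ^ 2 * Real.exp (-(δ * (geo9Y x).dist a a'))))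
    (h1 : ∀ ν, HasL2Majorant (g := toB6 (geo9Y x) Rr Hp) (fun q : (Fin (d + 1) × SiteY x.toKIdx) × ι => blkC x.toKIdx ιB q.1.2)
        (conj b (diffLetter (bT (shiftY x.toKIdx)) (bU (coordC G x.toKIdx (.base U))) (((((geo9Y x).eta : ℂ)))⁻¹) (Sum.inl ν)) * GbC x.toKIdx parS parB b (.prod U a)) (fun a a' => B * (geo9Y x).len a * Real.exp (-(δ * (geo9Y x).dist a a'))))
    (h2 : ∀ ν, HasL2Majorant (g := toB6 (geo9Y x) Rr Hp) (fun q : (Fin (d + 1) × SiteY x.toKIdx) × ι => blkC x.toKIdx ιB q.1.2)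
        (GbC x.toKIdx parS parB b (.prod U a) * conj b (diffLetter (bT (shiftY x.toKIdx)) (bU (coordC G x.toKIdx (.base U))) (((((geo9Y x).eta : ℂ)))⁻¹) (Sum.inr ν))) (fun a a' => B * (geo9Y x).len a * Real.exp (-(δ * (geo9Y x).dist a a'))))
    (h3 : ∀ ν μ, HasL2Majorant (g := toB6 (geo9Y x) Rr Hp) (fun q : (Fin (d + 1) × SiteY x.toKIdx) × ι => blkC x.toKIdx ιB q.1.2)
        (conj b (diffLetter (bT (shiftY x.toKIdx)) (bU (coordC G x.toKIdx (.base U))) (((((geo9Y x).eta : ℂ)))⁻¹) (Sum.inl ν)) * GbC x.toKIdx parS parB b (.prod U a) *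
          conj b (diffLetter (bT (shiftY x.toKIdx)) (bU (coordC G x.toKIdx (.base U))) (((((geo9Y x).eta : ℂ)))⁻¹) (Sum.inr μ))) (fun a a' => B * 1 * Real.exp (-(δ * (geo9Y x).dist a a'))))
    (h4 : ∀ ν μ, HasL2Majorant (g := toB6 (geo9Y x) Rr Hp) (fun q : (Fin (d + 1) × SiteY x.toKIdx) × ι => blkC x.toKIdx ιB q.1.2)
        (conj b (diffLetter (bT (shiftY x.toKIdx)) (bU (coordC G x.toKIdx (.base U))) (((((geo9Y x).eta : ℂ)))⁻¹) (Sum.inl ν)) *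
          conj b (diffLetter (bT (shiftY x.toKIdx)) (bU (coordC G x.toKIdx (.base U))) (((((geo9Y x).eta : ℂ)))⁻¹) (Sum.inl μ)) * GbC x.toKIdx parS parB b (.prod U a)) (fun a a' => B * 1 * Real.exp (-(δ * (geo9Y x).dist a a'))))
    (h5 : ∀ ν μ, HasL2Majorant (g := toB6 (geo9Y x) Rr Hp) (fun q : (Fin (d + 1) × SiteY x.toKIdx) × ι => blkC x.toKIdx ιB q.1.2)
        (GbC x.toKIdx parS parB b (.prod U a) * conj b (diffLetter (bT (shiftY x.toKIdx)) (bU (coordC G x.toKIdx (.base U))) (((((geo9Y x).eta : ℂ)))⁻¹) (Sum.inr ν)) *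
          conj b (diffLetter (bT (shiftY x.toKIdx)) (bU (coordC G x.toKIdx (.base U))) (((((geo9Y x).eta : ℂ)))⁻¹) (Sum.inr μ))) (fun a a' => B * 1 * Real.exp (-(δ * (geo9Y x).dist a a')))) :
    L2Block (KACU P G x (GAY x.toKIdx parS parB (GpY x.toKIdx parS)) parB C37 C38)
      ((mN : ℝ) * (Real.sqrt (Fintype.card ι) * M₂ * ∑ j, ‖b j‖) * (((ℓ + 1 : ℕ) : ℝ)) ^ 2 * Real.exp δ * B) δ (.prod U a) := by
  letI : Fintype (geo9K x.toKIdx).Site := ‹Fintype (geo9Y x).Site›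
  letI : DecidableEq (geo9K x.toKIdx).Site := ‹DecidableEq (geo9Y x).Site›
  have hco : coordC G x.toKIdx (.base U) = UboxY x.toKIdx U := coordC_base_eq G x hUG
  have hη : (((((geo9Y x).eta : ℂ))))⁻¹ = ((|x.toKIdx.cf| : ℝ) : ℂ) := eta_inv_eq_abs_cf x.toKIdx
  set W := decY x.toKIdx (.prod U a) with hW
  set O := (GAY x.toKIdx parS parB (GpY x.toKIdx parS) W).restrictScalars ℝ with hO
  have hGb : GbC x.toKIdx parS parB b (.prod U a) = conj b (bondOpCoordsRY x.toKIdx O) := GbC_eq_conj_bondOpCoordsRY x parS parB b (.prod U a)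
  -- the frame's letters ARE unit multiples of def-Y's transported ones
  have hDl : ∀ ν, ∃ ε : ℝ, |ε| = 1 ∧ conj b (diffLetter (bT (shiftY x.toKIdx)) (bU (coordC G x.toKIdx (.base U))) (((((geo9Y x).eta : ℂ)))⁻¹) (Sum.inl ν)) =
      ε • conj b (bondOpCoordsRY x.toKIdx (cdBₗ x.toKIdx U ν)) := fun ν => by
    obtain ⟨ε, hε, h⟩ := exists_sign_cdBₗ x.toKIdx b U ν
    have hεε : ε * ε = 1 := by nlinarith [abs_mul_abs_self ε, sq_abs ε]
    refine ⟨ε, hε, ?_⟩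
    rw [hco, hη, h, smul_smul, hεε, one_smul]
  have hDr : ∀ ν, ∃ ε : ℝ, |ε| = 1 ∧ conj b (diffLetter (bT (shiftY x.toKIdx)) (bU (coordC G x.toKIdx (.base U))) (((((geo9Y x).eta : ℂ)))⁻¹) (Sum.inr ν)) =
      ε • conj b (bondOpCoordsRY x.toKIdx (cdsBₗ x.toKIdx U ν)) := fun ν => by
    obtain ⟨ε, hε, h⟩ := exists_sign_cdsBₗ x.toKIdx b U ν
    have hεε : ε * ε = 1 := by nlinarith [abs_mul_abs_self ε, sq_abs ε]
    refine ⟨ε, hε, ?_⟩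
    rw [hco, hη, h, smul_smul, hεε, one_smul]
  -- back to def-Y's carrier, word by word
  have back : ∀ {T : Module.End ℝ (FBondY x.toKIdx → 𝔸)} {K : IBondY x.toKIdx → IBondY x.toKIdx → ℝ} {ε : ℝ}, |ε| = 1 →
      HasL2Majorant (g := toB6 (geo9Y x) Rr Hp) (fun q : (Fin (d + 1) × SiteY x.toKIdx) × ι => blkC x.toKIdx ιB q.1.2) (ε • conj b (bondOpCoordsRY x.toKIdx T)) K →
      HasL2Majorant (g := toB6 (geo9K x.toKIdx) Rr Hp) (fun p : FBondY x.toKIdx × ι => ιB (blkV1 x.toKIdx.hN x.toKIdx.D p.1)) (conj b T) K :=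
    fun {T K ε} hε h => hasL2Majorant_conj_of_bondOpCoordsRY x.toKIdx b ιB _ (hasL2Majorant_smul_unit _ hε h)
  have back₂ : ∀ {T : Module.End ℝ (FBondY x.toKIdx → 𝔸)} {K : IBondY x.toKIdx → IBondY x.toKIdx → ℝ} {ε ε' : ℝ}, |ε| = 1 → |ε'| = 1 →
      HasL2Majorant (g := toB6 (geo9Y x) Rr Hp) (fun q : (Fin (d + 1) × SiteY x.toKIdx) × ι => blkC x.toKIdx ιB q.1.2)
        ((ε * ε') • conj b (bondOpCoordsRY x.toKIdx T)) K →
      HasL2Majorant (g := toB6 (geo9K x.toKIdx) Rr Hp) (fun p : FBondY x.toKIdx × ι => ιB (blkV1 x.toKIdx.hN x.toKIdx.D p.1)) (conj b T) K :=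
    fun {T K ε ε'} hε hε' h => hasL2Majorant_conj_of_bondOpCoordsRY x.toKIdx b ιB _ (hasL2Majorant_smul_unit₂ _ hε hε' h)
  have g0 : HasL2Majorant (g := toB6 (geo9K x.toKIdx) Rr Hp) (fun p : FBondY x.toKIdx × ι => ιB (blkV1 x.toKIdx.hN x.toKIdx.D p.1)) (conj b O)
      (fun a a' => B * (geo9K x.toKIdx).len a ^ 2 * Real.exp (-(δ * (geo9K x.toKIdx).dist a a'))) :=
    hasL2Majorant_conj_of_bondOpCoordsRY x.toKIdx b ιB _ (by rw [← hGb]; exact h0)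
  have g1 : ∀ ν, HasL2Majorant (g := toB6 (geo9K x.toKIdx) Rr Hp) (fun p : FBondY x.toKIdx × ι => ιB (blkV1 x.toKIdx.hN x.toKIdx.D p.1))
      (conj b (cdBₗ x.toKIdx U ν) * conj b O) (fun a a' => B * (geo9K x.toKIdx).len a * Real.exp (-(δ * (geo9K x.toKIdx).dist a a'))) := by
    intro ν
    obtain ⟨ε, hε, hD⟩ := hDl ν
    have h := h1 ν
    rw [hD, hGb] at h
    simp only [smul_mul_assoc, ← B9Eq352DivFormLetters.conj_mul, ← bondOpCoordsRY_mul] at h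
    have h' := back hε h
    rw [B9Eq352DivFormLetters.conj_mul] at h'
    exact h'
  have g2 : ∀ ν, HasL2Majorant (g := toB6 (geo9K x.toKIdx) Rr Hp) (fun p : FBondY x.toKIdx × ι => ιB (blkV1 x.toKIdx.hN x.toKIdx.D p.1))
      (conj b O * conj b (cdsBₗ x.toKIdx U ν)) (fun a a' => B * (geo9K x.toKIdx).len a * Real.exp (-(δ * (geo9K x.toKIdx).dist a a'))) := by
    intro ν
    obtain ⟨ε, hε, hD⟩ := hDr ν
    have h := h2 ν
    rw [hD, hGb] at h
    simp only [mul_smul_comm, ← B9Eq352DivFormLetters.conj_mul, ← bondOpCoordsRY_mul] at h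
    have h' := back hε h
    rw [B9Eq352DivFormLetters.conj_mul] at h'
    exact h'
  have g3 : ∀ ν μ, HasL2Majorant (g := toB6 (geo9K x.toKIdx) Rr Hp) (fun p : FBondY x.toKIdx × ι => ιB (blkV1 x.toKIdx.hN x.toKIdx.D p.1))
      (conj b (cdBₗ x.toKIdx U ν) * conj b O * conj b (cdsBₗ x.toKIdx U μ)) (fun a a' => B * 1 * Real.exp (-(δ * (geo9K x.toKIdx).dist a a'))) := by
    intro ν μ
    obtain ⟨ε, hε, hD⟩ := hDl ν
    obtain ⟨ε', hε', hD'⟩ := hDr μ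
    have h := h3 ν μ
    rw [hD, hD', hGb] at h
    simp only [smul_mul_assoc, mul_smul_comm, smul_smul, ← B9Eq352DivFormLetters.conj_mul, ← bondOpCoordsRY_mul] at h
    have h' : HasL2Majorant (g := toB6 (geo9K x.toKIdx) Rr Hp) (fun p : FBondY x.toKIdx × ι => ιB (blkV1 x.toKIdx.hN x.toKIdx.D p.1))
        (conj b (cdBₗ x.toKIdx U ν * O * cdsBₗ x.toKIdx U μ)) (fun a a' => B * 1 * Real.exp (-(δ * (geo9K x.toKIdx).dist a a'))) := by
      exact back₂ (by assumption) (by assumption) h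
    rw [B9Eq352DivFormLetters.conj_mul, B9Eq352DivFormLetters.conj_mul] at h'
    exact h'
  have g4 : ∀ ν μ, HasL2Majorant (g := toB6 (geo9K x.toKIdx) Rr Hp) (fun p : FBondY x.toKIdx × ι => ιB (blkV1 x.toKIdx.hN x.toKIdx.D p.1))
      (conj b (cdBₗ x.toKIdx U ν) * conj b (cdBₗ x.toKIdx U μ) * conj b O) (fun a a' => B * 1 * Real.exp (-(δ * (geo9K x.toKIdx).dist a a'))) := by
    intro ν μ
    obtain ⟨ε, hε, hD⟩ := hDl ν
    obtain ⟨ε', hε', hD'⟩ := hDl μ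
    have h := h4 ν μ
    rw [hD, hD', hGb] at h
    simp only [smul_mul_assoc, mul_smul_comm, smul_smul, ← B9Eq352DivFormLetters.conj_mul, ← bondOpCoordsRY_mul] at h
    have h' : HasL2Majorant (g := toB6 (geo9K x.toKIdx) Rr Hp) (fun p : FBondY x.toKIdx × ι => ιB (blkV1 x.toKIdx.hN x.toKIdx.D p.1))
        (conj b (cdBₗ x.toKIdx U ν * cdBₗ x.toKIdx U μ * O)) (fun a a' => B * 1 * Real.exp (-(δ * (geo9K x.toKIdx).dist a a'))) := by
      exact back₂ (by assumption) (by assumption) h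
    rw [B9Eq352DivFormLetters.conj_mul, B9Eq352DivFormLetters.conj_mul] at h'
    exact h'
  have g5 : ∀ ν μ, HasL2Majorant (g := toB6 (geo9K x.toKIdx) Rr Hp) (fun p : FBondY x.toKIdx × ι => ιB (blkV1 x.toKIdx.hN x.toKIdx.D p.1))
      (conj b O * conj b (cdsBₗ x.toKIdx U ν) * conj b (cdsBₗ x.toKIdx U μ)) (fun a a' => B * 1 * Real.exp (-(δ * (geo9K x.toKIdx).dist a a'))) := by
    intro ν μ
    obtain ⟨ε, hε, hD⟩ := hDr ν
    obtain ⟨ε', hε', hD'⟩ := hDr μ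
    have h := h5 ν μ
    rw [hD, hD', hGb] at h
    simp only [smul_mul_assoc, mul_smul_comm, smul_smul, ← B9Eq352DivFormLetters.conj_mul, ← bondOpCoordsRY_mul] at h
    have h' : HasL2Majorant (g := toB6 (geo9K x.toKIdx) Rr Hp) (fun p : FBondY x.toKIdx × ι => ιB (blkV1 x.toKIdx.hN x.toKIdx.D p.1))
        (conj b (O * cdsBₗ x.toKIdx U ν * cdsBₗ x.toKIdx U μ)) (fun a a' => B * 1 * Real.exp (-(δ * (geo9K x.toKIdx).dist a a'))) := by
      exact back₂ (by assumption) (by assumption) h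
    rw [B9Eq352DivFormLetters.conj_mul, B9Eq352DivFormLetters.conj_mul] at h'
    exact h'
  exact writeGL2Y_KACU P (Rr := Rr) (Hp := Hp) b G x (GAY x.toKIdx parS parB (GpY x.toKIdx parS)) parB C37 C38 ιB hι hM₂ hrepr hnbr U a
    O (fun Λ => rfl) (fun ν => cdBₗ x.toKIdx U ν) (fun ν => cdsBₗ x.toKIdx U ν) (fun ν Λ => cdBₗ_apply x.toKIdx U ν Λ)
    (fun ν Λ => cdsBₗ_apply x.toKIdx U ν Λ) hB hδ g0 g1 g2 g3 g4 g5

end Fields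

end Literature.MathematicalPhysics.QuantumFieldTheory.Balaban1983to89.B9SectBL2GReadCodedYR

end

/-!
# `Balaban1983to89.B9SectBL2GCrossYR` — THE CLASS-PARAMETRIC TWIN of `B9SectBL2GCrossY` (CASCADE-R, director-ym №279 GO-R; №277 (3) `hunitA` cure; dag-n06-d SOCKET-(α) class question)

statement-level skeleton of published theorems with citation tags; proofs where landed; nothing here is a claim about the
Yang–Mills mass gap

WHAT THIS FILE IS.  The original module `B9SectBL2GCrossY` types its objects over MODULE 3's member carrier `bg9Y 𝔸 G x` (MODULE 2's small-cube class (3.35)).  This file RE-DECLARES, with UNCHANGED NAMES inside the namespace `…B9SectBL2GCrossYR`, exactly its 1 class-dependent declarations over the CLASS-PARAMETRIC carrier `B9SectBCodedClassR.bg9YC 𝔸 G P x` (`P : RegExtraY …` = the two cube conditions of (3.35)∕(3.36) as a parameter; `bg9Y 𝔸 G x = bg9YC 𝔸 G (extraY 𝔸 G) x` by `rfl`, so every declaration here specialises definitionally to its original; at the record's reading of PRINT's class, `P := extraYPb 𝔸 G`, the displayed laws `hreg335P` ((3.35) on plaquettes) and the class-keyed `hunitA` become theorems).  The text is the original's VERBATIM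 under the token surgery `bg9Y 𝔸 G ↦ bg9YC 𝔸 G P`, `NAME ↦ NAME P` for the class-dependent names (P the first explicit argument), and — №277 — the binder `hunitA` re-keyed from «all G-valued U» to «all (3.35)-regular U of the carrier» (`∀ j α₀ U, (bg9YC 𝔸 G P (f j)).Reg335 c35 α₀ U → IsUnit (deltaAY …)`) — a clause IDLE in this twin (no `hunitA` here; v1.1).  Class-free declarations of the original are NOT copied: they are imported and used BY NAME (`open … hiding` the re-declared ones).  Generated by dag-n06-c g16's `gen.py` (HOME `pub-ymgap-dag-n06-c/lean/g16/`); the ORIGINAL MODULE DOCUMENTATION FOLLOWS VERBATIM and describes the mathematics.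

HONEST SCOPE.  Re-typing bookkeeping; nothing of [B9] asserted beyond the original; COUNT-NEUTRAL; N06 NOT discharged; nothing continuum ∕ OS ∕ mass gap ∕ Clay.  Cell `pub-ymgap` (D-0062), Track A node N06 [B9], seat `pub-ymgap-dag-n06-c` g16, 2026-08-29.
-/

/-! Module documentation: that of the original `Balaban1983to89.B9SectBL2GCrossY` applies verbatim to this twin (not repeated here). -/

noncomputable section

namespace Literature.MathematicalPhysics.QuantumFieldTheory.Balaban1983to89.B9SectBL2GCrossYR

open Literature.MathematicalPhysics.QuantumFieldTheory.Balaban1983to89.B9SectBCodedClassR (RegExtraY bg9YC)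
open Literature.MathematicalPhysics.QuantumFieldTheory.Balaban1983to89.B9SectBL2GCrossY hiding readGL2_GbC_all

open B6Ineq2142KLevelV1 (β)
open B6KLevelCensusIndexV1 (KIdx kGeo)
open B6RandomWalk (Triangle254 Ineq261)
open B6RandomWalkL2 (HasL2Majorant hasL2Majorant_mono)
open B9Thm34Ext (toB6)
open B9Ineq347 (ScaleTransfer)
open B9FromB6 (L2Block)
open B9Eq39Adjoint (R plaqU)
open B9Eq369Small (Through through_self)
open B9Eq352DivFormLetters (conj)
open B9Eq352GradLetters (diffLetter)
open B9Eq371GradLetters (bT bU)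
open B9Ineq363L2 (hasL2Majorant_rate_mono)
open B9PinMembersKLevelV1 (MemberY geo9Y bg9Y)
open B9Eq360DeltaPrimeAY (AfldY)
open B9SectBGpLettersY (GVal coordC blkC stencilF_blkC stencilB_blkC norm_le_one_and_inv_of_mem)
open B9SectBL2DictionaryY (coordC_base_eq)
open B9SectBCodedReadingsUR (KACU)
open B9SectBGWordDeltaAY (GbC)
open B9SectBGClassLettersY (Reg335PlaqY)
open B9SectBL2GReadCodedYR (readGL2_GbC_printed)
open B9SectBL2SecondOrderY (PlaqLawY plaqLawY_of_holonomy_bound shiftY_comm)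
open B9Eq38CrossLettersL2 (hasL2Majorant_cross_left hasL2Majorant_cross_right)
open B9Eq38SecondOrderCrossL2 (hasL2Majorant_cross2_left_inner hasL2Majorant_cross2_right_inner)
open B9Eq370SecondOrderConversionL2 (le_of_scaleTransfer)
open B9GeoLemma21KLevelV1 (geo9Y_dist_triangle geo9Y_len_pos geo9K_eta_pos geo9K_one_le_L)
open B9RWSums347DefiniteFacesWindow (geo9Y_dist_nonneg)
open Node00 (SiteY BlkY IBondY CfgY SiteParY BondParY UboxY shiftY GAY GpY)

variable {d ℓ : ℕ} {hd : 1 ≤ d + 1} {hL : Odd (ℓ + 1) ∧ 1 < ℓ + 1} {b₀ b₁ : ℝ} {Mstar : ℕ}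
variable {𝔸 : Type} [NormedRing 𝔸] (P : RegExtraY d ℓ hd hL b₀ b₁ Mstar 𝔸) [NormedAlgebra ℂ 𝔸] [CompleteSpace 𝔸]
variable {ι : Type} [Fintype ι] [DecidableEq ι]

/-! ## §0  Bond-carrier facts: `bT`, `bU` read at the second component; the plaquette law from the class law -/

section Facts

variable (G : Subgroup 𝔸ˣ) (x : MemberY d ℓ hd hL b₀ b₁ Mstar) (ιB : BlkY x.toKIdx → IBondY x.toKIdx)

end Facts

/-! ## §1  ★★ Every orientation of the six `L²` bond letters at a base -/

section All

variable (G : Subgroup 𝔸ˣ) (x : MemberY d ℓ hd hL b₀ b₁ Mstar) (parS : SiteParY 𝔸 x.toKIdx) (parB : BondParY 𝔸 x.toKIdx)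
  (b : Module.Basis ι ℝ 𝔸) (ιB : BlkY x.toKIdx → IBondY x.toKIdx) (C37 C38 : ℝ → CfgY 𝔸 x.toKIdx → AfldY 𝔸 x.toKIdx → Prop)
  [Fintype (geo9Y x).Site] [DecidableEq (geo9Y x).Site]

set_option maxHeartbeats 1600000 in
/-- ★★ **FIELD `readGL2` OF `L2GFrame₇` AT NODE 00's LETTERS — EVERY ORIENTATION** (p. 398 first remark, made quantitative in block-`ℓ²`): at a member with a
section `ιB` of `β`, unit-norm structure group, a real basis, [4] Lemma 2.1 at `(δ₀, 1/12)` (exponent `dL`), the scale transfers of `ℓ` and `ℓ⁻²` with one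
constant `Λ ≧ 1`, and the plaquette law `PlaqLawY c_P U` of the `G`-valued base `U`: the (3.46) block of `KACU` at `base U` with `(B₀, δ₀)` gives, for ALL
`k, l ∈ κ ⊕ κ`, block-`ℓ²` majorants of `GbC`, `∇♯_k·GbC`, `GbC·∇♯_k`, `∇♯_k∇♯_l·GbC`, `∇♯_k·GbC·∇♯_l`, `GbC·∇♯_k∇♯_l` with `(cLGY·B₀, δ₀/2)`; letters
`∇♯_k = conj b (diffLetter (bT shiftY) (bU (coordC (base U))) η⁻¹ k)`.
[cite: Balaban1985BackgroundPropagators, Thm 3.3 p.399 with (3.46) p.398, p.398 (first remark), (3.8) p.392, p.404 (after (3.69)); Balaban1984PropagatorsII, Prop. 2.6 (2.140)–(2.141) p.247, Lemma 2.1 p.234] -/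
theorem readGL2_GbC_all [FiniteDimensional ℝ 𝔸] (hι : ∀ s, β x.toKIdx.hN x.toKIdx.D x.toKIdx.hk (ιB s) = s)
    (hG1 : ∀ u : 𝔸ˣ, u ∈ G → ‖(u : 𝔸)‖ ≤ 1) {M₂ : ℝ} (hM₂ : 0 ≤ M₂) (hrepr : ∀ (v : 𝔸) (j : ι), |b.repr v j| ≤ M₂ * ‖v‖)
    {δ₀ : ℝ} (hδ₀ : 0 < δ₀) {dL : ℕ} (h261 : Ineq261 dL (toB6 (geo9Y x) (0 : ℝ) True) δ₀ (1 / 12)) {Λ : ℝ} (hΛ : 1 ≤ Λ)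
    (hT1 : ScaleTransfer (geo9Y x) δ₀ (1 / 12) Λ (fun a => (geo9Y x).len a))
    (hTi2 : ScaleTransfer (geo9Y x) δ₀ (1 / 12) Λ (fun a => ((geo9Y x).len a)⁻¹ ^ 2))
    {cP : ℝ} (hcP : 0 ≤ cP) {U : CfgY 𝔸 x.toKIdx} (hUG : GVal G x.toKIdx U) (hplaq : PlaqLawY x ιB cP U)
    {B₀ : ℝ} (hB₀ : 0 ≤ B₀) (hL2 : L2Block (KACU P G x (GAY x.toKIdx parS parB (GpY x.toKIdx parS)) parB C37 C38) B₀ δ₀ (.base U)) :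
    HasL2Majorant (g := toB6 (geo9Y x) (0 : ℝ) True) (fun q : (Fin (d + 1) × SiteY x.toKIdx) × ι => blkC x.toKIdx ιB q.1.2) (GbC x.toKIdx parS parB b (.base U)) (fun a a' => cLGY cP M₂ (∑ j, ‖b j‖) (Real.sqrt (Fintype.card ι)) d dL δ₀ Λ * B₀ * (geo9Y x).len a ^ 2 * Real.exp (-(δ₀ / 2 * (geo9Y x).dist a a'))) ∧
      (∀ k : Fin (d + 1) ⊕ Fin (d + 1), HasL2Majorant (g := toB6 (geo9Y x) (0 : ℝ) True) (fun q : (Fin (d + 1) × SiteY x.toKIdx) × ι => blkC x.toKIdx ιB q.1.2)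
        (conj b (diffLetter (bT (shiftY x.toKIdx)) (bU (coordC G x.toKIdx (.base U))) (((((geo9Y x).eta : ℂ)))⁻¹) (k)) * GbC x.toKIdx parS parB b (.base U)) (fun a a' => cLGY cP M₂ (∑ j, ‖b j‖) (Real.sqrt (Fintype.card ι)) d dL δ₀ Λ * B₀ * (geo9Y x).len a * Real.exp (-(δ₀ / 2 * (geo9Y x).dist a a')))) ∧
      (∀ k : Fin (d + 1) ⊕ Fin (d + 1), HasL2Majorant (g := toB6 (geo9Y x) (0 : ℝ) True) (fun q : (Fin (d + 1) × SiteY x.toKIdx) × ι => blkC x.toKIdx ιB q.1.2)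
        (GbC x.toKIdx parS parB b (.base U) * conj b (diffLetter (bT (shiftY x.toKIdx)) (bU (coordC G x.toKIdx (.base U))) (((((geo9Y x).eta : ℂ)))⁻¹) (k))) (fun a a' => cLGY cP M₂ (∑ j, ‖b j‖) (Real.sqrt (Fintype.card ι)) d dL δ₀ Λ * B₀ * (geo9Y x).len a * Real.exp (-(δ₀ / 2 * (geo9Y x).dist a a')))) ∧
      (∀ k l : Fin (d + 1) ⊕ Fin (d + 1), HasL2Majorant (g := toB6 (geo9Y x) (0 : ℝ) True) (fun q : (Fin (d + 1) × SiteY x.toKIdx) × ι => blkC x.toKIdx ιB q.1.2)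
        (conj b (diffLetter (bT (shiftY x.toKIdx)) (bU (coordC G x.toKIdx (.base U))) (((((geo9Y x).eta : ℂ)))⁻¹) (k)) *
          conj b (diffLetter (bT (shiftY x.toKIdx)) (bU (coordC G x.toKIdx (.base U))) (((((geo9Y x).eta : ℂ)))⁻¹) (l)) * GbC x.toKIdx parS parB b (.base U)) (fun a a' => cLGY cP M₂ (∑ j, ‖b j‖) (Real.sqrt (Fintype.card ι)) d dL δ₀ Λ * B₀ * 1 * Real.exp (-(δ₀ / 2 * (geo9Y x).dist a a')))) ∧
      (∀ k l : Fin (d + 1) ⊕ Fin (d + 1), HasL2Majorant (g := toB6 (geo9Y x) (0 : ℝ) True) (fun q : (Fin (d + 1) × SiteY x.toKIdx) × ι => blkC x.toKIdx ιB q.1.2)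
        (conj b (diffLetter (bT (shiftY x.toKIdx)) (bU (coordC G x.toKIdx (.base U))) (((((geo9Y x).eta : ℂ)))⁻¹) (k)) * GbC x.toKIdx parS parB b (.base U) *
          conj b (diffLetter (bT (shiftY x.toKIdx)) (bU (coordC G x.toKIdx (.base U))) (((((geo9Y x).eta : ℂ)))⁻¹) (l))) (fun a a' => cLGY cP M₂ (∑ j, ‖b j‖) (Real.sqrt (Fintype.card ι)) d dL δ₀ Λ * B₀ * 1 * Real.exp (-(δ₀ / 2 * (geo9Y x).dist a a')))) ∧
      (∀ k l : Fin (d + 1) ⊕ Fin (d + 1), HasL2Majorant (g := toB6 (geo9Y x) (0 : ℝ) True) (fun q : (Fin (d + 1) × SiteY x.toKIdx) × ι => blkC x.toKIdx ιB q.1.2)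
        (GbC x.toKIdx parS parB b (.base U) * conj b (diffLetter (bT (shiftY x.toKIdx)) (bU (coordC G x.toKIdx (.base U))) (((((geo9Y x).eta : ℂ)))⁻¹) (k)) *
          conj b (diffLetter (bT (shiftY x.toKIdx)) (bU (coordC G x.toKIdx (.base U))) (((((geo9Y x).eta : ℂ)))⁻¹) (l))) (fun a a' => cLGY cP M₂ (∑ j, ‖b j‖) (Real.sqrt (Fintype.card ι)) d dL δ₀ Λ * B₀ * 1 * Real.exp (-(δ₀ / 2 * (geo9Y x).dist a a')))) := by
  -- constants and geometry
  set η : ℝ := (kGeo x.toKIdx).eta with hηdef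
  have hη0 : 0 < η := geo9K_eta_pos x.toKIdx
  set Sb : ℝ := ∑ j, ‖b j‖ with hSbdef
  set sι : ℝ := Real.sqrt (Fintype.card ι) with hsι
  set cL : ℝ := sι * M₂ * Sb with hcL
  set Bin : ℝ := cL * B₀ with hBin
  set c₁ : ℝ := B6.c1 dL δ₀ (1 / 12) with hc₁
  set d₀ : ℝ := 2 * ((d : ℝ) + 1) with hd₀
  set σ₁ : ℝ := Λ * Real.exp (1 / 12 * δ₀ * d₀) with hσ₁
  set gX : ℝ := 1 + ((1 : ℝ) ^ 2 * M₂ * Sb * sι * Real.exp (δ₀ * d₀)) * Λ * c₁ with hgX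
  set gI : ℝ := 1 + c₁ * M₂ * Sb * sι * ((1 : ℝ) ^ 2 * Real.exp (δ₀ * d₀) * Λ + (1 : ℝ) ^ 4 * cP * σ₁ * Real.exp (δ₀ * (2 * d₀)) * Λ) with hgI
  set Bx : ℝ := cLGY cP M₂ (∑ j, ‖b j‖) (Real.sqrt (Fintype.card ι)) d dL δ₀ Λ * B₀ with hBxdef
  have hSb : 0 ≤ Sb := Finset.sum_nonneg fun i _ => norm_nonneg _
  have hsι0 : 0 ≤ sι := Real.sqrt_nonneg _
  have hcL0 : 0 ≤ cL := by positivity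
  have hBin0 : 0 ≤ Bin := mul_nonneg hcL0 hB₀
  have hΛ0 : 0 ≤ Λ := le_trans zero_le_one hΛ
  have hc₁0 : 0 ≤ c₁ := B6RandomWalk.c1_nonneg dL δ₀ (1 / 12)
  have hσ₁0 : 0 ≤ σ₁ := by positivity
  have hgX1 : 1 ≤ gX := by rw [hgX]; exact le_add_of_nonneg_right (by positivity)
  have hgX0 : 0 ≤ gX := le_trans zero_le_one hgX1
  have hgI1 : 1 ≤ gI := by rw [hgI]; exact le_add_of_nonneg_right (by positivity)
  have hgI0 : 0 ≤ gI := le_trans zero_le_one hgI1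
  have hBx : Bx = gX ^ 2 * gI * Bin := by
    simp only [hBxdef, cLGY, hgX, hgI, hσ₁, hBin, hcL, hc₁, hd₀, hSbdef, hsι]; ring
  have hdnn : ∀ y y' : (geo9Y x).Site, 0 ≤ (geo9Y x).dist y y' := geo9Y_dist_nonneg x
  have htri : Triangle254 (toB6 (geo9Y x) (0 : ℝ) True) := fun p q r => geo9Y_dist_triangle x p q r
  have hlen : ∀ y : (geo9Y x).Site, 0 < (geo9Y x).len y := geo9Y_len_pos x
  have hwℓ : ∀ p : (geo9Y x).Site, 0 ≤ (geo9Y x).len p := fun p => (hlen p).le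
  have hd₀F : ∀ (μ : Fin (d + 1)) (q : Fin (d + 1) × SiteY x.toKIdx),
      (geo9Y x).dist (blkC x.toKIdx ιB q.2) (blkC x.toKIdx ιB ((bT (shiftY x.toKIdx)) μ q).2) ≤ d₀ := fun μ q => stencilF_blkC x.toKIdx ιB hι μ q.2
  have hd₀B : ∀ (μ : Fin (d + 1)) (q : Fin (d + 1) × SiteY x.toKIdx),
      (geo9Y x).dist (blkC x.toKIdx ιB q.2) (blkC x.toKIdx ιB (((bT (shiftY x.toKIdx)) μ).symm q).2) ≤ d₀ := fun μ q => stencilB_blkC x.toKIdx ιB hι μ q.2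
  have hd₀FB : ∀ (μ : Fin (d + 1)) (q : Fin (d + 1) × SiteY x.toKIdx),
      (geo9Y x).dist (blkC x.toKIdx ιB q.2) (blkC x.toKIdx ιB ((bT (shiftY x.toKIdx)) μ q).2) ≤ d₀ ∧
      (geo9Y x).dist (blkC x.toKIdx ιB q.2) (blkC x.toKIdx ιB (((bT (shiftY x.toKIdx)) μ).symm q).2) ≤ d₀ := fun μ q => ⟨hd₀F μ q, hd₀B μ q⟩
  have hρu : ∀ (μ : Fin (d + 1)) (q : Fin (d + 1) × SiteY x.toKIdx), ‖(((bU (UboxY x.toKIdx U)) μ q : 𝔸ˣ) : 𝔸)‖ ≤ 1 ∧ ‖((((bU (UboxY x.toKIdx U)) μ q)⁻¹ : 𝔸ˣ) : 𝔸)‖ ≤ 1 :=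
    fun μ q => norm_le_one_and_inv_of_mem G hG1 (hUG μ _ : UboxY x.toKIdx U μ q.2 ∈ G)
  have hαδ : 0 ≤ 1 / 12 * δ₀ := by positivity
  have hT0 : ScaleTransfer (geo9Y x) δ₀ (1 / 12) Λ (fun _ => (1 : ℝ)) := fun y y' => by
    rw [mul_one, mul_one]
    have : Real.exp (-(1 / 12 * δ₀ * (geo9Y x).dist y y')) ≤ 1 := Real.exp_le_one_iff.2 (by nlinarith [hdnn y y', hδ₀.le])
    exact this.trans hΛ
  have heta : ∀ y : (geo9Y x).Site, η ≤ (geo9Y x).len y := B9SectBL2SecondOrderY.eta_le_len x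
  have hcomm : ∀ (μ ν : Fin (d + 1)) (q : Fin (d + 1) × SiteY x.toKIdx), (bT (shiftY x.toKIdx)) μ ((bT (shiftY x.toKIdx)) ν q) = (bT (shiftY x.toKIdx)) ν ((bT (shiftY x.toKIdx)) μ q) :=
    fun μ ν q => Prod.ext rfl (shiftY_comm x μ ν q.2)
  have hσ : ∀ (ν : Fin (d + 1)) (q : Fin (d + 1) × SiteY x.toKIdx), ((geo9Y x).len (blkC x.toKIdx ιB (((bT (shiftY x.toKIdx)) ν).symm q).2))⁻¹ ^ 2
      ≤ σ₁ * ((geo9Y x).len (blkC x.toKIdx ιB q.2))⁻¹ ^ 2 := fun ν q =>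
    le_of_scaleTransfer (w := fun a => ((geo9Y x).len a)⁻¹ ^ 2) hTi2 hαδ (hd₀B ν q) (pow_nonneg (inv_nonneg.mpr (hlen _).le) _)
  have hplaq' : ∀ (μ ν : Fin (d + 1)) (q : Fin (d + 1) × SiteY x.toKIdx) (X : 𝔸),
      ‖R ((bU (UboxY x.toKIdx U)) μ q * (bU (UboxY x.toKIdx U)) ν ((bT (shiftY x.toKIdx)) μ q)) X - R ((bU (UboxY x.toKIdx U)) ν q * (bU (UboxY x.toKIdx U)) μ ((bT (shiftY x.toKIdx)) ν q)) X‖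
        ≤ cP * (η * ((geo9Y x).len (blkC x.toKIdx ιB q.2))⁻¹) ^ 2 * ‖X‖ := fun μ ν q X => hplaq μ ν q.2 X
  -- the letters: `D k` at the genuine `U_□` (the frame's `coordC (base U)` IS `U_□` at a `G`-valued base)
  have hco : coordC G x.toKIdx (.base U) = UboxY x.toKIdx U := coordC_base_eq G x hUG
  set Gb := GbC x.toKIdx parS parB b (.base U) with hGb
  set D : Fin (d + 1) ⊕ Fin (d + 1) → Module.End ℝ ((Fin (d + 1) × SiteY x.toKIdx) → 𝔸) :=
    fun k => diffLetter (bT (shiftY x.toKIdx)) (bU (UboxY x.toKIdx U)) (((η : ℂ))⁻¹) k with hD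
  have hDc : ∀ k, conj b (diffLetter (bT (shiftY x.toKIdx)) (bU (coordC G x.toKIdx (.base U))) (((((geo9Y x).eta : ℂ)))⁻¹) (k)) = conj b (D k) := fun k => by
    rw [hco]; rfl
  simp only [hDc]
  -- READ print's orientations (gen 14's `readGL2_GbC_printed`), rate δ₀, constant Bin
  obtain ⟨r0, r1', r2', r4', r3', r5'⟩ := readGL2_GbC_printed P (Rr := (0 : ℝ)) (Hp := True) G x parS parB b ιB C37 C38 hι hM₂ hrepr U hUG hB₀ hL2
  simp only [hDc] at r1' r2' r3' r4' r5'
  have hK : ∀ (w : (geo9Y x).Site → ℝ) (p q : (geo9Y x).Site), (Real.sqrt (Fintype.card ι) * M₂ * ∑ j, ‖b j‖) * B₀ * w p * Real.exp (-(δ₀ * (geo9Y x).dist p q))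
      = Bin * w p * Real.exp (-(δ₀ * (geo9Y x).dist p q)) := fun w p q => by rw [hBin, hcL, hsι, hSbdef]
  have r0' : HasL2Majorant (g := toB6 (geo9Y x) (0 : ℝ) True) (fun q : (Fin (d + 1) × SiteY x.toKIdx) × ι => blkC x.toKIdx ιB q.1.2) Gb (fun p q => Bin * (geo9Y x).len p ^ 2 * Real.exp (-(δ₀ * (geo9Y x).dist p q))) :=
    hasL2Majorant_mono (g := toB6 (geo9Y x) (0 : ℝ) True) _ r0 fun p q => le_of_eq (hK (fun p => (geo9Y x).len p ^ 2) p q)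
  have r1 : ∀ μ, HasL2Majorant (g := toB6 (geo9Y x) (0 : ℝ) True) (fun q : (Fin (d + 1) × SiteY x.toKIdx) × ι => blkC x.toKIdx ιB q.1.2) (conj b (D (Sum.inl μ)) * Gb) (fun p q => Bin * (geo9Y x).len p * Real.exp (-(δ₀ * (geo9Y x).dist p q))) := fun μ =>
    hasL2Majorant_mono (g := toB6 (geo9Y x) (0 : ℝ) True) _ (r1' μ) fun p q => le_of_eq (hK (fun p => (geo9Y x).len p) p q)
  have r2 : ∀ μ, HasL2Majorant (g := toB6 (geo9Y x) (0 : ℝ) True) (fun q : (Fin (d + 1) × SiteY x.toKIdx) × ι => blkC x.toKIdx ιB q.1.2) (Gb * conj b (D (Sum.inr μ))) (fun p q => Bin * (geo9Y x).len p * Real.exp (-(δ₀ * (geo9Y x).dist p q))) := fun μ =>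
    hasL2Majorant_mono (g := toB6 (geo9Y x) (0 : ℝ) True) _ (r2' μ) fun p q => le_of_eq (hK (fun p => (geo9Y x).len p) p q)
  have r3 : ∀ μ ν, HasL2Majorant (g := toB6 (geo9Y x) (0 : ℝ) True) (fun q : (Fin (d + 1) × SiteY x.toKIdx) × ι => blkC x.toKIdx ιB q.1.2) (conj b (D (Sum.inl μ)) * conj b (D (Sum.inl ν)) * Gb) (fun p q => Bin * 1 * Real.exp (-(δ₀ * (geo9Y x).dist p q))) := fun μ ν =>
    hasL2Majorant_mono (g := toB6 (geo9Y x) (0 : ℝ) True) _ (r3' μ ν) fun p q => le_of_eq (hK (fun _ => 1) p q)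
  have r4 : ∀ μ ν, HasL2Majorant (g := toB6 (geo9Y x) (0 : ℝ) True) (fun q : (Fin (d + 1) × SiteY x.toKIdx) × ι => blkC x.toKIdx ιB q.1.2) (conj b (D (Sum.inl μ)) * Gb * conj b (D (Sum.inr ν))) (fun p q => Bin * 1 * Real.exp (-(δ₀ * (geo9Y x).dist p q))) := fun μ ν =>
    hasL2Majorant_mono (g := toB6 (geo9Y x) (0 : ℝ) True) _ (r4' μ ν) fun p q => le_of_eq (hK (fun _ => 1) p q)
  have r5 : ∀ μ ν, HasL2Majorant (g := toB6 (geo9Y x) (0 : ℝ) True) (fun q : (Fin (d + 1) × SiteY x.toKIdx) × ι => blkC x.toKIdx ιB q.1.2) (Gb * conj b (D (Sum.inr μ)) * conj b (D (Sum.inr ν))) (fun p q => Bin * 1 * Real.exp (-(δ₀ * (geo9Y x).dist p q))) := fun μ ν =>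
    hasL2Majorant_mono (g := toB6 (geo9Y x) (0 : ℝ) True) _ (r5' μ ν) fun p q => le_of_eq (hK (fun _ => 1) p q)
  -- rates
  set ρ₁ : ℝ := 5 * δ₀ / 6 with hρ₁
  set ρ₂ : ℝ := 2 * δ₀ / 3 with hρ₂
  have hρ₁0 : 0 ≤ ρ₁ := by rw [hρ₁]; positivity
  have hρ₂0 : 0 ≤ ρ₂ := by rw [hρ₂]; positivity
  have hr₁ : ρ₁ + (1 / 12 + 1 / 12) * δ₀ ≤ δ₀ := by rw [hρ₁]; linarith
  have hρ₁δ : ρ₁ ≤ δ₀ := by rw [hρ₁]; linarith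
  have hr₂ : ρ₂ + (1 / 12 + 1 / 12) * δ₀ ≤ ρ₁ := by rw [hρ₁, hρ₂]; linarith
  have hρ₂₁ : ρ₂ ≤ ρ₁ := by rw [hρ₁, hρ₂]; linarith
  -- the outer and inner step constants are bounded by `g_X`, `g_I` times the input constant (rates `≦ δ₀`)
  have hexp1 : ∀ r : ℝ, r ≤ δ₀ → Real.exp (r * d₀) ≤ Real.exp (δ₀ * d₀) := fun r hr =>
    Real.exp_le_exp.2 (mul_le_mul_of_nonneg_right hr (by rw [hd₀]; positivity))
  have hexp2 : ∀ r : ℝ, r ≤ δ₀ → Real.exp (r * (2 * d₀)) ≤ Real.exp (δ₀ * (2 * d₀)) := fun r hr =>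
    Real.exp_le_exp.2 (mul_le_mul_of_nonneg_right hr (by rw [hd₀]; positivity))
  have hstep : ∀ (r Bc : ℝ), r ≤ δ₀ → 0 ≤ Bc →
      (1 : ℝ) ^ 2 * M₂ * (∑ i, ‖b i‖) * Real.sqrt (Fintype.card ι) * Real.exp (r * d₀) * Λ * B6.c1 dL δ₀ (1 / 12) * Bc ≤ gX * Bc := by
    intro r Bc hr hBc
    have h1 : (1 : ℝ) ^ 2 * M₂ * (∑ i, ‖b i‖) * Real.sqrt (Fintype.card ι) * Real.exp (r * d₀) * Λ * B6.c1 dL δ₀ (1 / 12)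
        ≤ (1 : ℝ) ^ 2 * M₂ * Sb * sι * Real.exp (δ₀ * d₀) * Λ * c₁ := by
      rw [← hSbdef, ← hsι, ← hc₁]
      exact mul_le_mul_of_nonneg_right (mul_le_mul_of_nonneg_right (mul_le_mul_of_nonneg_left (hexp1 r hr) (by positivity)) hΛ0) hc₁0
    have h2 : (1 : ℝ) ^ 2 * M₂ * Sb * sι * Real.exp (δ₀ * d₀) * Λ * c₁ ≤ gX := by rw [hgX]; linarith
    exact mul_le_mul_of_nonneg_right (h1.trans h2) hBc
  have hstepI : ∀ (r Bc : ℝ), r ≤ δ₀ → 0 ≤ Bc →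
      (B6.c1 dL δ₀ (1 / 12) * M₂ * (∑ i, ‖b i‖) * Real.sqrt (Fintype.card ι)
        * ((1 : ℝ) ^ 2 * Real.exp (r * d₀) * Λ + (1 : ℝ) ^ 4 * cP * σ₁ * Real.exp (r * (2 * d₀)) * Λ)) * Bc ≤ gI * Bc := by
    intro r Bc hr hBc
    refine mul_le_mul_of_nonneg_right ?_ hBc
    rw [← hSbdef, ← hsι, ← hc₁, hgI]
    have hin : (1 : ℝ) ^ 2 * Real.exp (r * d₀) * Λ + (1 : ℝ) ^ 4 * cP * σ₁ * Real.exp (r * (2 * d₀)) * Λ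
        ≤ (1 : ℝ) ^ 2 * Real.exp (δ₀ * d₀) * Λ + (1 : ℝ) ^ 4 * cP * σ₁ * Real.exp (δ₀ * (2 * d₀)) * Λ :=
      add_le_add (mul_le_mul_of_nonneg_right (mul_le_mul_of_nonneg_left (hexp1 r hr) (by positivity)) hΛ0)
        (mul_le_mul_of_nonneg_right (mul_le_mul_of_nonneg_left (hexp2 r hr) (by positivity)) hΛ0)
    have h0 : 0 ≤ c₁ * M₂ * Sb * sι := by positivity
    have := mul_le_mul_of_nonneg_left hin h0
    linarith
  -- FIRST ORDER: the two cross conversions (rate ρ₁)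
  have x1 : ∀ μ, HasL2Majorant (g := toB6 (geo9Y x) (0 : ℝ) True) (fun q : (Fin (d + 1) × SiteY x.toKIdx) × ι => blkC x.toKIdx ιB q.1.2) (conj b (D (Sum.inr μ)) * Gb) (fun p q => (gX * Bin) * (geo9Y x).len p * Real.exp (-(ρ₁ * (geo9Y x).dist p q))) := fun μ => by
    have h := hasL2Majorant_cross_left b (bT (shiftY x.toKIdx)) (bU (UboxY x.toKIdx U)) (Rr := (0 : ℝ)) (H := True) (g := geo9Y x) (fun q : Fin (d + 1) × SiteY x.toKIdx => blkC x.toKIdx ιB q.2) dL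
      (((η : ℂ))⁻¹) 1 d₀ M₂ δ₀ δ₀ (1 / 12) (1 / 12) ρ₁ Λ Bin (fun p => (geo9Y x).len p) hwℓ hδ₀.le hM₂ hBin0 hΛ0 hρ₁0 hr₁ hρ₁δ hrepr hdnn htri h261 hT1
      hρu hd₀B μ (Gp := Gb) (r1 μ)
    exact hasL2Majorant_mono (g := toB6 (geo9Y x) (0 : ℝ) True) _ h fun p q =>
      mul_le_mul_of_nonneg_right (mul_le_mul_of_nonneg_right (hstep δ₀ Bin le_rfl hBin0) (hwℓ p)) (Real.exp_nonneg _)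
  have x2 : ∀ μ, HasL2Majorant (g := toB6 (geo9Y x) (0 : ℝ) True) (fun q : (Fin (d + 1) × SiteY x.toKIdx) × ι => blkC x.toKIdx ιB q.1.2) (Gb * conj b (D (Sum.inl μ))) (fun p q => (gX * Bin) * (geo9Y x).len p * Real.exp (-(ρ₁ * (geo9Y x).dist p q))) := fun μ => by
    have h := hasL2Majorant_cross_right b (bT (shiftY x.toKIdx)) (bU (UboxY x.toKIdx U)) (Rr := (0 : ℝ)) (H := True) (g := geo9Y x) (fun q : Fin (d + 1) × SiteY x.toKIdx => blkC x.toKIdx ιB q.2) dL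
      (((η : ℂ))⁻¹) 1 d₀ M₂ δ₀ δ₀ (1 / 12) (1 / 12) ρ₁ Λ Bin (fun p => (geo9Y x).len p) hwℓ hM₂ hBin0 hΛ hρ₁0 hr₁ hαδ hrepr hdnn htri h261
      hρu hd₀F μ (Gp := Gb) (r2 μ)
    exact hasL2Majorant_mono (g := toB6 (geo9Y x) (0 : ℝ) True) _ h fun p q =>
      mul_le_mul_of_nonneg_right (mul_le_mul_of_nonneg_right (hstep ρ₁ Bin hρ₁δ hBin0) (hwℓ p)) (Real.exp_nonneg _)
  -- MIXED words `D k * Gb * D l`: (inl, inr) read; (inr, inr) left cross; (inl, inl) right cross; (inr, inl) both (rate ρ₂)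
  have m_rr : ∀ μ ν, HasL2Majorant (g := toB6 (geo9Y x) (0 : ℝ) True) (fun q : (Fin (d + 1) × SiteY x.toKIdx) × ι => blkC x.toKIdx ιB q.1.2) (conj b (D (Sum.inr μ)) * (Gb * conj b (D (Sum.inr ν)))) (fun p q => (gX * Bin) * 1 * Real.exp (-(ρ₁ * (geo9Y x).dist p q))) :=
    fun μ ν => by
    have hin : HasL2Majorant (g := toB6 (geo9Y x) (0 : ℝ) True) (fun q : (Fin (d + 1) × SiteY x.toKIdx) × ι => blkC x.toKIdx ιB q.1.2) (conj b (D (Sum.inl μ)) * (Gb * conj b (D (Sum.inr ν)))) (fun p q => Bin * 1 * Real.exp (-(δ₀ * (geo9Y x).dist p q))) := by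
      rw [← mul_assoc]; exact r4 μ ν
    have h := hasL2Majorant_cross_left b (bT (shiftY x.toKIdx)) (bU (UboxY x.toKIdx U)) (Rr := (0 : ℝ)) (H := True) (g := geo9Y x) (fun q : Fin (d + 1) × SiteY x.toKIdx => blkC x.toKIdx ιB q.2) dL
      (((η : ℂ))⁻¹) 1 d₀ M₂ δ₀ δ₀ (1 / 12) (1 / 12) ρ₁ Λ Bin (fun _ => (1 : ℝ)) (fun _ => zero_le_one) hδ₀.le hM₂ hBin0 hΛ0 hρ₁0 hr₁ hρ₁δ hrepr hdnn htri
      h261 hT0 hρu hd₀B μ (Gp := Gb * conj b (D (Sum.inr ν))) hin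
    exact hasL2Majorant_mono (g := toB6 (geo9Y x) (0 : ℝ) True) _ h fun p q =>
      mul_le_mul_of_nonneg_right (mul_le_mul_of_nonneg_right (hstep δ₀ Bin le_rfl hBin0) zero_le_one) (Real.exp_nonneg _)
  have m_ll : ∀ μ ν, HasL2Majorant (g := toB6 (geo9Y x) (0 : ℝ) True) (fun q : (Fin (d + 1) × SiteY x.toKIdx) × ι => blkC x.toKIdx ιB q.1.2) (conj b (D (Sum.inl μ)) * Gb * conj b (D (Sum.inl ν))) (fun p q => (gX * Bin) * 1 * Real.exp (-(ρ₁ * (geo9Y x).dist p q))) :=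
    fun μ ν => by
    have h := hasL2Majorant_cross_right b (bT (shiftY x.toKIdx)) (bU (UboxY x.toKIdx U)) (Rr := (0 : ℝ)) (H := True) (g := geo9Y x) (fun q : Fin (d + 1) × SiteY x.toKIdx => blkC x.toKIdx ιB q.2) dL
      (((η : ℂ))⁻¹) 1 d₀ M₂ δ₀ δ₀ (1 / 12) (1 / 12) ρ₁ Λ Bin (fun _ => (1 : ℝ)) (fun _ => zero_le_one) hM₂ hBin0 hΛ hρ₁0 hr₁ hαδ hrepr hdnn htri h261
      hρu hd₀F ν (Gp := conj b (D (Sum.inl μ)) * Gb) (r4 μ ν)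
    exact hasL2Majorant_mono (g := toB6 (geo9Y x) (0 : ℝ) True) _ h fun p q =>
      mul_le_mul_of_nonneg_right (mul_le_mul_of_nonneg_right (hstep ρ₁ Bin hρ₁δ hBin0) zero_le_one) (Real.exp_nonneg _)
  have m_rl : ∀ μ ν, HasL2Majorant (g := toB6 (geo9Y x) (0 : ℝ) True) (fun q : (Fin (d + 1) × SiteY x.toKIdx) × ι => blkC x.toKIdx ιB q.1.2) (conj b (D (Sum.inr μ)) * (Gb * conj b (D (Sum.inl ν)))) (fun p q => (gX * (gX * Bin)) * 1 * Real.exp (-(ρ₂ * (geo9Y x).dist p q))) :=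
    fun μ ν => by
    have hin : HasL2Majorant (g := toB6 (geo9Y x) (0 : ℝ) True) (fun q : (Fin (d + 1) × SiteY x.toKIdx) × ι => blkC x.toKIdx ιB q.1.2) (conj b (D (Sum.inl μ)) * (Gb * conj b (D (Sum.inl ν)))) (fun p q => (gX * Bin) * 1 * Real.exp (-(ρ₁ * (geo9Y x).dist p q))) := by
      rw [← mul_assoc]; exact m_ll μ ν
    have h := hasL2Majorant_cross_left b (bT (shiftY x.toKIdx)) (bU (UboxY x.toKIdx U)) (Rr := (0 : ℝ)) (H := True) (g := geo9Y x) (fun q : Fin (d + 1) × SiteY x.toKIdx => blkC x.toKIdx ιB q.2) dL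
      (((η : ℂ))⁻¹) 1 d₀ M₂ δ₀ ρ₁ (1 / 12) (1 / 12) ρ₂ Λ (gX * Bin) (fun _ => (1 : ℝ)) (fun _ => zero_le_one) hρ₁0 hM₂ (mul_nonneg hgX0 hBin0) hΛ0 hρ₂0 hr₂
      hρ₂₁ hrepr hdnn htri h261 hT0 hρu hd₀B μ (Gp := Gb * conj b (D (Sum.inl ν))) hin
    exact hasL2Majorant_mono (g := toB6 (geo9Y x) (0 : ℝ) True) _ h fun p q =>
      mul_le_mul_of_nonneg_right (mul_le_mul_of_nonneg_right (hstep ρ₁ (gX * Bin) hρ₁δ (mul_nonneg hgX0 hBin0)) zero_le_one) (Real.exp_nonneg _)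
  -- SECOND ORDER LEFT `D k * D l * Gb`: inner switch (inl, inr) at ρ₁; outer (inr, inl) at ρ₁ and (inr, inr) at ρ₂
  have w3_li : ∀ μ ν, HasL2Majorant (g := toB6 (geo9Y x) (0 : ℝ) True) (fun q : (Fin (d + 1) × SiteY x.toKIdx) × ι => blkC x.toKIdx ιB q.1.2) (conj b (D (Sum.inl μ)) * conj b (D (Sum.inr ν)) * Gb) (fun p q => (gI * Bin) * 1 * Real.exp (-(ρ₁ * (geo9Y x).dist p q))) :=
    fun μ ν => by
    have h := hasL2Majorant_cross2_left_inner b (bT (shiftY x.toKIdx)) (bU (UboxY x.toKIdx U)) (Rr := (0 : ℝ)) (H := True) (g := geo9Y x)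
      (fun q : Fin (d + 1) × SiteY x.toKIdx => blkC x.toKIdx ιB q.2) dL hη0 1 cP σ₁ d₀ M₂ δ₀ δ₀ (1 / 12) (1 / 12) ρ₁ Λ Λ Bin hcP hσ₁0 hδ₀.le hM₂ hBin0 hΛ0 hΛ0 hρ₁0 hr₁ hρ₁δ hrepr hdnn
      htri hlen h261 hT0 hT1 μ ν (hcomm μ ν) hρu (hplaq' μ ν) hd₀FB (hσ ν) heta (Gp := Gb) (r3 μ ν) (r1 ν)
    exact hasL2Majorant_mono (g := toB6 (geo9Y x) (0 : ℝ) True) _ h fun p q =>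
      mul_le_mul_of_nonneg_right (mul_le_mul_of_nonneg_right (hstepI δ₀ Bin le_rfl hBin0) zero_le_one) (Real.exp_nonneg _)
  have w3_rl : ∀ μ ν, HasL2Majorant (g := toB6 (geo9Y x) (0 : ℝ) True) (fun q : (Fin (d + 1) × SiteY x.toKIdx) × ι => blkC x.toKIdx ιB q.1.2) (conj b (D (Sum.inr μ)) * (conj b (D (Sum.inl ν)) * Gb)) (fun p q => (gX * Bin) * 1 * Real.exp (-(ρ₁ * (geo9Y x).dist p q))) :=
    fun μ ν => by
    have hin : HasL2Majorant (g := toB6 (geo9Y x) (0 : ℝ) True) (fun q : (Fin (d + 1) × SiteY x.toKIdx) × ι => blkC x.toKIdx ιB q.1.2) (conj b (D (Sum.inl μ)) * (conj b (D (Sum.inl ν)) * Gb)) (fun p q => Bin * 1 * Real.exp (-(δ₀ * (geo9Y x).dist p q))) := by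
      rw [← mul_assoc]; exact r3 μ ν
    have h := hasL2Majorant_cross_left b (bT (shiftY x.toKIdx)) (bU (UboxY x.toKIdx U)) (Rr := (0 : ℝ)) (H := True) (g := geo9Y x) (fun q : Fin (d + 1) × SiteY x.toKIdx => blkC x.toKIdx ιB q.2) dL
      (((η : ℂ))⁻¹) 1 d₀ M₂ δ₀ δ₀ (1 / 12) (1 / 12) ρ₁ Λ Bin (fun _ => (1 : ℝ)) (fun _ => zero_le_one) hδ₀.le hM₂ hBin0 hΛ0 hρ₁0 hr₁ hρ₁δ hrepr hdnn htri
      h261 hT0 hρu hd₀B μ (Gp := conj b (D (Sum.inl ν)) * Gb) hin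
    exact hasL2Majorant_mono (g := toB6 (geo9Y x) (0 : ℝ) True) _ h fun p q =>
      mul_le_mul_of_nonneg_right (mul_le_mul_of_nonneg_right (hstep δ₀ Bin le_rfl hBin0) zero_le_one) (Real.exp_nonneg _)
  have w3_rr : ∀ μ ν, HasL2Majorant (g := toB6 (geo9Y x) (0 : ℝ) True) (fun q : (Fin (d + 1) × SiteY x.toKIdx) × ι => blkC x.toKIdx ιB q.1.2) (conj b (D (Sum.inr μ)) * (conj b (D (Sum.inr ν)) * Gb)) (fun p q => (gX * (gI * Bin)) * 1 * Real.exp (-(ρ₂ * (geo9Y x).dist p q))) :=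
    fun μ ν => by
    have hin : HasL2Majorant (g := toB6 (geo9Y x) (0 : ℝ) True) (fun q : (Fin (d + 1) × SiteY x.toKIdx) × ι => blkC x.toKIdx ιB q.1.2) (conj b (D (Sum.inl μ)) * (conj b (D (Sum.inr ν)) * Gb)) (fun p q => (gI * Bin) * 1 * Real.exp (-(ρ₁ * (geo9Y x).dist p q))) := by
      rw [← mul_assoc]; exact w3_li μ ν
    have h := hasL2Majorant_cross_left b (bT (shiftY x.toKIdx)) (bU (UboxY x.toKIdx U)) (Rr := (0 : ℝ)) (H := True) (g := geo9Y x) (fun q : Fin (d + 1) × SiteY x.toKIdx => blkC x.toKIdx ιB q.2) dL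
      (((η : ℂ))⁻¹) 1 d₀ M₂ δ₀ ρ₁ (1 / 12) (1 / 12) ρ₂ Λ (gI * Bin) (fun _ => (1 : ℝ)) (fun _ => zero_le_one) hρ₁0 hM₂ (mul_nonneg hgI0 hBin0) hΛ0 hρ₂0 hr₂
      hρ₂₁ hrepr hdnn htri h261 hT0 hρu hd₀B μ (Gp := conj b (D (Sum.inr ν)) * Gb) hin
    exact hasL2Majorant_mono (g := toB6 (geo9Y x) (0 : ℝ) True) _ h fun p q =>
      mul_le_mul_of_nonneg_right (mul_le_mul_of_nonneg_right (hstep ρ₁ (gI * Bin) hρ₁δ (mul_nonneg hgI0 hBin0)) zero_le_one) (Real.exp_nonneg _)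
  -- SECOND ORDER RIGHT `Gb * D k * D l`: inner switch (inl, inr) at ρ₁; outer (inr, inl) at ρ₁ and (inl, inl) at ρ₂
  have w5_li : ∀ μ ν, HasL2Majorant (g := toB6 (geo9Y x) (0 : ℝ) True) (fun q : (Fin (d + 1) × SiteY x.toKIdx) × ι => blkC x.toKIdx ιB q.1.2) (Gb * conj b (D (Sum.inl μ)) * conj b (D (Sum.inr ν))) (fun p q => (gI * Bin) * 1 * Real.exp (-(ρ₁ * (geo9Y x).dist p q))) :=
    fun μ ν => by
    have h := hasL2Majorant_cross2_right_inner b (bT (shiftY x.toKIdx)) (bU (UboxY x.toKIdx U)) (Rr := (0 : ℝ)) (H := True) (g := geo9Y x)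
      (fun q : Fin (d + 1) × SiteY x.toKIdx => blkC x.toKIdx ιB q.2) dL hη0 1 cP σ₁ d₀ M₂ δ₀ δ₀ (1 / 12) (1 / 12) ρ₁ Λ Λ Bin hcP hσ₁0 hM₂ hBin0 hΛ0 hΛ0 hρ₁0 hr₁ hrepr hdnn
      htri hlen h261 hT0 hTi2 μ ν (hcomm μ ν) hρu (hplaq' μ ν) hd₀FB (hσ ν) heta (Gp := Gb) (r5 μ ν) (r2 μ)
    exact hasL2Majorant_mono (g := toB6 (geo9Y x) (0 : ℝ) True) _ h fun p q =>
      mul_le_mul_of_nonneg_right (mul_le_mul_of_nonneg_right (hstepI ρ₁ Bin hρ₁δ hBin0) zero_le_one) (Real.exp_nonneg _)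
  have w5_rl : ∀ μ ν, HasL2Majorant (g := toB6 (geo9Y x) (0 : ℝ) True) (fun q : (Fin (d + 1) × SiteY x.toKIdx) × ι => blkC x.toKIdx ιB q.1.2) (Gb * conj b (D (Sum.inr μ)) * conj b (D (Sum.inl ν))) (fun p q => (gX * Bin) * 1 * Real.exp (-(ρ₁ * (geo9Y x).dist p q))) :=
    fun μ ν => by
    have h := hasL2Majorant_cross_right b (bT (shiftY x.toKIdx)) (bU (UboxY x.toKIdx U)) (Rr := (0 : ℝ)) (H := True) (g := geo9Y x) (fun q : Fin (d + 1) × SiteY x.toKIdx => blkC x.toKIdx ιB q.2) dL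
      (((η : ℂ))⁻¹) 1 d₀ M₂ δ₀ δ₀ (1 / 12) (1 / 12) ρ₁ Λ Bin (fun _ => (1 : ℝ)) (fun _ => zero_le_one) hM₂ hBin0 hΛ hρ₁0 hr₁ hαδ hrepr hdnn htri h261
      hρu hd₀F ν (Gp := Gb * conj b (D (Sum.inr μ))) (r5 μ ν)
    exact hasL2Majorant_mono (g := toB6 (geo9Y x) (0 : ℝ) True) _ h fun p q =>
      mul_le_mul_of_nonneg_right (mul_le_mul_of_nonneg_right (hstep ρ₁ Bin hρ₁δ hBin0) zero_le_one) (Real.exp_nonneg _)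
  have w5_ll : ∀ μ ν, HasL2Majorant (g := toB6 (geo9Y x) (0 : ℝ) True) (fun q : (Fin (d + 1) × SiteY x.toKIdx) × ι => blkC x.toKIdx ιB q.1.2) (Gb * conj b (D (Sum.inl μ)) * conj b (D (Sum.inl ν))) (fun p q => (gX * (gI * Bin)) * 1 * Real.exp (-(ρ₂ * (geo9Y x).dist p q))) :=
    fun μ ν => by
    have h := hasL2Majorant_cross_right b (bT (shiftY x.toKIdx)) (bU (UboxY x.toKIdx U)) (Rr := (0 : ℝ)) (H := True) (g := geo9Y x) (fun q : Fin (d + 1) × SiteY x.toKIdx => blkC x.toKIdx ιB q.2) dL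
      (((η : ℂ))⁻¹) 1 d₀ M₂ δ₀ ρ₁ (1 / 12) (1 / 12) ρ₂ Λ (gI * Bin) (fun _ => (1 : ℝ)) (fun _ => zero_le_one) hM₂ (mul_nonneg hgI0 hBin0) hΛ hρ₂0 hr₂ hαδ
      hrepr hdnn htri h261 hρu hd₀F ν (Gp := Gb * conj b (D (Sum.inl μ))) (w5_li μ ν)
    exact hasL2Majorant_mono (g := toB6 (geo9Y x) (0 : ℝ) True) _ h fun p q =>
      mul_le_mul_of_nonneg_right (mul_le_mul_of_nonneg_right (hstep ρ₂ (gI * Bin) (hρ₂₁.trans hρ₁δ) (mul_nonneg hgI0 hBin0)) zero_le_one)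
        (Real.exp_nonneg _)
  -- assemble: common constant `Bx = g_X²·g_I·Bin`, common rate `δ₀/2`
  have hBx0 : 0 ≤ Bx := by rw [hBx]; positivity
  have hle1 : Bin ≤ Bx := by
    rw [hBx]
    calc Bin ≤ gI * Bin := le_mul_of_one_le_left hBin0 hgI1
      _ ≤ gX ^ 2 * (gI * Bin) := le_mul_of_one_le_left (mul_nonneg hgI0 hBin0) (one_le_pow₀ hgX1)
      _ = gX ^ 2 * gI * Bin := by ring
  have hle2 : gX * Bin ≤ Bx := by
    rw [hBx]
    calc gX * Bin ≤ gX * (gI * Bin) := mul_le_mul_of_nonneg_left (le_mul_of_one_le_left hBin0 hgI1) hgX0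
      _ ≤ gX * (gX * (gI * Bin)) := mul_le_mul_of_nonneg_left (le_mul_of_one_le_left (mul_nonneg hgI0 hBin0) hgX1) hgX0
      _ = gX ^ 2 * gI * Bin := by ring
  have hle3 : gI * Bin ≤ Bx := by
    rw [hBx]
    calc gI * Bin ≤ gX ^ 2 * (gI * Bin) := le_mul_of_one_le_left (mul_nonneg hgI0 hBin0) (one_le_pow₀ hgX1)
      _ = gX ^ 2 * gI * Bin := by ring
  have hle4 : gX * (gI * Bin) ≤ Bx := by
    rw [hBx]
    calc gX * (gI * Bin) ≤ gX * (gX * (gI * Bin)) := mul_le_mul_of_nonneg_left (le_mul_of_one_le_left (mul_nonneg hgI0 hBin0) hgX1) hgX0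
      _ = gX ^ 2 * gI * Bin := by ring
  have hle5 : gX * (gX * Bin) ≤ Bx := by
    rw [hBx]
    calc gX * (gX * Bin) ≤ gX * (gX * (gI * Bin)) :=
          mul_le_mul_of_nonneg_left (mul_le_mul_of_nonneg_left (le_mul_of_one_le_left hBin0 hgI1) hgX0) hgX0
      _ = gX ^ 2 * gI * Bin := by ring
  have mono : ∀ {Tm : Module.End ℝ ((Fin (d + 1) × SiteY x.toKIdx) × ι → ℝ)} {Bc r : ℝ} (w : (geo9Y x).Site → ℝ), (∀ p, 0 ≤ w p) → 0 ≤ Bc → Bc ≤ Bx →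
      δ₀ / 2 ≤ r →
      HasL2Majorant (g := toB6 (geo9Y x) (0 : ℝ) True) (fun q : (Fin (d + 1) × SiteY x.toKIdx) × ι => blkC x.toKIdx ιB q.1.2) Tm (fun p q => Bc * w p * Real.exp (-(r * (geo9Y x).dist p q))) →
      HasL2Majorant (g := toB6 (geo9Y x) (0 : ℝ) True) (fun q : (Fin (d + 1) × SiteY x.toKIdx) × ι => blkC x.toKIdx ιB q.1.2) Tm (fun p q => cLGY cP M₂ (∑ j, ‖b j‖) (Real.sqrt (Fintype.card ι)) d dL δ₀ Λ * B₀ * w p * Real.exp (-(δ₀ / 2 * (geo9Y x).dist p q))) := by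
    intro Tm Bc r w hw hBc hBcx hr h
    have h' := hasL2Majorant_rate_mono (R := (0 : ℝ)) (H := True) (g := geo9Y x) _ Bc w hBc hw hr hdnn h
    exact hasL2Majorant_mono (g := toB6 (geo9Y x) (0 : ℝ) True) _ h' fun p q => by
      rw [← hBxdef]; exact mul_le_mul_of_nonneg_right (mul_le_mul_of_nonneg_right hBcx (hw p)) (Real.exp_nonneg _)
  have h01 : δ₀ / 2 ≤ ρ₁ := by rw [hρ₁]; linarith
  have h02 : δ₀ / 2 ≤ ρ₂ := by rw [hρ₂]; linarith
  have h00 : δ₀ / 2 ≤ δ₀ := by linarith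
  have hw0 : ∀ _p : (geo9Y x).Site, (0 : ℝ) ≤ 1 := fun _ => zero_le_one
  refine ⟨?_, fun k => ?_, fun k => ?_, fun k l => ?_, fun k l => ?_, fun k l => ?_⟩
  · exact mono (fun p => (geo9Y x).len p ^ 2) (fun p => sq_nonneg _) hBin0 hle1 h00 r0'
  · cases k with
    | inl μ => exact mono (fun p => (geo9Y x).len p) hwℓ hBin0 hle1 h00 (r1 μ)
    | inr μ => exact mono (fun p => (geo9Y x).len p) hwℓ (mul_nonneg hgX0 hBin0) hle2 h01 (x1 μ)
  · cases k with
    | inl μ => exact mono (fun p => (geo9Y x).len p) hwℓ (mul_nonneg hgX0 hBin0) hle2 h01 (x2 μ)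
    | inr μ => exact mono (fun p => (geo9Y x).len p) hwℓ hBin0 hle1 h00 (r2 μ)
  · cases k with
    | inl μ =>
      cases l with
      | inl ν => exact mono (fun _ => (1 : ℝ)) hw0 hBin0 hle1 h00 (r3 μ ν)
      | inr ν => exact mono (fun _ => (1 : ℝ)) hw0 (mul_nonneg hgI0 hBin0) hle3 h01 (w3_li μ ν)
    | inr μ =>
      cases l with
      | inl ν =>
        rw [mul_assoc]
        exact mono (fun _ => (1 : ℝ)) hw0 (mul_nonneg hgX0 hBin0) hle2 h01 (w3_rl μ ν)
      | inr ν =>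
        rw [mul_assoc]
        exact mono (fun _ => (1 : ℝ)) hw0 (mul_nonneg hgX0 (mul_nonneg hgI0 hBin0)) hle4 h02 (w3_rr μ ν)
  · cases k with
    | inl μ =>
      cases l with
      | inl ν => exact mono (fun _ => (1 : ℝ)) hw0 (mul_nonneg hgX0 hBin0) hle2 h01 (m_ll μ ν)
      | inr ν => exact mono (fun _ => (1 : ℝ)) hw0 hBin0 hle1 h00 (r4 μ ν)
    | inr μ =>
      cases l with
      | inl ν =>
        rw [mul_assoc]
        exact mono (fun _ => (1 : ℝ)) hw0 (mul_nonneg hgX0 (mul_nonneg hgX0 hBin0)) hle5 h02 (m_rl μ ν)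
      | inr ν =>
        rw [mul_assoc]
        exact mono (fun _ => (1 : ℝ)) hw0 (mul_nonneg hgX0 hBin0) hle2 h01 (m_rr μ ν)
  · cases k with
    | inl μ =>
      cases l with
      | inl ν => exact mono (fun _ => (1 : ℝ)) hw0 (mul_nonneg hgX0 (mul_nonneg hgI0 hBin0)) hle4 h02 (w5_ll μ ν)
      | inr ν => exact mono (fun _ => (1 : ℝ)) hw0 (mul_nonneg hgI0 hBin0) hle3 h01 (w5_li μ ν)
    | inr μ =>
      cases l with
      | inl ν => exact mono (fun _ => (1 : ℝ)) hw0 (mul_nonneg hgX0 hBin0) hle2 h01 (w5_rl μ ν)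
      | inr ν => exact mono (fun _ => (1 : ℝ)) hw0 hBin0 hle1 h00 (r5 μ ν)

end All

end Literature.MathematicalPhysics.QuantumFieldTheory.Balaban1983to89.B9SectBL2GCrossYR

end

/-!
# `Balaban1983to89.B9SectBL2GFrameCodedYR` — THE CLASS-PARAMETRIC TWIN of `B9SectBL2GFrameCodedY` (CASCADE-R, director-ym №279 GO-R; №277 (3) `hunitA` cure; dag-n06-d SOCKET-(α) class question)

statement-level skeleton of published theorems with citation tags; proofs where landed; nothing here is a claim about the
Yang–Mills mass gap

WHAT THIS FILE IS.  The original module `B9SectBL2GFrameCodedY` types its objects over MODULE 3's member carrier `bg9Y 𝔸 G x` (MODULE 2's small-cube class (3.35)).  This file RE-DECLARES, with UNCHANGED NAMES inside the namespace `…B9SectBL2GFrameCodedYR`, exactly its 2 class-dependent declarations over the CLASS-PARAMETRIC carrier `B9SectBCodedClassR.bg9YC 𝔸 G P x` (`P : RegExtraY …` = the two cube conditions of (3.35)∕(3.36) as a parameter; `bg9Y 𝔸 G x = bg9YC 𝔸 G (extraY 𝔸 G) x` by `rfl`, so every declaration here WITHOUT the `hunitA` binder specialises definitionally to its original; EXCEPTION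 (v1.1, №288 (4), ref-E READ-13 HEADER-NIT): `l2GFrame₇CodedOn`, `stepL2Pos_KACU_frame_on` carry the №277 RE-KEYED `hunitA` (WEAKER hypothesis), so at `P := extraY 𝔸 G` they IMPLY the originals via `fun j α₀ U hU => hunitA j U hU.1.1` (ref-E K3), NOT a definitional specialisation; CAVEAT (LOCATED-18, №290 (1)): no α₀-threshold ⇒ still uninhabitable at `SU(N)` — consumers use the GUARDED `…RG` twin; at the record's reading of PRINT's class, `P := extraYPb 𝔸 G`, the displayed laws `hreg335P` ((3.35) on plaquettes) and the class-keyed `hunitA` become theorems).  The text is the original's VERBATIM under the token surgery `bg9Y 𝔸 G ↦ bg9YC 𝔸 G P`, `NAME ↦ NAME P` for the class-dependent names (P the first explicit argument), and — №277 — the binder `hunitA` re-keyed from «all G-valued U» to «all (3.35)-regular U of the carrier» (`∀ j α₀ U, (bg9YC 𝔸 G P (f j)).Reg335 c35 α₀ U → IsUnit (deltaAY …)`) with its use sites (`hunitA j U hU ↦ hunitA j α₀ U hU`) — NOT verbatim for the declarations named above.  Class-free declarations of the original are NOT copied: they are imported and used BY NAME (`open … hiding` the re-declared ones).  Generated by dag-n06-c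 g16's `gen.py` (HOME `pub-ymgap-dag-n06-c/lean/g16/`); the ORIGINAL MODULE DOCUMENTATION FOLLOWS VERBATIM and describes the mathematics.

HONEST SCOPE.  Re-typing bookkeeping; nothing of [B9] asserted beyond the original; COUNT-NEUTRAL; N06 NOT discharged; nothing continuum ∕ OS ∕ mass gap ∕ Clay.  Cell `pub-ymgap` (D-0062), Track A node N06 [B9], seat `pub-ymgap-dag-n06-c` g16, 2026-08-29.
-/

/-! Module documentation: that of the original `Balaban1983to89.B9SectBL2GFrameCodedY` applies verbatim to this twin (not repeated here). -/

noncomputable section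

namespace Literature.MathematicalPhysics.QuantumFieldTheory.Balaban1983to89.B9SectBL2GFrameCodedYR

open Literature.MathematicalPhysics.QuantumFieldTheory.Balaban1983to89.B9SectBCodedClassR (RegExtraY bg9YC)
open Literature.MathematicalPhysics.QuantumFieldTheory.Balaban1983to89.B9SectBL2GFrameCodedY hiding l2GFrame₇CodedOn stepL2Pos_KACU_frame_on

open B6Ineq2142KLevelV1 (β)
open B6KLevelCensusIndexV1 (KIdx kGeo)
open B6RandomWalk (Ineq261)
open B6RandomWalkL2 (HasL2Majorant hasL2Majorant_mono)
open B9Thm34Ext (toB6)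
open B9Ineq347 (ScaleTransfer)
open B9FromB6 (EBlock L2Block pref6_nonneg)
open B9Eq352DivFormLetters (conj)
open B9Eq352GradLetters (diffLetter)
open B9Eq371GradLetters (bT bU)
open B9PinMembersKLevelV1 (MemberY geo9Y bg9Y)
open B9Eq360DeltaPrimeAY (AfldY)
open B9SectBGpLettersY (GVal)
open B9SectBGpFrameCodedYR (codingYx)
open B9SectBGpFrameCodedY (CplxLettersY exists_d261)
open B9SectBGpReadingsYR (KSC)
open B9SectBCodedCarrier (pullS)
open B9SectBCodedReadingsUR (KACU)
open B9SectBKerFrameCodedYR (CinvY)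
open B9SectBStepWhole (StepL2Pos)
open B9RWSumsReadsNbr (nbr mem_nbr)
open B9RWSums347DefiniteFacesWindow (scaleTransfer6_window_geo9Y)
open B9SectBGClassLettersY (Reg335PlaqY CplxLettersGY VarParBY)
open B9SectBGFrameV5 (GFrame₅)
open B9SectBGFrameCodedYR (gFrame₅CodedOn)
open B9SectBL2GFrameV7 (L2GFrame₇ stepL2Pos_of_l2GFrame₇)
open B9SectBL2GCrossYR (readGL2_GbC_all)
open B9SectBL2GCrossY (cLGY cLGY_nonneg plaqLawY_of_reg335PlaqY)
open B9SectBL2GReadCodedYR (writeGL2_GbC)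
open B9Thm34GL2Entries (pOneConc)
open B9GeoLemma21KLevelV1 (geo9K_one_le_L geo9Y_len_pos)
open B9GeoNormsKLevelV1 (geo9K_l2Norm_nonneg geo9K_cutSup_nonneg)
open Node00 (SiteY BlkY FBondY IBondY CfgY SiteParY BondParY GAY GpY XY deltaAY deltaPrimeAY)

universe u

variable {d ℓ : ℕ} {hd : 1 ≤ d + 1} {hL : Odd (ℓ + 1) ∧ 1 < ℓ + 1} {b₀ b₁ : ℝ} {Mstar : ℕ}
variable {𝔸 : Type} [NormedRing 𝔸] (P : RegExtraY d ℓ hd hL b₀ b₁ Mstar 𝔸) [NormedAlgebra ℂ 𝔸] [CompleteSpace 𝔸]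

/-! ## §1 The four displayed printed letter laws in block-`ℓ²`, as predicates on a G frame -/

section Laws

variable {I : Type} {c35 : ℝ} {geo : I → B9.Geometry} {bg : I → B9.Backgrounds} {Gp : ∀ i, B9.KernelFamily (geo i) (bg i)}
  {ι : Type} [Fintype ι] [DecidableEq ι] {b : Module.Basis ι ℝ 𝔸} {κ : Type} [Fintype κ] [LinearOrder κ]
  {S : I → Type} [∀ i, Fintype (S i)] [∀ i, DecidableEq (S i)] [∀ i, Fintype (geo i).Site] [∀ i, DecidableEq (geo i).Site] [∀ i, Nonempty (geo i).Site]
  {P : I → Type} [∀ i, Fintype (P i)] [∀ i, DecidableEq (P i)] {GA : ∀ i, B9.KernelFamily (geo i) (bg i)} {Cinv : ∀ i, B9.SiteKernel (geo i) (bg i)}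

end Laws

/-! ## §2 Record suppliers: [4] Lemma 2.1, a radius bookkeeping, the `L²` block is monotone in its constant -/

section Suppliers

variable [∀ x : MemberY d ℓ hd hL b₀ b₁ Mstar, Fintype (geo9Y x).Site]

end Suppliers

/-! ## §3 ★★★ The `L²` frame inhabited over the coded carriers of a subfamily -/

section Instance

variable [NormOneClass 𝔸] [FiniteDimensional ℝ 𝔸] {J : Type} (f : J → MemberY d ℓ hd hL b₀ b₁ Mstar)
  [∀ x : MemberY d ℓ hd hL b₀ b₁ Mstar, Fintype (geo9Y x).Site]
  [instDS : ∀ x : MemberY d ℓ hd hL b₀ b₁ Mstar, DecidableEq (geo9Y x).Site] [instNE : ∀ x : MemberY d ℓ hd hL b₀ b₁ Mstar, Nonempty (geo9Y x).Site]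
  (c35 : ℝ) (G : Subgroup 𝔸ˣ) (par : ∀ j : J, SiteParY 𝔸 (f j).toKIdx) (parB : ∀ j : J, BondParY 𝔸 (f j).toKIdx)
  {ι : Type} [Fintype ι] [DecidableEq ι] (b : Module.Basis ι ℝ 𝔸) (ιB : ∀ j : J, BlkY (f j).toKIdx → IBondY (f j).toKIdx)
  (C37 C38 : ∀ j : J, ℝ → CfgY 𝔸 (f j).toKIdx → AfldY 𝔸 (f j).toKIdx → Prop)

set_option maxHeartbeats 1600000 in
/-- ★★★ **THE `L²` FRAME `L2GFrame₇` OVER THE CODED CARRIERS OF A SUBFAMILY, INHABITED FOR `KACU`**: gen 13's `gFrame₅CodedOn` extended by the `L²` reading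
constant `cLG δ = cLGY (2C₀) M₂ S_b s_ι d (d261 δ) δ L⁴`, output rate `δ/2`, threshold `max (M261 δ) (48 log L / δ)`, the writing function
`m_N·c_L·L²·e^{δ}·B + 1`, the `L²` reading PROVED (`readGL2_GbC_all`) and writing PROVED (`writeGL2_GbC`), and the four displayed printed letter laws of §1.
[cite: Balaban1985BackgroundPropagators, Thm 3.4 p.400, Thm 3.3 p.399, (3.46) p.398, p.398 (first remark), (3.15) p.393, (3.24) p.394, (3.77) p.406, (3.80)–(3.81) p.406, (3.82)–(3.86) p.407; Balaban1984PropagatorsII, Lemma 2.1 p.234, Prop. 2.6 (2.140)–(2.141) p.247] -/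
noncomputable def l2GFrame₇CodedOn (hι : ∀ (j : J) (s : BlkY (f j).toKIdx), β (f j).toKIdx.hN (f j).toKIdx.D (f j).toKIdx.hk (ιB j s) = s)
    (hG1 : ∀ u : 𝔸ˣ, u ∈ G → ‖(u : 𝔸)‖ ≤ 1) (hpar : ∀ j (U : CfgY 𝔸 (f j).toKIdx), GVal G (f j).toKIdx U → ∀ z w, par j U z w ∈ G)
    (hunit : ∀ j (U : CfgY 𝔸 (f j).toKIdx), GVal G (f j).toKIdx U → IsUnit (deltaPrimeAY (f j).toKIdx (par j) U))
    (M₂ : ℝ) (hM₂ : 0 ≤ M₂) (hrepr : ∀ (v : 𝔸) (j : ι), |b.repr v j| ≤ M₂ * ‖v‖) (hcR : 0 < M₂ * ∑ j, ‖b j‖)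
    (Cq : ℝ) (hCq : 0 ≤ Cq) (hC37 : ∀ j β' U a, C37 j β' U a → GVal G (f j).toKIdx U ∧ CplxLettersY G (f j) (par j) (ιB j) Cq β' U a)
    (MInv aInv aW : ℝ) (hMInv : 0 < MInv) (haInv : 0 < aInv) (haW : 0 < aW)
    (hunitX : ∀ j (U : CfgY 𝔸 (f j).toKIdx), GVal G (f j).toKIdx U → IsUnit (XY (f j).toKIdx (par j) (GpY (f j).toKIdx (par j)) U))
    (hsym : ∀ j (U : CfgY 𝔸 (f j).toKIdx) (z w : SiteY (f j).toKIdx), par j U z w = (par j U w z)⁻¹)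
    (hunitA : ∀ j (α₀ : ℝ) (U : CfgY 𝔸 (f j).toKIdx), (bg9YC 𝔸 G P (f j)).Reg335 c35 α₀ U → IsUnit (deltaAY (f j).toKIdx (par j) (parB j) (GpY (f j).toKIdx (par j)) U))
    (hparB : ∀ j (U : CfgY 𝔸 (f j).toKIdx), GVal G (f j).toKIdx U → ∀ y f', parB j U y f' ∈ G) (hb₁ : 0 ≤ b₁)
    (C₀ : ℝ) (hC₀ : 0 ≤ C₀)
    (hreg335P : ∀ j (α₀ : ℝ) (U : CfgY 𝔸 (f j).toKIdx), MInv ≤ (geo9Y (f j)).M → 0 < α₀ → (geo9Y (f j)).M * α₀ ≤ aInv →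
      (bg9YC 𝔸 G P (f j)).Reg335 c35 α₀ U → Reg335PlaqY G (f j) (ιB j) C₀ U)
    (hC37G : ∀ j β' U a, C37 j β' U a → CplxLettersGY G (f j) (ιB j) β' U a)
    (cVar : ℝ) (hcVar : 0 ≤ cVar) (hvarB : ∀ j β' U a, C37 j β' U a → VarParBY (f j).toKIdx (parB j) cVar β' U a)
    (hMd : 2 * ((d : ℝ) + 1) < MInv) (mN : ℕ) (hnbr : ∀ (j : J) (y' : IBondY (f j).toKIdx), (nbr (geo9Y (f j)) (2 * ((d : ℝ) + 1)) y').card ≤ mN)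
    (κ2 : ℝ) (hκ2 : 0 ≤ κ2) (hQbL2 : L2SizeQb (gFrame₅CodedOn P f c35 G par parB b ιB C37 C38 hι hG1 hpar hunit M₂ hM₂ hrepr hcR Cq hCq hC37 MInv aInv aW hMInv haInv haW hunitX hsym hunitA hparB hb₁ C₀
        hC₀ hreg335P hC37G cVar hcVar hvarB hMd mN hnbr) κ2)
    (c2 : ℝ) (hc2 : 0 ≤ c2) (hF₂L2 : L2SizeF₂ (gFrame₅CodedOn P f c35 G par parB b ιB C37 C38 hι hG1 hpar hunit M₂ hM₂ hrepr hcR Cq hCq hC37 MInv aInv aW hMInv haInv haW hunitX hsym hunitA hparB hb₁ C₀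
        hC₀ hreg335P hC37G cVar hcVar hvarB hMd mN hnbr) c2)
    (abar2 : ℝ) (habar2 : 0 ≤ abar2) (haL2 : L2SizeAb (gFrame₅CodedOn P f c35 G par parB b ιB C37 C38 hι hG1 hpar hunit M₂ hM₂ hrepr hcR Cq hCq hC37 MInv aInv aW hMInv haInv haW hunitX hsym hunitA hparB hb₁ C₀
        hC₀ hreg335P hC37G cVar hcVar hvarB hMd mN hnbr) abar2)
    (h377 : Read377L2 (gFrame₅CodedOn P f c35 G par parB b ιB C37 C38 hι hG1 hpar hunit M₂ hM₂ hrepr hcR Cq hCq hC37 MInv aInv aW hMInv haInv haW hunitX hsym hunitA hparB hb₁ C₀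
        hC₀ hreg335P hC37G cVar hcVar hvarB hMd mN hnbr)) :
    L2GFrame₇ c35 (fun j => geo9Y (f j)) (fun j => (codingYx P G (f j) (C37 j) (C38 j)).bg) (fun j => KSC P G (f j) (par j) (C37 j) (C38 j)) b (Fin (d + 1))
      (fun j => SiteY (f j).toKIdx) (fun j => BlkY (f j).toKIdx × ι)
      (fun j => KACU P G (f j) (GAY (f j).toKIdx (par j) (parB j) (GpY (f j).toKIdx (par j))) (parB j) (C37 j) (C38 j))
      (fun j => pullS (codingYx P G (f j) (C37 j) (C38 j)) (CinvY P f G par j)) :=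
  { gFrame₅CodedOn P f c35 G par parB b ιB C37 C38 hι hG1 hpar hunit M₂ hM₂ hrepr hcR Cq hCq hC37 MInv aInv aW hMInv haInv haW hunitX hsym hunitA hparB hb₁ C₀
        hC₀ hreg335P hC37G cVar hcVar hvarB hMd mN hnbr with
    cLG := fun δ => cLGY (2 * C₀) M₂ (∑ j, ‖b j‖) (Real.sqrt (Fintype.card ι)) d (d261Y (d := d) (ℓ := ℓ) (hd := hd) (hL := hL) (b₀ := b₀) (b₁ := b₁) (Mstar := Mstar) δ) δ (((ℓ : ℝ) + 1) ^ 4)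
    κQb2 := κ2
    cFb2 := c2
    abar2 := abar2
    wLG := fun B δ => (mN : ℝ) * (Real.sqrt (Fintype.card ι) * M₂ * ∑ j, ‖b j‖) * (((ℓ + 1 : ℕ) : ℝ)) ^ 2 * Real.exp δ * B + 1
    wLGδ := fun δ => δ
    rLG := fun δ => δ / 2
    ML2 := fun δ => max (M261Y (d := d) (ℓ := ℓ) (hd := hd) (hL := hL) (b₀ := b₀) (b₁ := b₁) (Mstar := Mstar) δ) (4 * Real.log ((ℓ : ℝ) + 1) / (δ / 12))
    cLG_pos := fun δ hδ => by
      -- `cLGY = g_X²·g_I·(s_ι M₂ S_b)`, `g ≥ 1`, `s_ι M₂ S_b > 0`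
      have hSb : 0 < ∑ j, ‖b j‖ := by
        rcases (mul_pos_iff.1 hcR) with ⟨-, h⟩ | ⟨h1, -⟩
        · exact h
        · exact absurd h1 (not_lt.2 hM₂)
      have hne : Nonempty ι := by
        by_contra hι'
        rw [not_nonempty_iff] at hι'
        have : ∑ j, ‖b j‖ = 0 := Finset.sum_eq_zero fun j _ => (IsEmpty.false j).elim
        linarith
      have hcard : (0 : ℝ) < Fintype.card ι := by exact_mod_cast Fintype.card_pos
      have hM₂' : 0 < M₂ := by
        rcases (mul_pos_iff.1 hcR) with ⟨h, -⟩ | ⟨-, h2⟩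
        · exact h
        · exact absurd h2 (not_lt.2 hSb.le)
      have hc1 := B6RandomWalk.c1_nonneg (d261Y (d := d) (ℓ := ℓ) (hd := hd) (hL := hL) (b₀ := b₀) (b₁ := b₁) (Mstar := Mstar) δ) δ (1 / 12)
      unfold cLGY
      have hs : 0 < Real.sqrt (Fintype.card ι) * M₂ * ∑ j, ‖b j‖ := by positivity
      have h1 : (1 : ℝ) ≤ (1 + ((1 : ℝ) ^ 2 * M₂ * (∑ j, ‖b j‖) * Real.sqrt (Fintype.card ι) * Real.exp (δ * (2 * ((d : ℝ) + 1)))) *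
          (((ℓ : ℝ) + 1) ^ 4) * B6.c1 (d261Y (d := d) (ℓ := ℓ) (hd := hd) (hL := hL) (b₀ := b₀) (b₁ := b₁) (Mstar := Mstar) δ) δ (1 / 12)) ^ 2 :=
        one_le_pow₀ (le_add_of_nonneg_right (by positivity))
      have h2 : (1 : ℝ) ≤ 1 + B6.c1 (d261Y (d := d) (ℓ := ℓ) (hd := hd) (hL := hL) (b₀ := b₀) (b₁ := b₁) (Mstar := Mstar) δ) δ (1 / 12) * M₂ * (∑ j, ‖b j‖) * Real.sqrt (Fintype.card ι) *
          ((1 : ℝ) ^ 2 * Real.exp (δ * (2 * ((d : ℝ) + 1))) * ((ℓ : ℝ) + 1) ^ 4 +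
            (1 : ℝ) ^ 4 * (2 * C₀) * (((ℓ : ℝ) + 1) ^ 4 * Real.exp (1 / 12 * δ * (2 * ((d : ℝ) + 1)))) *
              Real.exp (δ * (2 * (2 * ((d : ℝ) + 1)))) * ((ℓ : ℝ) + 1) ^ 4) :=
        le_add_of_nonneg_right (by positivity)
      have := mul_le_mul h1 h2 zero_le_one (zero_le_one.trans h1)
      nlinarith
    rLG_pos := fun δ hδ => by positivity
    rLG_le := fun δ hδ => by linarith
    κQb2_nonneg := hκ2
    cFb2_nonneg := hc2
    abar2_nonneg := habar2
    wLG_pos := fun B δ hB _ => by positivity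
    wLGδ_pos := fun δ hδ => hδ
    hQb2 := fun j α₀ c δ hM hα₀ hMa hreg hδ hδc => (hQbL2 j α₀ c δ hM hα₀ hMa hreg hδ hδc).1
    hQsb2 := fun j α₀ c δ hM hα₀ hMa hreg hδ hδc => (hQbL2 j α₀ c δ hM hα₀ hMa hreg hδ hδc).2
    hF₂2 := fun j α₁ c c' hα₁ h37 δ hδ hδc => hF₂L2 j α₁ c c' hα₁ h37 δ hδ hδc
    ha2 := fun j => haL2 j
    readGL2 := fun j α₀ c B₀ δ hM hML hα₀ hMa hreg hB₀ hδ hL2 => by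
      letI : Fintype (B9GeoNormsKLevelV1.geo9K (f j).toKIdx).Site := ‹∀ x : MemberY d ℓ hd hL b₀ b₁ Mstar, Fintype (geo9Y x).Site› (f j)
      obtain ⟨U, rfl, hU⟩ := (codingYx P G (f j) (C37 j) (C38 j)).exists_of_bg_Reg335 hreg
      have hM261 : M261Y (d := d) (ℓ := ℓ) (hd := hd) (hL := hL) (b₀ := b₀) (b₁ := b₁) (Mstar := Mstar) δ ≤ (geo9Y (f j)).M := le_trans (le_max_left _ _) hML
      have hMST : 4 * Real.log ((ℓ : ℝ) + 1) / (δ / 12) ≤ (geo9Y (f j)).M := le_trans (le_max_right _ _) hML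
      have h261 := d261Y_spec (f j) hδ (by norm_num : (9 : ℝ) / 5000 ≤ 1 / 12) (by norm_num) hM261
      have hκlo : 0 < δ / 12 := by positivity
      obtain ⟨hT1, -, -, hT2i, -, -⟩ := scaleTransfer6_window_geo9Y hκlo (f j) (δ := δ) (α := 1 / 12) (by linarith) hMST
      have hTi2 : ScaleTransfer (geo9Y (f j)) δ (1 / 12) (((ℓ : ℝ) + 1) ^ 4) (fun a => ((geo9Y (f j)).len a)⁻¹ ^ 2) := by
        have e : (fun a => ((geo9Y (f j)).len a)⁻¹ ^ 2) = (fun a => ((geo9Y (f j)).len a ^ 2)⁻¹) := funext fun a => by rw [inv_pow]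
        rw [e]; exact hT2i
      have hΛ : (1 : ℝ) ≤ ((ℓ : ℝ) + 1) ^ 4 := one_le_pow₀ (by have : (0 : ℝ) ≤ ℓ := Nat.cast_nonneg ℓ; linarith)
      have hplaq := plaqLawY_of_reg335PlaqY G (f j) (ιB j) hG1 hU.1.1 hC₀ (hreg335P j α₀ U hM hα₀ hMa hU)
      exact readGL2_GbC_all P G (f j) (par j) (parB j) b (ιB j) (C37 j) (C38 j) (hι j) hG1 hM₂ hrepr hδ h261 hΛ hT1 hTi2 (by positivity) hU.1.1 hplaq
        hB₀.le hL2
    writeGL2 := fun j α₀ c c' α₁ B δ hM hα₀ hMa hreg hα₁ haW' h37 hB hδ h0 h1 h2 h3 h4 h5 => by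
      letI : Fintype (B9GeoNormsKLevelV1.geo9K (f j).toKIdx).Site := ‹∀ x : MemberY d ℓ hd hL b₀ b₁ Mstar, Fintype (geo9Y x).Site› (f j)
      obtain ⟨U, a, rfl, rfl, hC⟩ := (codingYx P G (f j) (C37 j) (C38 j)).exists_of_bg_Cplx337 h37
      have hUG := (hC37 j α₁ U a hC).1
      have hnbr1 : ∀ y : IBondY (f j).toKIdx, (nbr (geo9Y (f j)) 1 y).card ≤ mN := fun y =>
        (card_nbr_mono (f j) (by have : (0 : ℝ) ≤ d := Nat.cast_nonneg d; linarith) y).trans (hnbr j y)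
      have hw := writeGL2_GbC P (Rr := 0) (Hp := True) G (f j) (par j) (parB j) b (ιB j) (C37 j) (C38 j) (hι j) hM₂ hrepr hnbr1 U hUG a hB hδ.le
        h0 (fun ν => h1 (Sum.inl ν)) (fun ν => h2 (Sum.inr ν)) (fun ν μ => h4 (Sum.inl ν) (Sum.inr μ)) (fun ν μ => h3 (Sum.inl ν) (Sum.inl μ))
        (fun ν μ => h5 (Sum.inr ν) (Sum.inr μ))
      exact l2Block_mono_const (f j) _ hw (by linarith)
    read377 := fun B₀ δ₀ B₁ δ₁ hB₀ hδ₀ hB₁ hδ₁ => h377 B₀ δ₀ B₁ δ₁ hB₀ hδ₀ hB₁ hδ₁ }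

/-- ★★ **`StepL2Pos` OF THE CODED BOND FAMILY `KACU` THROUGH THE `L²` FRAME — THE (3.46) MEMBER OF THE SECT.-B STEP OF RECORD, G SIDE** (gen 14's
`stepL2Pos_of_l2GFrame₇` on `l2GFrame₇CodedOn`), GIVEN the Lemma-2.1 datum `(d261, h261)` of the frame; site family `KSC`, output family
`KACU G (f j) (GAY … (par j) (parB j) (GpY (par j))) (parB j) …`; displayed: gen 13's laws and the four printed ℓ² letter laws of §1.
[cite: Balaban1985BackgroundPropagators, Thm 3.4 p.400, Thm 3.3 p.399, Thm 3.1 (3.46) p.398, (3.82)–(3.86) p.407; Balaban1984PropagatorsII, Lemma 2.1 p.234, Prop. 2.6 (2.140)–(2.141) p.247] -/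
theorem stepL2Pos_KACU_frame_on (hι : ∀ (j : J) (s : BlkY (f j).toKIdx), β (f j).toKIdx.hN (f j).toKIdx.D (f j).toKIdx.hk (ιB j s) = s)
    (hG1 : ∀ u : 𝔸ˣ, u ∈ G → ‖(u : 𝔸)‖ ≤ 1) (hpar : ∀ j (U : CfgY 𝔸 (f j).toKIdx), GVal G (f j).toKIdx U → ∀ z w, par j U z w ∈ G)
    (hunit : ∀ j (U : CfgY 𝔸 (f j).toKIdx), GVal G (f j).toKIdx U → IsUnit (deltaPrimeAY (f j).toKIdx (par j) U))
    (M₂ : ℝ) (hM₂ : 0 ≤ M₂) (hrepr : ∀ (v : 𝔸) (j : ι), |b.repr v j| ≤ M₂ * ‖v‖) (hcR : 0 < M₂ * ∑ j, ‖b j‖)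
    (Cq : ℝ) (hCq : 0 ≤ Cq) (hC37 : ∀ j β' U a, C37 j β' U a → GVal G (f j).toKIdx U ∧ CplxLettersY G (f j) (par j) (ιB j) Cq β' U a)
    (MInv aInv aW : ℝ) (hMInv : 0 < MInv) (haInv : 0 < aInv) (haW : 0 < aW)
    (hunitX : ∀ j (U : CfgY 𝔸 (f j).toKIdx), GVal G (f j).toKIdx U → IsUnit (XY (f j).toKIdx (par j) (GpY (f j).toKIdx (par j)) U))
    (hsym : ∀ j (U : CfgY 𝔸 (f j).toKIdx) (z w : SiteY (f j).toKIdx), par j U z w = (par j U w z)⁻¹)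
    (hunitA : ∀ j (α₀ : ℝ) (U : CfgY 𝔸 (f j).toKIdx), (bg9YC 𝔸 G P (f j)).Reg335 c35 α₀ U → IsUnit (deltaAY (f j).toKIdx (par j) (parB j) (GpY (f j).toKIdx (par j)) U))
    (hparB : ∀ j (U : CfgY 𝔸 (f j).toKIdx), GVal G (f j).toKIdx U → ∀ y f', parB j U y f' ∈ G) (hb₁ : 0 ≤ b₁)
    (C₀ : ℝ) (hC₀ : 0 ≤ C₀)
    (hreg335P : ∀ j (α₀ : ℝ) (U : CfgY 𝔸 (f j).toKIdx), MInv ≤ (geo9Y (f j)).M → 0 < α₀ → (geo9Y (f j)).M * α₀ ≤ aInv →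
      (bg9YC 𝔸 G P (f j)).Reg335 c35 α₀ U → Reg335PlaqY G (f j) (ιB j) C₀ U)
    (hC37G : ∀ j β' U a, C37 j β' U a → CplxLettersGY G (f j) (ιB j) β' U a)
    (cVar : ℝ) (hcVar : 0 ≤ cVar) (hvarB : ∀ j β' U a, C37 j β' U a → VarParBY (f j).toKIdx (parB j) cVar β' U a)
    (hMd : 2 * ((d : ℝ) + 1) < MInv) (mN : ℕ) (hnbr : ∀ (j : J) (y' : IBondY (f j).toKIdx), (nbr (geo9Y (f j)) (2 * ((d : ℝ) + 1)) y').card ≤ mN)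
    (κ2 : ℝ) (hκ2 : 0 ≤ κ2) (hQbL2 : L2SizeQb (gFrame₅CodedOn P f c35 G par parB b ιB C37 C38 hι hG1 hpar hunit M₂ hM₂ hrepr hcR Cq hCq hC37 MInv aInv aW hMInv haInv haW hunitX hsym hunitA hparB hb₁ C₀
        hC₀ hreg335P hC37G cVar hcVar hvarB hMd mN hnbr) κ2)
    (c2 : ℝ) (hc2 : 0 ≤ c2) (hF₂L2 : L2SizeF₂ (gFrame₅CodedOn P f c35 G par parB b ιB C37 C38 hι hG1 hpar hunit M₂ hM₂ hrepr hcR Cq hCq hC37 MInv aInv aW hMInv haInv haW hunitX hsym hunitA hparB hb₁ C₀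
        hC₀ hreg335P hC37G cVar hcVar hvarB hMd mN hnbr) c2)
    (abar2 : ℝ) (habar2 : 0 ≤ abar2) (haL2 : L2SizeAb (gFrame₅CodedOn P f c35 G par parB b ιB C37 C38 hι hG1 hpar hunit M₂ hM₂ hrepr hcR Cq hCq hC37 MInv aInv aW hMInv haInv haW hunitX hsym hunitA hparB hb₁ C₀
        hC₀ hreg335P hC37G cVar hcVar hvarB hMd mN hnbr) abar2)
    (h377 : Read377L2 (gFrame₅CodedOn P f c35 G par parB b ιB C37 C38 hι hG1 hpar hunit M₂ hM₂ hrepr hcR Cq hCq hC37 MInv aInv aW hMInv haInv haW hunitX hsym hunitA hparB hb₁ C₀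
        hC₀ hreg335P hC37G cVar hcVar hvarB hMd mN hnbr)) (d261 : ℝ → ℕ)
    (h261 : ∀ (j : J) (δ α : ℝ), 0 < δ → δ ≤ 1 → 9 / 5000 ≤ α → α < 1 →
      (gFrame₅CodedOn P f c35 G par parB b ιB C37 C38 hι hG1 hpar hunit M₂ hM₂ hrepr hcR Cq hCq hC37 MInv aInv aW hMInv haInv haW hunitX hsym hunitA hparB hb₁ C₀
        hC₀ hreg335P hC37G cVar hcVar hvarB hMd mN hnbr).M261 δ ≤ (geo9Y (f j)).M →
      Ineq261 (d261 δ) (toB6 (geo9Y (f j)) 0 True) δ α) :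
    StepL2Pos (d + 1) c35 (fun j => geo9Y (f j)) (fun j => (codingYx P G (f j) (C37 j) (C38 j)).bg) (fun j => KSC P G (f j) (par j) (C37 j) (C38 j))
      (fun j => KACU P G (f j) (GAY (f j).toKIdx (par j) (parB j) (GpY (f j).toKIdx (par j))) (parB j) (C37 j) (C38 j))
      (fun j => pullS (codingYx P G (f j) (C37 j) (C38 j)) (CinvY P f G par j))
      (fun j => KACU P G (f j) (GAY (f j).toKIdx (par j) (parB j) (GpY (f j).toKIdx (par j))) (parB j) (C37 j) (C38 j)) :=
  stepL2Pos_of_l2GFrame₇ (F := l2GFrame₇CodedOn P f c35 G par parB b ιB C37 C38 hι hG1 hpar hunit M₂ hM₂ hrepr hcR Cq hCq hC37 MInv aInv aW hMInv haInv haW hunitX hsym hunitA hparB hb₁ C₀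
        hC₀ hreg335P hC37G cVar hcVar hvarB hMd mN hnbr κ2 hκ2 hQbL2 c2 hc2 hF₂L2 abar2 habar2 haL2 h377) d261 h261

end Instance

end Literature.MathematicalPhysics.QuantumFieldTheory.Balaban1983to89.B9SectBL2GFrameCodedYR

end

/-!
# `Balaban1983to89.B9SectBQSizesL2YR` — THE CLASS-PARAMETRIC TWIN of `B9SectBQSizesL2Y` (CASCADE-R, director-ym №279 GO-R; №277 (3) `hunitA` cure; dag-n06-d SOCKET-(α) class question)

statement-level skeleton of published theorems with citation tags; proofs where landed; nothing here is a claim about the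
Yang–Mills mass gap

WHAT THIS FILE IS.  The original module `B9SectBQSizesL2Y` types its objects over MODULE 3's member carrier `bg9Y 𝔸 G x` (MODULE 2's small-cube class (3.35)).  This file RE-DECLARES, with UNCHANGED NAMES inside the namespace `…B9SectBQSizesL2YR`, exactly its 1 class-dependent declarations over the CLASS-PARAMETRIC carrier `B9SectBCodedClassR.bg9YC 𝔸 G P x` (`P : RegExtraY …` = the two cube conditions of (3.35)∕(3.36) as a parameter; `bg9Y 𝔸 G x = bg9YC 𝔸 G (extraY 𝔸 G) x` by `rfl`, so every declaration here WITHOUT the `hunitA` binder specialises definitionally to its original; EXCEPTION (v1.1, №288 (4), ref-E READ-13 HEADER-NIT): `l2SizeAb_gFrame₅CodedOn` carries the №277 RE-KEYED `hunitA` (WEAKER hypothesis), so at `P := extraY 𝔸 G` it IMPLIES the original via `fun j α₀ U hU => hunitA j U hU.1.1` (ref-E K3), NOT a definitional specialisation; CAVEAT (LOCATED-18, №290 (1)): no α₀-threshold ⇒ still uninhabitable at `SU(N)` — consumers use the GUARDED `…RG` twin; at the record's reading of PRINT's class, `P := extraYPb 𝔸 G`, the displayed laws `hreg335P` ((3.35)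 on plaquettes) and the class-keyed `hunitA` become theorems).  The text is the original's VERBATIM under the token surgery `bg9Y 𝔸 G ↦ bg9YC 𝔸 G P`, `NAME ↦ NAME P` for the class-dependent names (P the first explicit argument), and — №277 — the binder `hunitA` re-keyed from «all G-valued U» to «all (3.35)-regular U of the carrier» (`∀ j α₀ U, (bg9YC 𝔸 G P (f j)).Reg335 c35 α₀ U → IsUnit (deltaAY …)`) with its use sites (`hunitA j U hU ↦ hunitA j α₀ U hU`) — NOT verbatim for the declaration named above.  Class-free declarations of the original are NOT copied: they are imported and used BY NAME (`open … hiding` the re-declared ones).  Generated by dag-n06-c g16's `gen.py` (HOME `pub-ymgap-dag-n06-c/lean/g16/`); the ORIGINAL MODULE DOCUMENTATION FOLLOWS VERBATIM and describes the mathematics.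

HONEST SCOPE.  Re-typing bookkeeping; nothing of [B9] asserted beyond the original; COUNT-NEUTRAL; N06 NOT discharged; nothing continuum ∕ OS ∕ mass gap ∕ Clay.  Cell `pub-ymgap` (D-0062), Track A node N06 [B9], seat `pub-ymgap-dag-n06-c` g16, 2026-08-29.
-/

/-! Module documentation: that of the original `Balaban1983to89.B9SectBQSizesL2Y` applies verbatim to this twin (not repeated here). -/

noncomputable section

namespace Literature.MathematicalPhysics.QuantumFieldTheory.Balaban1983to89.B9SectBQSizesL2YR

open Literature.MathematicalPhysics.QuantumFieldTheory.Balaban1983to89.B9SectBCodedClassR (RegExtraY bg9YC)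
open Literature.MathematicalPhysics.QuantumFieldTheory.Balaban1983to89.B9SectBQSizesL2Y hiding l2SizeAb_gFrame₅CodedOn

open B6Ineq2142KLevelV1 (β)
open B6KLevelCensusIndexV1 (KIdx kGeo)
open B6RandomWalk (blockPiece)
open B6RandomWalkL2 (l2n l2n_smul l2n_mono l2n_nonneg HasL2Majorant hasL2Majorant_mono)
open B9Thm34Ext (toB6)
open B9GeoNormsKLevelV1 (geo9K)
open B9Eq352DivFormLetters (conj conj_apply coordEquiv coordEquiv_apply)
open B9PinMembersKLevelV1 (MemberY geo9Y bg9Y)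
open B9Eq360DeltaPrimeAY (blkY AfldY)
open B9SectBGpLettersY (GVal blkC)
open B9SectBGpFrameCodedYR (codingYx)
open B9SectBGpFrameCodedY (CplxLettersY)
open B9SectBGWordDeltaAY (bondOpCoordsRY bondOpCoordsRY_apply restrictScalars_bondOpCoordsY volY volY_pos abC abVY)
open B9SectBQSizesY (w_div_volY_le bondFunCoordsY_symm_liftY)
open B9SectBGClassLettersY (Reg335PlaqY CplxLettersGY VarParBY)
open B9SectBGFrameCodedYR (gFrame₅CodedOn)
open B9SectBL2GFrameCodedY (L2SizeAb)
open B9RWSumsReadsNbr (nbr)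
open Node00 (SiteY BlkY FBondY IBondY CfgY SiteParY BondParY repBondY bondCoordsY bondFunCoordsY GpY XY deltaAY deltaPrimeAY extBondY_apply_repBondY
  extBondY_apply_of_not_mem_range resBondY_apply blkY_repBondY_src liftMatY_diagonal_apply)

variable {d ℓ : ℕ} {hd : 1 ≤ d + 1} {hL : Odd (ℓ + 1) ∧ 1 < ℓ + 1} {b₀ b₁ : ℝ} {Mstar : ℕ}
variable {𝔸 : Type} [NormedRing 𝔸] (P : RegExtraY d ℓ hd hL b₀ b₁ Mstar 𝔸) [NormedAlgebra ℂ 𝔸] [CompleteSpace 𝔸]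
variable {ι : Type} [Fintype ι]

/-! ## §1 Diagonal real letters in block-`ℓ²` -/

section Diag

variable {g : B6.Geometry} [DecidableEq g.Site] {X : Type} [Fintype X]

end Diag

/-! ## §2 The weight letter `abC` is diagonal; its block-`ℓ²` majorant -/

section Weight

variable (i : KIdx d ℓ hd hL b₀ b₁) (b : Module.Basis ι ℝ 𝔸) (ιB : BlkY i → IBondY i) {Rr : ℝ} {Hp : Prop} [Fintype (geo9K i).Site]
  [DecidableEq (geo9K i).Site]

end Weight

/-! ## §3 ★★ The displayed law `L2SizeAb` of the `L²` frame instance, supplied -/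

section Instance

variable [NormOneClass 𝔸] [FiniteDimensional ℝ 𝔸] {J : Type} (f : J → MemberY d ℓ hd hL b₀ b₁ Mstar)
  [∀ x : MemberY d ℓ hd hL b₀ b₁ Mstar, Fintype (geo9Y x).Site]
  [instDS : ∀ x : MemberY d ℓ hd hL b₀ b₁ Mstar, DecidableEq (geo9Y x).Site] [instNE : ∀ x : MemberY d ℓ hd hL b₀ b₁ Mstar, Nonempty (geo9Y x).Site]
  (c35 : ℝ) (G : Subgroup 𝔸ˣ) (par : ∀ j : J, SiteParY 𝔸 (f j).toKIdx) (parB : ∀ j : J, BondParY 𝔸 (f j).toKIdx)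
  [DecidableEq ι] (b : Module.Basis ι ℝ 𝔸) (ιB : ∀ j : J, BlkY (f j).toKIdx → IBondY (f j).toKIdx)
  (C37 C38 : ∀ j : J, ℝ → CfgY 𝔸 (f j).toKIdx → AfldY 𝔸 (f j).toKIdx → Prop)

omit instNE in
/-- ★★ **THE DISPLAYED LAW `L2SizeAb` OF `l2GFrame₇CodedOn` HOLDS WITH `abar2 = b₁`** (the binder `haL2` of `stepL2Pos_KACU_frame_on` supplied).
[cite: Balaban1985BackgroundPropagators, (3.24) p.394, (3.26) p.395; Balaban1984PropagatorsII, (2.20) p.226, Prop. 2.6 (2.140) p.247] -/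
theorem l2SizeAb_gFrame₅CodedOn (hι : ∀ (j : J) (s : BlkY (f j).toKIdx), β (f j).toKIdx.hN (f j).toKIdx.D (f j).toKIdx.hk (ιB j s) = s)
    (hG1 : ∀ u : 𝔸ˣ, u ∈ G → ‖(u : 𝔸)‖ ≤ 1) (hpar : ∀ j (U : CfgY 𝔸 (f j).toKIdx), GVal G (f j).toKIdx U → ∀ z w, par j U z w ∈ G)
    (hunit : ∀ j (U : CfgY 𝔸 (f j).toKIdx), GVal G (f j).toKIdx U → IsUnit (deltaPrimeAY (f j).toKIdx (par j) U))
    (M₂ : ℝ) (hM₂ : 0 ≤ M₂) (hrepr : ∀ (v : 𝔸) (j : ι), |b.repr v j| ≤ M₂ * ‖v‖) (hcR : 0 < M₂ * ∑ j, ‖b j‖)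
    (Cq : ℝ) (hCq : 0 ≤ Cq) (hC37 : ∀ j β' U a, C37 j β' U a → GVal G (f j).toKIdx U ∧ CplxLettersY G (f j) (par j) (ιB j) Cq β' U a)
    (MInv aInv aW : ℝ) (hMInv : 0 < MInv) (haInv : 0 < aInv) (haW : 0 < aW)
    (hunitX : ∀ j (U : CfgY 𝔸 (f j).toKIdx), GVal G (f j).toKIdx U → IsUnit (XY (f j).toKIdx (par j) (GpY (f j).toKIdx (par j)) U))
    (hsym : ∀ j (U : CfgY 𝔸 (f j).toKIdx) (z w : SiteY (f j).toKIdx), par j U z w = (par j U w z)⁻¹)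
    (hunitA : ∀ j (α₀ : ℝ) (U : CfgY 𝔸 (f j).toKIdx), (bg9YC 𝔸 G P (f j)).Reg335 c35 α₀ U → IsUnit (deltaAY (f j).toKIdx (par j) (parB j) (GpY (f j).toKIdx (par j)) U))
    (hparB : ∀ j (U : CfgY 𝔸 (f j).toKIdx), GVal G (f j).toKIdx U → ∀ y f', parB j U y f' ∈ G) (hb₁ : 0 ≤ b₁)
    (C₀ : ℝ) (hC₀ : 0 ≤ C₀)
    (hreg335P : ∀ j (α₀ : ℝ) (U : CfgY 𝔸 (f j).toKIdx), MInv ≤ (geo9Y (f j)).M → 0 < α₀ → (geo9Y (f j)).M * α₀ ≤ aInv →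
      (bg9YC 𝔸 G P (f j)).Reg335 c35 α₀ U → Reg335PlaqY G (f j) (ιB j) C₀ U)
    (hC37G : ∀ j β' U a, C37 j β' U a → CplxLettersGY G (f j) (ιB j) β' U a)
    (cVar : ℝ) (hcVar : 0 ≤ cVar) (hvarB : ∀ j β' U a, C37 j β' U a → VarParBY (f j).toKIdx (parB j) cVar β' U a)
    (hMd : 2 * ((d : ℝ) + 1) < MInv) (mN : ℕ) (hnbr : ∀ (j : J) (y' : IBondY (f j).toKIdx), (nbr (geo9Y (f j)) (2 * ((d : ℝ) + 1)) y').card ≤ mN) :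
    L2SizeAb (gFrame₅CodedOn P f c35 G par parB b ιB C37 C38 hι hG1 hpar hunit M₂ hM₂ hrepr hcR Cq hCq hC37 MInv aInv aW hMInv haInv haW hunitX hsym hunitA hparB hb₁ C₀
      hC₀ hreg335P hC37G cVar hcVar hvarB hMd mN hnbr) b₁ := by
  intro j
  letI : Fintype (geo9K (f j).toKIdx).Site := ‹∀ x : MemberY d ℓ hd hL b₀ b₁ Mstar, Fintype (geo9Y x).Site› (f j)
  letI : DecidableEq (geo9K (f j).toKIdx).Site := instDS (f j)
  exact hasL2Majorant_abC (Rr := 0) (Hp := True) (f j).toKIdx b (ιB j) (hι j) hb₁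

end Instance

end Literature.MathematicalPhysics.QuantumFieldTheory.Balaban1983to89.B9SectBQSizesL2YR

end

/-!
# `Balaban1983to89.B9SectBL2GFrameCodedV8YR` — THE CLASS-PARAMETRIC TWIN of `B9SectBL2GFrameCodedV8Y` (CASCADE-R, director-ym №279 GO-R; №277 (3) `hunitA` cure; dag-n06-d SOCKET-(α) class question)

statement-level skeleton of published theorems with citation tags; proofs where landed; nothing here is a claim about the
Yang–Mills mass gap

WHAT THIS FILE IS.  The original module `B9SectBL2GFrameCodedV8Y` types its objects over MODULE 3's member carrier `bg9Y 𝔸 G x` (MODULE 2's small-cube class (3.35)).  This file RE-DECLARES, with UNCHANGED NAMES inside the namespace `…B9SectBL2GFrameCodedV8YR`, exactly its 2 class-dependent declarations over the CLASS-PARAMETRIC carrier `B9SectBCodedClassR.bg9YC 𝔸 G P x` (`P : RegExtraY …` = the two cube conditions of (3.35)∕(3.36) as a parameter; `bg9Y 𝔸 G x = bg9YC 𝔸 G (extraY 𝔸 G) x` by `rfl`, so every declaration here WITHOUT the `hunitA` binder specialises definitionally to its original; EXCEPTION (v1.1, №288 (4), ref-E READ-13 HEADER-NIT): `l2GFrame₈CodedOn`,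 `stepL2Pos_KACU_frame₈_on` carry the №277 RE-KEYED `hunitA` (WEAKER hypothesis), so at `P := extraY 𝔸 G` they IMPLY the originals via `fun j α₀ U hU => hunitA j U hU.1.1` (ref-E K3), NOT a definitional specialisation; CAVEAT (LOCATED-18, №290 (1)): no α₀-threshold ⇒ still uninhabitable at `SU(N)` — consumers use the GUARDED `…RG` twin; at the record's reading of PRINT's class, `P := extraYPb 𝔸 G`, the displayed laws `hreg335P` ((3.35) on plaquettes) and the class-keyed `hunitA` become theorems).  The text is the original's VERBATIM under the token surgery `bg9Y 𝔸 G ↦ bg9YC 𝔸 G P`, `NAME ↦ NAME P` for the class-dependent names (P the first explicit argument), and — №277 — the binder `hunitA` re-keyed from «all G-valued U» to «all (3.35)-regular U of the carrier» (`∀ j α₀ U, (bg9YC 𝔸 G P (f j)).Reg335 c35 α₀ U → IsUnit (deltaAY …)`) with its use sites (`hunitA j U hU ↦ hunitA j α₀ U hU`) — NOT verbatim for the declarations named above.  Class-free declarations of the original are NOT copied: they are imported and used BY NAME (`open … hiding` the re-declared ones).  Generated by dag-n06-c g16's `gen.py` (HOME `pub-ymgap-dag-n06-c/lean/g16/`);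 the ORIGINAL MODULE DOCUMENTATION FOLLOWS VERBATIM and describes the mathematics.

HONEST SCOPE.  Re-typing bookkeeping; nothing of [B9] asserted beyond the original; COUNT-NEUTRAL; N06 NOT discharged; nothing continuum ∕ OS ∕ mass gap ∕ Clay.  Cell `pub-ymgap` (D-0062), Track A node N06 [B9], seat `pub-ymgap-dag-n06-c` g16, 2026-08-29.
-/

/-! Module documentation: that of the original `Balaban1983to89.B9SectBL2GFrameCodedV8Y` applies verbatim to this twin (not repeated here). -/

noncomputable section

namespace Literature.MathematicalPhysics.QuantumFieldTheory.Balaban1983to89.B9SectBL2GFrameCodedV8YR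

open Literature.MathematicalPhysics.QuantumFieldTheory.Balaban1983to89.B9SectBCodedClassR (RegExtraY bg9YC)
open Literature.MathematicalPhysics.QuantumFieldTheory.Balaban1983to89.B9SectBL2GFrameCodedV8Y hiding l2GFrame₈CodedOn stepL2Pos_KACU_frame₈_on

open B6Ineq2142KLevelV1 (β)
open B6KLevelCensusIndexV1 (KIdx kGeo)
open B6RandomWalk (Ineq261)
open B6RandomWalkL2 (HasL2Majorant hasL2Majorant_mono)
open B9Thm34Ext (toB6)
open B9Ineq347 (ScaleTransfer)
open B9FromB6 (EBlock L2Block)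
open B9PinMembersKLevelV1 (MemberY geo9Y bg9Y)
open B9Eq360DeltaPrimeAY (AfldY)
open B9SectBGpLettersY (GVal)
open B9SectBGpFrameCodedYR (codingYx)
open B9SectBGpFrameCodedY (CplxLettersY)
open B9SectBGpReadingsYR (KSC)
open B9SectBCodedCarrier (pullS)
open B9SectBCodedReadingsUR (KACU)
open B9SectBKerFrameCodedYR (CinvY)
open B9SectBStepWhole (StepL2Pos)
open B9RWSumsReadsNbr (nbr)
open B9RWSums347DefiniteFacesWindow (scaleTransfer6_window_geo9Y)
open B9SectBGClassLettersY (Reg335PlaqY CplxLettersGY VarParBY)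
open B9SectBGFrameCodedYR (gFrame₅CodedOn)
open B9SectBGFrameCodedY (parB_contractive)
open B9SectBL2GFrameV8 (L2GFrame₈ stepL2Pos_of_l2GFrame₈)
open B9SectBL2GFrameCodedY (Read377L2 d261Y M261Y d261Y_spec card_nbr_mono l2Block_mono_const)
open B9SectBL2GCrossYR (readGL2_GbC_all)
open B9SectBL2GCrossY (cLGY cLGY_nonneg plaqLawY_of_reg335PlaqY)
open B9SectBL2GReadCodedYR (writeGL2_GbC)
open B9SectBQLettersL2Y (QbC2 QsbC2 F₂C2 F₂sC2 qC2_prod qbC2_prod qsbC2_prod hasL2Majorant_QbC2 hasL2Majorant_QsbC2 hasL2Majorant_F₂C2 hasL2Majorant_F₂sC2)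
open B9SectBQSizesL2Y (hasL2Majorant_abC)
open B9GeoLemma21KLevelV1 (geo9K_one_le_L geo9Y_len_pos)
open B9GeoNormsKLevelV1 (geo9K)
open Node00 (SiteY BlkY FBondY IBondY CfgY SiteParY BondParY GAY GpY XY deltaAY deltaPrimeAY)

universe u

variable {d ℓ : ℕ} {hd : 1 ≤ d + 1} {hL : Odd (ℓ + 1) ∧ 1 < ℓ + 1} {b₀ b₁ : ℝ} {Mstar : ℕ}
variable {𝔸 : Type} [NormedRing 𝔸] (P : RegExtraY d ℓ hd hL b₀ b₁ Mstar 𝔸) [NormedAlgebra ℂ 𝔸] [CompleteSpace 𝔸]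

/-! ## §1 ★★★ The `L²` frame V8 inhabited over the coded carriers of a subfamily, letter laws proved -/

section Instance

variable [NormOneClass 𝔸] [FiniteDimensional ℝ 𝔸] {J : Type} (f : J → MemberY d ℓ hd hL b₀ b₁ Mstar)
  [∀ x : MemberY d ℓ hd hL b₀ b₁ Mstar, Fintype (geo9Y x).Site]
  [instDS : ∀ x : MemberY d ℓ hd hL b₀ b₁ Mstar, DecidableEq (geo9Y x).Site] [instNE : ∀ x : MemberY d ℓ hd hL b₀ b₁ Mstar, Nonempty (geo9Y x).Site]
  (c35 : ℝ) (G : Subgroup 𝔸ˣ) (par : ∀ j : J, SiteParY 𝔸 (f j).toKIdx) (parB : ∀ j : J, BondParY 𝔸 (f j).toKIdx)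
  {ι : Type} [Fintype ι] [DecidableEq ι] (b : Module.Basis ι ℝ 𝔸) (ιB : ∀ j : J, BlkY (f j).toKIdx → IBondY (f j).toKIdx)
  (C37 C38 : ∀ j : J, ℝ → CfgY 𝔸 (f j).toKIdx → AfldY 𝔸 (f j).toKIdx → Prop)

set_option maxHeartbeats 1600000 in
/-- ★★★ **THE `L²` FRAME `L2GFrame₈` OVER THE CODED CARRIERS OF A SUBFAMILY, INHABITED FOR `KACU`, ℓ² LETTER LAWS PROVED**: gen 13's `gFrame₅CodedOn`
extended by the `L²` reading constant `cLGY (2C₀) …`, output rate `δ/2`, threshold `max (M261 δ) (48 log L / δ)`, the writing function, the `L²` reading and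
writing PROVED (as in `l2GFrame₇CodedOn`), the volume-symmetrized ℓ² letters `QbC2 QsbC2 F₂C2 F₂sC2` with `q2_prod`, `qb2_mul`, (3.15)∕(3.81)∕(3.24) in
block-ℓ² PROVED (`κQb2 = c_L·√(2L^{d+1})·e^{ℓ+3}`, `cFb2 = c_L·c_var·√(2L^{d+1})·e^{ℓ+3}`, `abar2 = b₁`), and ONE displayed printed law `Read377L2`.
[cite: Balaban1985BackgroundPropagators, Thm 3.4 p.400, Thm 3.3 p.399, (3.46) p.398, (3.12)–(3.13) p.392, (3.14)–(3.15) p.393, (3.24)–(3.26) pp.394–395, (3.77) p.406, (3.80)–(3.81) p.406, (3.82)–(3.86) p.407; Balaban1984PropagatorsII, (2.19)–(2.20) p.226, Lemma 2.1 p.234, Prop. 2.6 (2.140)–(2.141) p.247] -/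
noncomputable def l2GFrame₈CodedOn (hι : ∀ (j : J) (s : BlkY (f j).toKIdx), β (f j).toKIdx.hN (f j).toKIdx.D (f j).toKIdx.hk (ιB j s) = s)
    (hG1 : ∀ u : 𝔸ˣ, u ∈ G → ‖(u : 𝔸)‖ ≤ 1) (hpar : ∀ j (U : CfgY 𝔸 (f j).toKIdx), GVal G (f j).toKIdx U → ∀ z w, par j U z w ∈ G)
    (hunit : ∀ j (U : CfgY 𝔸 (f j).toKIdx), GVal G (f j).toKIdx U → IsUnit (deltaPrimeAY (f j).toKIdx (par j) U))
    (M₂ : ℝ) (hM₂ : 0 ≤ M₂) (hrepr : ∀ (v : 𝔸) (j : ι), |b.repr v j| ≤ M₂ * ‖v‖) (hcR : 0 < M₂ * ∑ j, ‖b j‖)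
    (Cq : ℝ) (hCq : 0 ≤ Cq) (hC37 : ∀ j β' U a, C37 j β' U a → GVal G (f j).toKIdx U ∧ CplxLettersY G (f j) (par j) (ιB j) Cq β' U a)
    (MInv aInv aW : ℝ) (hMInv : 0 < MInv) (haInv : 0 < aInv) (haW : 0 < aW)
    (hunitX : ∀ j (U : CfgY 𝔸 (f j).toKIdx), GVal G (f j).toKIdx U → IsUnit (XY (f j).toKIdx (par j) (GpY (f j).toKIdx (par j)) U))
    (hsym : ∀ j (U : CfgY 𝔸 (f j).toKIdx) (z w : SiteY (f j).toKIdx), par j U z w = (par j U w z)⁻¹)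
    (hunitA : ∀ j (α₀ : ℝ) (U : CfgY 𝔸 (f j).toKIdx), (bg9YC 𝔸 G P (f j)).Reg335 c35 α₀ U → IsUnit (deltaAY (f j).toKIdx (par j) (parB j) (GpY (f j).toKIdx (par j)) U))
    (hparB : ∀ j (U : CfgY 𝔸 (f j).toKIdx), GVal G (f j).toKIdx U → ∀ y f', parB j U y f' ∈ G) (hb₁ : 0 ≤ b₁)
    (C₀ : ℝ) (hC₀ : 0 ≤ C₀)
    (hreg335P : ∀ j (α₀ : ℝ) (U : CfgY 𝔸 (f j).toKIdx), MInv ≤ (geo9Y (f j)).M → 0 < α₀ → (geo9Y (f j)).M * α₀ ≤ aInv →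
      (bg9YC 𝔸 G P (f j)).Reg335 c35 α₀ U → Reg335PlaqY G (f j) (ιB j) C₀ U)
    (hC37G : ∀ j β' U a, C37 j β' U a → CplxLettersGY G (f j) (ιB j) β' U a)
    (cVar : ℝ) (hcVar : 0 ≤ cVar) (hvarB : ∀ j β' U a, C37 j β' U a → VarParBY (f j).toKIdx (parB j) cVar β' U a)
    (hMd : 2 * ((d : ℝ) + 1) < MInv) (mN : ℕ) (hnbr : ∀ (j : J) (y' : IBondY (f j).toKIdx), (nbr (geo9Y (f j)) (2 * ((d : ℝ) + 1)) y').card ≤ mN)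
    (h377 : Read377L2 (gFrame₅CodedOn P f c35 G par parB b ιB C37 C38 hι hG1 hpar hunit M₂ hM₂ hrepr hcR Cq hCq hC37 MInv aInv aW hMInv haInv haW hunitX hsym hunitA hparB hb₁ C₀
        hC₀ hreg335P hC37G cVar hcVar hvarB hMd mN hnbr)) :
    L2GFrame₈ c35 (fun j => geo9Y (f j)) (fun j => (codingYx P G (f j) (C37 j) (C38 j)).bg) (fun j => KSC P G (f j) (par j) (C37 j) (C38 j)) b (Fin (d + 1))
      (fun j => SiteY (f j).toKIdx) (fun j => BlkY (f j).toKIdx × ι)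
      (fun j => KACU P G (f j) (GAY (f j).toKIdx (par j) (parB j) (GpY (f j).toKIdx (par j))) (parB j) (C37 j) (C38 j))
      (fun j => pullS (codingYx P G (f j) (C37 j) (C38 j)) (CinvY P f G par j)) :=
  { gFrame₅CodedOn P f c35 G par parB b ιB C37 C38 hι hG1 hpar hunit M₂ hM₂ hrepr hcR Cq hCq hC37 MInv aInv aW hMInv haInv haW hunitX hsym hunitA hparB hb₁ C₀
        hC₀ hreg335P hC37G cVar hcVar hvarB hMd mN hnbr with
    cLG := fun δ => cLGY (2 * C₀) M₂ (∑ j, ‖b j‖) (Real.sqrt (Fintype.card ι)) d (d261Y (d := d) (ℓ := ℓ) (hd := hd) (hL := hL) (b₀ := b₀) (b₁ := b₁) (Mstar := Mstar) δ) δ (((ℓ : ℝ) + 1) ^ 4)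
    κQb2 := (Real.sqrt (Fintype.card ι) * M₂ * ∑ j, ‖b j‖) * (1 * Real.sqrt (2 * (((ℓ + 1 : ℕ) : ℝ)) ^ (d + 1))) * Real.exp (1 * ((ℓ : ℝ) + 3))
    cFb2 := (Real.sqrt (Fintype.card ι) * M₂ * ∑ j, ‖b j‖) * (cVar * Real.sqrt (2 * (((ℓ + 1 : ℕ) : ℝ)) ^ (d + 1))) * Real.exp (1 * ((ℓ : ℝ) + 3))
    abar2 := b₁
    wLG := fun B δ => (mN : ℝ) * (Real.sqrt (Fintype.card ι) * M₂ * ∑ j, ‖b j‖) * (((ℓ + 1 : ℕ) : ℝ)) ^ 2 * Real.exp δ * B + 1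
    wLGδ := fun δ => δ
    rLG := fun δ => δ / 2
    ML2 := fun δ => max (M261Y (d := d) (ℓ := ℓ) (hd := hd) (hL := hL) (b₀ := b₀) (b₁ := b₁) (Mstar := Mstar) δ) (4 * Real.log ((ℓ : ℝ) + 1) / (δ / 12))
    cLG_pos := fun δ hδ => by
      -- `cLGY = g_X²·g_I·(s_ι M₂ S_b)`, `g ≥ 1`, `s_ι M₂ S_b > 0`
      have hSb : 0 < ∑ j, ‖b j‖ := by
        rcases (mul_pos_iff.1 hcR) with ⟨-, h⟩ | ⟨h1, -⟩
        · exact h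
        · exact absurd h1 (not_lt.2 hM₂)
      have hne : Nonempty ι := by
        by_contra hι'
        rw [not_nonempty_iff] at hι'
        have : ∑ j, ‖b j‖ = 0 := Finset.sum_eq_zero fun j _ => (IsEmpty.false j).elim
        linarith
      have hcard : (0 : ℝ) < Fintype.card ι := by exact_mod_cast Fintype.card_pos
      have hM₂' : 0 < M₂ := by
        rcases (mul_pos_iff.1 hcR) with ⟨h, -⟩ | ⟨-, h2⟩
        · exact h
        · exact absurd h2 (not_lt.2 hSb.le)
      have hc1 := B6RandomWalk.c1_nonneg (d261Y (d := d) (ℓ := ℓ) (hd := hd) (hL := hL) (b₀ := b₀) (b₁ := b₁) (Mstar := Mstar) δ) δ (1 / 12)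
      unfold cLGY
      have hs : 0 < Real.sqrt (Fintype.card ι) * M₂ * ∑ j, ‖b j‖ := by positivity
      have h1 : (1 : ℝ) ≤ (1 + ((1 : ℝ) ^ 2 * M₂ * (∑ j, ‖b j‖) * Real.sqrt (Fintype.card ι) * Real.exp (δ * (2 * ((d : ℝ) + 1)))) *
          (((ℓ : ℝ) + 1) ^ 4) * B6.c1 (d261Y (d := d) (ℓ := ℓ) (hd := hd) (hL := hL) (b₀ := b₀) (b₁ := b₁) (Mstar := Mstar) δ) δ (1 / 12)) ^ 2 :=
        one_le_pow₀ (le_add_of_nonneg_right (by positivity))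
      have h2 : (1 : ℝ) ≤ 1 + B6.c1 (d261Y (d := d) (ℓ := ℓ) (hd := hd) (hL := hL) (b₀ := b₀) (b₁ := b₁) (Mstar := Mstar) δ) δ (1 / 12) * M₂ * (∑ j, ‖b j‖) * Real.sqrt (Fintype.card ι) *
          ((1 : ℝ) ^ 2 * Real.exp (δ * (2 * ((d : ℝ) + 1))) * ((ℓ : ℝ) + 1) ^ 4 +
            (1 : ℝ) ^ 4 * (2 * C₀) * (((ℓ : ℝ) + 1) ^ 4 * Real.exp (1 / 12 * δ * (2 * ((d : ℝ) + 1)))) *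
              Real.exp (δ * (2 * (2 * ((d : ℝ) + 1)))) * ((ℓ : ℝ) + 1) ^ 4) :=
        le_add_of_nonneg_right (by positivity)
      have := mul_le_mul h1 h2 zero_le_one (zero_le_one.trans h1)
      nlinarith
    rLG_pos := fun δ hδ => by positivity
    rLG_le := fun δ hδ => by linarith
    κQb2_nonneg := by positivity
    cFb2_nonneg := by positivity
    abar2_nonneg := hb₁
    wLG_pos := fun B δ hB _ => by positivity
    wLGδ_pos := fun δ hδ => hδ
    Qb2 := fun j c => QbC2 (f j).toKIdx (parB j) b c
    Qsb2 := fun j c => QsbC2 (f j).toKIdx (parB j) b c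
    F₂2 := fun j c c' => F₂C2 (f j).toKIdx (parB j) b c c'
    F₂s2 := fun j c c' => F₂sC2 (f j).toKIdx (parB j) b c c'
    q2_prod := fun j c => qC2_prod (f j).toKIdx (parB j) b c
    qb2_mul := fun j α₁ c c' hα₁ h37 => by
      obtain ⟨U, a, rfl, rfl, -⟩ := (codingYx P G (f j) (C37 j) (C38 j)).exists_of_bg_Cplx337 h37
      exact ⟨qbC2_prod (f j).toKIdx (parB j) b U a, qsbC2_prod (f j).toKIdx (parB j) b U a⟩
    hQb2 := fun j α₀ c δ hM hα₀ hMa hreg hδ hδc => by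
      letI : Fintype (geo9K (f j).toKIdx).Site := ‹∀ x : MemberY d ℓ hd hL b₀ b₁ Mstar, Fintype (geo9Y x).Site› (f j)
      letI : DecidableEq (geo9K (f j).toKIdx).Site := instDS (f j)
      obtain ⟨U, rfl, hU⟩ := (codingYx P G (f j) (C37 j) (C38 j)).exists_of_bg_Reg335 hreg
      have h := hasL2Majorant_QbC2 (Rr := 0) (Hp := True) (f j).toKIdx (parB j) b (ιB j) (hι j) hM₂ hrepr
        (parB_contractive G (f j) (parB j) hG1 (hparB j U hU.1.1)) hδ.le
      refine hasL2Majorant_mono _ h fun a a' => ?_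
      have hδ1' : δ ≤ 1 := hδc
      have hℓ : (0 : ℝ) ≤ (ℓ : ℝ) + 3 := by positivity
      have he : Real.exp (δ * ((ℓ : ℝ) + 3)) ≤ Real.exp (1 * ((ℓ : ℝ) + 3)) := Real.exp_le_exp.2 (by nlinarith)
      calc (Real.sqrt (Fintype.card ι) * M₂ * ∑ j, ‖b j‖) * (1 * Real.sqrt (2 * (((ℓ + 1 : ℕ) : ℝ)) ^ (d + 1)) *
            (Real.exp (δ * ((ℓ : ℝ) + 3)) * Real.exp (-(δ * (geo9K (f j).toKIdx).dist a a'))))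
          = (Real.sqrt (Fintype.card ι) * M₂ * ∑ j, ‖b j‖) * (1 * Real.sqrt (2 * (((ℓ + 1 : ℕ) : ℝ)) ^ (d + 1))) *
              Real.exp (δ * ((ℓ : ℝ) + 3)) * Real.exp (-(δ * (geo9K (f j).toKIdx).dist a a')) := by ring
        _ ≤ (Real.sqrt (Fintype.card ι) * M₂ * ∑ j, ‖b j‖) * (1 * Real.sqrt (2 * (((ℓ + 1 : ℕ) : ℝ)) ^ (d + 1))) *
              Real.exp (1 * ((ℓ : ℝ) + 3)) * Real.exp (-(δ * (geo9K (f j).toKIdx).dist a a')) := by gcongr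
    hQsb2 := fun j α₀ c δ hM hα₀ hMa hreg hδ hδc => by
      letI : Fintype (geo9K (f j).toKIdx).Site := ‹∀ x : MemberY d ℓ hd hL b₀ b₁ Mstar, Fintype (geo9Y x).Site› (f j)
      letI : DecidableEq (geo9K (f j).toKIdx).Site := instDS (f j)
      obtain ⟨U, rfl, hU⟩ := (codingYx P G (f j) (C37 j) (C38 j)).exists_of_bg_Reg335 hreg
      have h := hasL2Majorant_QsbC2 (Rr := 0) (Hp := True) (f j).toKIdx (parB j) b (ιB j) (hι j) hM₂ hrepr
        (parB_contractive G (f j) (parB j) hG1 (hparB j U hU.1.1)) hδ.le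
      refine hasL2Majorant_mono _ h fun a a' => ?_
      have hδ1' : δ ≤ 1 := hδc
      have hℓ : (0 : ℝ) ≤ (ℓ : ℝ) + 3 := by positivity
      have he : Real.exp (δ * ((ℓ : ℝ) + 3)) ≤ Real.exp (1 * ((ℓ : ℝ) + 3)) := Real.exp_le_exp.2 (by nlinarith)
      calc (Real.sqrt (Fintype.card ι) * M₂ * ∑ j, ‖b j‖) * (1 * Real.sqrt (2 * (((ℓ + 1 : ℕ) : ℝ)) ^ (d + 1)) *
            (Real.exp (δ * ((ℓ : ℝ) + 3)) * Real.exp (-(δ * (geo9K (f j).toKIdx).dist a a'))))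
          = (Real.sqrt (Fintype.card ι) * M₂ * ∑ j, ‖b j‖) * (1 * Real.sqrt (2 * (((ℓ + 1 : ℕ) : ℝ)) ^ (d + 1))) *
              Real.exp (δ * ((ℓ : ℝ) + 3)) * Real.exp (-(δ * (geo9K (f j).toKIdx).dist a a')) := by ring
        _ ≤ (Real.sqrt (Fintype.card ι) * M₂ * ∑ j, ‖b j‖) * (1 * Real.sqrt (2 * (((ℓ + 1 : ℕ) : ℝ)) ^ (d + 1))) *
              Real.exp (1 * ((ℓ : ℝ) + 3)) * Real.exp (-(δ * (geo9K (f j).toKIdx).dist a a')) := by gcongr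
    hF₂2 := fun j α₁ c c' hα₁ h37 δ hδ hδc => by
      letI : Fintype (geo9K (f j).toKIdx).Site := ‹∀ x : MemberY d ℓ hd hL b₀ b₁ Mstar, Fintype (geo9Y x).Site› (f j)
      letI : DecidableEq (geo9K (f j).toKIdx).Site := instDS (f j)
      obtain ⟨U, a, rfl, rfl, hC⟩ := (codingYx P G (f j) (C37 j) (C38 j)).exists_of_bg_Cplx337 h37
      have hcv : 0 ≤ cVar * α₁ := mul_nonneg hcVar hα₁.le
      have hv := hvarB j α₁ U a hC
      have hδ1' : δ ≤ 1 := hδc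
      have hℓ : (0 : ℝ) ≤ (ℓ : ℝ) + 3 := by positivity
      have he : Real.exp (δ * ((ℓ : ℝ) + 3)) ≤ Real.exp (1 * ((ℓ : ℝ) + 3)) := Real.exp_le_exp.2 (by nlinarith)
      constructor
      · refine hasL2Majorant_mono _ (hasL2Majorant_F₂C2 (Rr := 0) (Hp := True) (f j).toKIdx (parB j) b (ιB j) (hι j) hM₂ hrepr hcv hv hδ.le)
          fun a' a'' => ?_
        calc (Real.sqrt (Fintype.card ι) * M₂ * ∑ j, ‖b j‖) * (cVar * α₁ * Real.sqrt (2 * (((ℓ + 1 : ℕ) : ℝ)) ^ (d + 1)) *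
              (Real.exp (δ * ((ℓ : ℝ) + 3)) * Real.exp (-(δ * (geo9K (f j).toKIdx).dist a' a''))))
            = (Real.sqrt (Fintype.card ι) * M₂ * ∑ j, ‖b j‖) * (cVar * Real.sqrt (2 * (((ℓ + 1 : ℕ) : ℝ)) ^ (d + 1))) *
                Real.exp (δ * ((ℓ : ℝ) + 3)) * α₁ * Real.exp (-(δ * (geo9K (f j).toKIdx).dist a' a'')) := by ring
          _ ≤ (Real.sqrt (Fintype.card ι) * M₂ * ∑ j, ‖b j‖) * (cVar * Real.sqrt (2 * (((ℓ + 1 : ℕ) : ℝ)) ^ (d + 1))) *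
                Real.exp (1 * ((ℓ : ℝ) + 3)) * α₁ * Real.exp (-(δ * (geo9K (f j).toKIdx).dist a' a'')) := by gcongr
      · refine hasL2Majorant_mono _ (hasL2Majorant_F₂sC2 (Rr := 0) (Hp := True) (f j).toKIdx (parB j) b (ιB j) (hι j) hM₂ hrepr hcv hv hδ.le)
          fun a' a'' => ?_
        calc (Real.sqrt (Fintype.card ι) * M₂ * ∑ j, ‖b j‖) * (cVar * α₁ * Real.sqrt (2 * (((ℓ + 1 : ℕ) : ℝ)) ^ (d + 1)) *
              (Real.exp (δ * ((ℓ : ℝ) + 3)) * Real.exp (-(δ * (geo9K (f j).toKIdx).dist a' a''))))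
            = (Real.sqrt (Fintype.card ι) * M₂ * ∑ j, ‖b j‖) * (cVar * Real.sqrt (2 * (((ℓ + 1 : ℕ) : ℝ)) ^ (d + 1))) *
                Real.exp (δ * ((ℓ : ℝ) + 3)) * α₁ * Real.exp (-(δ * (geo9K (f j).toKIdx).dist a' a'')) := by ring
          _ ≤ (Real.sqrt (Fintype.card ι) * M₂ * ∑ j, ‖b j‖) * (cVar * Real.sqrt (2 * (((ℓ + 1 : ℕ) : ℝ)) ^ (d + 1))) *
                Real.exp (1 * ((ℓ : ℝ) + 3)) * α₁ * Real.exp (-(δ * (geo9K (f j).toKIdx).dist a' a'')) := by gcongr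
    ha2 := fun j => by
      letI : Fintype (geo9K (f j).toKIdx).Site := ‹∀ x : MemberY d ℓ hd hL b₀ b₁ Mstar, Fintype (geo9Y x).Site› (f j)
      letI : DecidableEq (geo9K (f j).toKIdx).Site := instDS (f j)
      exact hasL2Majorant_abC (Rr := 0) (Hp := True) (f j).toKIdx b (ιB j) (hι j) hb₁
    readGL2 := fun j α₀ c B₀ δ hM hML hα₀ hMa hreg hB₀ hδ hL2 => by
      letI : Fintype (B9GeoNormsKLevelV1.geo9K (f j).toKIdx).Site := ‹∀ x : MemberY d ℓ hd hL b₀ b₁ Mstar, Fintype (geo9Y x).Site› (f j)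
      obtain ⟨U, rfl, hU⟩ := (codingYx P G (f j) (C37 j) (C38 j)).exists_of_bg_Reg335 hreg
      have hM261 : M261Y (d := d) (ℓ := ℓ) (hd := hd) (hL := hL) (b₀ := b₀) (b₁ := b₁) (Mstar := Mstar) δ ≤ (geo9Y (f j)).M := le_trans (le_max_left _ _) hML
      have hMST : 4 * Real.log ((ℓ : ℝ) + 1) / (δ / 12) ≤ (geo9Y (f j)).M := le_trans (le_max_right _ _) hML
      have h261 := d261Y_spec (f j) hδ (by norm_num : (9 : ℝ) / 5000 ≤ 1 / 12) (by norm_num) hM261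
      have hκlo : 0 < δ / 12 := by positivity
      obtain ⟨hT1, -, -, hT2i, -, -⟩ := scaleTransfer6_window_geo9Y hκlo (f j) (δ := δ) (α := 1 / 12) (by linarith) hMST
      have hTi2 : ScaleTransfer (geo9Y (f j)) δ (1 / 12) (((ℓ : ℝ) + 1) ^ 4) (fun a => ((geo9Y (f j)).len a)⁻¹ ^ 2) := by
        have e : (fun a => ((geo9Y (f j)).len a)⁻¹ ^ 2) = (fun a => ((geo9Y (f j)).len a ^ 2)⁻¹) := funext fun a => by rw [inv_pow]
        rw [e]; exact hT2i
      have hΛ : (1 : ℝ) ≤ ((ℓ : ℝ) + 1) ^ 4 := one_le_pow₀ (by have : (0 : ℝ) ≤ ℓ := Nat.cast_nonneg ℓ; linarith)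
      have hplaq := plaqLawY_of_reg335PlaqY G (f j) (ιB j) hG1 hU.1.1 hC₀ (hreg335P j α₀ U hM hα₀ hMa hU)
      exact readGL2_GbC_all P G (f j) (par j) (parB j) b (ιB j) (C37 j) (C38 j) (hι j) hG1 hM₂ hrepr hδ h261 hΛ hT1 hTi2 (by positivity) hU.1.1 hplaq
        hB₀.le hL2
    writeGL2 := fun j α₀ c c' α₁ B δ hM hα₀ hMa hreg hα₁ haW' h37 hB hδ h0 h1 h2 h3 h4 h5 => by
      letI : Fintype (B9GeoNormsKLevelV1.geo9K (f j).toKIdx).Site := ‹∀ x : MemberY d ℓ hd hL b₀ b₁ Mstar, Fintype (geo9Y x).Site› (f j)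
      obtain ⟨U, a, rfl, rfl, hC⟩ := (codingYx P G (f j) (C37 j) (C38 j)).exists_of_bg_Cplx337 h37
      have hUG := (hC37 j α₁ U a hC).1
      have hnbr1 : ∀ y : IBondY (f j).toKIdx, (nbr (geo9Y (f j)) 1 y).card ≤ mN := fun y =>
        (card_nbr_mono (f j) (by have : (0 : ℝ) ≤ d := Nat.cast_nonneg d; linarith) y).trans (hnbr j y)
      have hw := writeGL2_GbC P (Rr := 0) (Hp := True) G (f j) (par j) (parB j) b (ιB j) (C37 j) (C38 j) (hι j) hM₂ hrepr hnbr1 U hUG a hB hδ.le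
        h0 (fun ν => h1 (Sum.inl ν)) (fun ν => h2 (Sum.inr ν)) (fun ν μ => h4 (Sum.inl ν) (Sum.inr μ)) (fun ν μ => h3 (Sum.inl ν) (Sum.inl μ))
        (fun ν μ => h5 (Sum.inr ν) (Sum.inr μ))
      exact l2Block_mono_const (f j) _ hw (by linarith)
    read377 := fun B₀ δ₀ B₁ δ₁ hB₀ hδ₀ hB₁ hδ₁ => h377 B₀ δ₀ B₁ δ₁ hB₀ hδ₀ hB₁ hδ₁ }

/-! ## §2 ★★ The (3.46) member of the Sect.-B step of record, G side, through the V8 frame -/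

/-- ★★ **`StepL2Pos` OF THE CODED BOND FAMILY `KACU` THROUGH THE `L²` FRAME V8 — THE (3.46) MEMBER OF THE SECT.-B STEP OF RECORD, G SIDE** (gen 14's
`stepL2Pos_of_l2GFrame₈` on `l2GFrame₈CodedOn`), GIVEN the Lemma-2.1 datum `(d261, h261)` of the frame; displayed: gen 13's laws and (3.77) in block-ℓ²
(`Read377L2`) — the ℓ² letter laws (3.15), (3.24), (3.81) are PROVED. [cite: Balaban1985BackgroundPropagators, Thm 3.4 p.400, Thm 3.3 p.399, Thm 3.1 (3.46) p.398, (3.82)–(3.86) p.407; Balaban1984PropagatorsII, Lemma 2.1 p.234, Prop. 2.6 (2.140)–(2.141) p.247] -/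
theorem stepL2Pos_KACU_frame₈_on (hι : ∀ (j : J) (s : BlkY (f j).toKIdx), β (f j).toKIdx.hN (f j).toKIdx.D (f j).toKIdx.hk (ιB j s) = s)
    (hG1 : ∀ u : 𝔸ˣ, u ∈ G → ‖(u : 𝔸)‖ ≤ 1) (hpar : ∀ j (U : CfgY 𝔸 (f j).toKIdx), GVal G (f j).toKIdx U → ∀ z w, par j U z w ∈ G)
    (hunit : ∀ j (U : CfgY 𝔸 (f j).toKIdx), GVal G (f j).toKIdx U → IsUnit (deltaPrimeAY (f j).toKIdx (par j) U))
    (M₂ : ℝ) (hM₂ : 0 ≤ M₂) (hrepr : ∀ (v : 𝔸) (j : ι), |b.repr v j| ≤ M₂ * ‖v‖) (hcR : 0 < M₂ * ∑ j, ‖b j‖)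
    (Cq : ℝ) (hCq : 0 ≤ Cq) (hC37 : ∀ j β' U a, C37 j β' U a → GVal G (f j).toKIdx U ∧ CplxLettersY G (f j) (par j) (ιB j) Cq β' U a)
    (MInv aInv aW : ℝ) (hMInv : 0 < MInv) (haInv : 0 < aInv) (haW : 0 < aW)
    (hunitX : ∀ j (U : CfgY 𝔸 (f j).toKIdx), GVal G (f j).toKIdx U → IsUnit (XY (f j).toKIdx (par j) (GpY (f j).toKIdx (par j)) U))
    (hsym : ∀ j (U : CfgY 𝔸 (f j).toKIdx) (z w : SiteY (f j).toKIdx), par j U z w = (par j U w z)⁻¹)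
    (hunitA : ∀ j (α₀ : ℝ) (U : CfgY 𝔸 (f j).toKIdx), (bg9YC 𝔸 G P (f j)).Reg335 c35 α₀ U → IsUnit (deltaAY (f j).toKIdx (par j) (parB j) (GpY (f j).toKIdx (par j)) U))
    (hparB : ∀ j (U : CfgY 𝔸 (f j).toKIdx), GVal G (f j).toKIdx U → ∀ y f', parB j U y f' ∈ G) (hb₁ : 0 ≤ b₁)
    (C₀ : ℝ) (hC₀ : 0 ≤ C₀)
    (hreg335P : ∀ j (α₀ : ℝ) (U : CfgY 𝔸 (f j).toKIdx), MInv ≤ (geo9Y (f j)).M → 0 < α₀ → (geo9Y (f j)).M * α₀ ≤ aInv →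
      (bg9YC 𝔸 G P (f j)).Reg335 c35 α₀ U → Reg335PlaqY G (f j) (ιB j) C₀ U)
    (hC37G : ∀ j β' U a, C37 j β' U a → CplxLettersGY G (f j) (ιB j) β' U a)
    (cVar : ℝ) (hcVar : 0 ≤ cVar) (hvarB : ∀ j β' U a, C37 j β' U a → VarParBY (f j).toKIdx (parB j) cVar β' U a)
    (hMd : 2 * ((d : ℝ) + 1) < MInv) (mN : ℕ) (hnbr : ∀ (j : J) (y' : IBondY (f j).toKIdx), (nbr (geo9Y (f j)) (2 * ((d : ℝ) + 1)) y').card ≤ mN)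
    (h377 : Read377L2 (gFrame₅CodedOn P f c35 G par parB b ιB C37 C38 hι hG1 hpar hunit M₂ hM₂ hrepr hcR Cq hCq hC37 MInv aInv aW hMInv haInv haW hunitX hsym hunitA hparB hb₁ C₀
        hC₀ hreg335P hC37G cVar hcVar hvarB hMd mN hnbr)) (d261 : ℝ → ℕ)
    (h261 : ∀ (j : J) (δ α : ℝ), 0 < δ → δ ≤ 1 → 9 / 5000 ≤ α → α < 1 →
      (gFrame₅CodedOn P f c35 G par parB b ιB C37 C38 hι hG1 hpar hunit M₂ hM₂ hrepr hcR Cq hCq hC37 MInv aInv aW hMInv haInv haW hunitX hsym hunitA hparB hb₁ C₀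
        hC₀ hreg335P hC37G cVar hcVar hvarB hMd mN hnbr).M261 δ ≤ (geo9Y (f j)).M →
      Ineq261 (d261 δ) (toB6 (geo9Y (f j)) 0 True) δ α) :
    StepL2Pos (d + 1) c35 (fun j => geo9Y (f j)) (fun j => (codingYx P G (f j) (C37 j) (C38 j)).bg) (fun j => KSC P G (f j) (par j) (C37 j) (C38 j))
      (fun j => KACU P G (f j) (GAY (f j).toKIdx (par j) (parB j) (GpY (f j).toKIdx (par j))) (parB j) (C37 j) (C38 j))
      (fun j => pullS (codingYx P G (f j) (C37 j) (C38 j)) (CinvY P f G par j))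
      (fun j => KACU P G (f j) (GAY (f j).toKIdx (par j) (parB j) (GpY (f j).toKIdx (par j))) (parB j) (C37 j) (C38 j)) :=
  stepL2Pos_of_l2GFrame₈ (F := l2GFrame₈CodedOn P f c35 G par parB b ιB C37 C38 hι hG1 hpar hunit M₂ hM₂ hrepr hcR Cq hCq hC37 MInv aInv aW hMInv haInv haW hunitX hsym hunitA hparB hb₁ C₀
        hC₀ hreg335P hC37G cVar hcVar hvarB hMd mN hnbr h377) d261 h261

end Instance

end Literature.MathematicalPhysics.QuantumFieldTheory.Balaban1983to89.B9SectBL2GFrameCodedV8YR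

end

/-!
# `Balaban1983to89.B9SectBL2GRead377YR` — THE CLASS-PARAMETRIC TWIN of `B9SectBL2GRead377Y` (CASCADE-R, director-ym №279 GO-R; №277 (3) `hunitA` cure; dag-n06-d SOCKET-(α) class question)

statement-level skeleton of published theorems with citation tags; proofs where landed; nothing here is a claim about the
Yang–Mills mass gap

WHAT THIS FILE IS.  The original module `B9SectBL2GRead377Y` types its objects over MODULE 3's member carrier `bg9Y 𝔸 G x` (MODULE 2's small-cube class (3.35)).  This file RE-DECLARES, with UNCHANGED NAMES inside the namespace `…B9SectBL2GRead377YR`, exactly its 2 class-dependent declarations over the CLASS-PARAMETRIC carrier `B9SectBCodedClassR.bg9YC 𝔸 G P x` (`P : RegExtraY …` = the two cube conditions of (3.35)∕(3.36) as a parameter; `bg9Y 𝔸 G x = bg9YC 𝔸 G (extraY 𝔸 G) x` by `rfl`, so every declaration here WITHOUT the `hunitA` binder specialises definitionally to its original; EXCEPTION (v1.1, №288 (4), ref-E READ-13 HEADER-NIT): `read377L2_gFrame₅CodedOn` carries the №277 RE-KEYED `hunitA` (WEAKER hypothesis), so at `P := extraY 𝔸 G` it IMPLIES the original via `fun j α₀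 U hU => hunitA j U hU.1.1` (ref-E K3), NOT a definitional specialisation; CAVEAT (LOCATED-18, №290 (1)): no α₀-threshold ⇒ still uninhabitable at `SU(N)` — consumers use the GUARDED `…RG` twin; at the record's reading of PRINT's class, `P := extraYPb 𝔸 G`, the displayed laws `hreg335P` ((3.35) on plaquettes) and the class-keyed `hunitA` become theorems).  The text is the original's VERBATIM under the token surgery `bg9Y 𝔸 G ↦ bg9YC 𝔸 G P`, `NAME ↦ NAME P` for the class-dependent names (P the first explicit argument), and — №277 — the binder `hunitA` re-keyed from «all G-valued U» to «all (3.35)-regular U of the carrier» (`∀ j α₀ U, (bg9YC 𝔸 G P (f j)).Reg335 c35 α₀ U → IsUnit (deltaAY …)`) with its use sites (`hunitA j U hU ↦ hunitA j α₀ U hU`) — NOT verbatim for the declaration named above.  Class-free declarations of the original are NOT copied: they are imported and used BY NAME (`open … hiding` the re-declared ones).  Generated by dag-n06-c g16's `gen.py` (HOME `pub-ymgap-dag-n06-c/lean/g16/`); the ORIGINAL MODULE DOCUMENTATION FOLLOWS VERBATIM and describes the mathematics.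

HONEST SCOPE.  Re-typing bookkeeping; nothing of [B9] asserted beyond the original; COUNT-NEUTRAL; N06 NOT discharged; nothing continuum ∕ OS ∕ mass gap ∕ Clay.  Cell `pub-ymgap` (D-0062), Track A node N06 [B9], seat `pub-ymgap-dag-n06-c` g16, 2026-08-29.
-/

/-! Module documentation: that of the original `Balaban1983to89.B9SectBL2GRead377Y` applies verbatim to this twin (not repeated here). -/

noncomputable section

open scoped BigOperators

namespace Literature.MathematicalPhysics.QuantumFieldTheory.Balaban1983to89.B9SectBL2GRead377YR

open Literature.MathematicalPhysics.QuantumFieldTheory.Balaban1983to89.B9SectBCodedClassR (RegExtraY bg9YC)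
open Literature.MathematicalPhysics.QuantumFieldTheory.Balaban1983to89.B9SectBL2GRead377Y hiding l2Block_record_of_KSC_base read377L2_gFrame₅CodedOn

open B6Ineq2142KLevelV1 (β)
open B6KLevelCensusIndexV1 (KIdx kGeo)
open B6RandomWalk (HasMajorant BlockSupp hasMajorant_mono Ineq261 blockPiece)
open B6RandomWalkL2 (HasL2Majorant hasL2Majorant_mono l2n l2n_nonneg l2n_sq abs_apply_le_l2n)
open B6RandomWalkL2Hom (HasL2MajorantHom hasL2MajorantHom_mono hasL2MajorantHom_add)
open B6Ineq268MultiLevelBox (W W_eq W_pos)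
open B9Thm34Ext (toB6)
open B9Ineq347 (ScaleTransfer)
open B9FromB6 (EBlock L2Block pref4_nonneg pref6_nonneg)
open B9PinMembersKLevelV1 (MemberY geo9Y bg9Y)
open B9Eq360DeltaPrimeAY (AfldY)
open B9Eq352DivFormLetters (conj)
open B9Eq352GradLetters (diffLetter)
open B9Eq360VprimeLetters (vPrimeConc)
open B9SectBGpLettersY (decY decY_base GVal blkC coordC GopC norm_le_one_and_inv_of_mem)
open B9SectBGpFrameCodedYR (codingYx)
open B9SectBGpFrameCodedY (CplxLettersY)
open B9SectBGpReadingsYR (KSC)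
open B9SectBGpReadingsY (etaS_eq_eta len_label)
open B9SectBCodedCarrier (CCfg pullS)
open B9SectBCodedReadingsUR (KACU)
open B9SectBKerFrameCodedYR (CinvY)
open B9SectBKerFrameCodedY (VarParY varParY_of_cplxLettersY len_ιB)
open B9SectBKerLettersY (QcC QcsC CopC FcC FcsC qcC_prod qcsC_prod)
open B9SectBKerLettersL2Y (wcY wsY wcY_nonneg wsY_nonneg wsY_mul_wcY hasL2MajorantHom_QcC hasL2MajorantHom_QcsC hasL2MajorantHom_FcC hasL2MajorantHom_FcsC)
open B9SectBGFrameCodedYR (gFrame₅CodedOn)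
open B9SectBL2GFrameCodedY (Read377L2 d261Y M261Y d261Y_spec)
open B9SectBL2DictionaryYR (KSC₃ l2Frame₂CodedOn readL2_KSC₃ readL2_two_KSC₃ eBlock_KSC₃_iff)
open B9SectBL2SecondOrderYR (l2Block_KSC₃_base_of_record)
open B9SectBL2SecondOrderY (cross2ConstL2 cross2ConstL2_nonneg)
open B9SectBL2TransferInY (crossConstL2 crossConstL2_nonneg)
open B9SectBCodedChainL2 (l2Block_weaken)
open B9SectBL2GCrossY (plaqLawY_of_reg335PlaqY)
open B9SectBGClassLettersY (Reg335PlaqY CplxLettersGY VarParBY)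
open B9SectBL2StepAtLettersV2 (cVL2_le_one l2entries_ext_of_l2Frame₂)
open B9SectBL2StepAtLettersV2Right (rateR rateR_pos l2rightEntries_ext_of_l2Frame₂)
open B9SectBL2GStepAtLettersV3 (kappa377_le_one)
open B9Thm34SectBUniformR1 (thm34_Gp_uniform)
open B9Thm34InvBlk (thm34_Cinv_uniform_blk)
open B9Ineq363L2 (cVL2 cVL2_nonneg ineq363_l2_vPrime eq365_of_inverse hasL2Majorant_rate_mono)
open B9Ineq363L2Right (hasL2Majorant_gp_vPrime eq365_first_of_inverse)
open B9Ineq377POne (kappa377 kappa377_nonneg)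
open B9Ineq368PPrime (kappa349)
open B9Ineq368L2F (kappa368F)
open B9Thm34GL2Entries (pOneConc)
open B9Ineq349L2ReadingsP (ineq349_l2Hom_of_readingsP)
open B9Ineq368L2FP (ineq368_l2_FP)
open B9Ineq377L2Hom (ineq377_l2_concreteE)
open B9RWSumsReadsNbr (nbr)
open B9RWSums347DefiniteFacesWindow (scaleTransfer6_window_geo9Y)
open B9GeoLemma21KLevelV1 (geo9K_one_le_L geo9Y_len_pos geo9K_eta_pos)
open B9GeoNormsKLevelV1 (geo9K geo9K_dist_nonneg)
open Node00 (SiteY BlkY IBondY CfgY SiteParY BondParY GAY GpY XY deltaAY deltaPrimeAY kernelFamilyS etaS)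

variable {d ℓ : ℕ} {hd : 1 ≤ d + 1} {hL : Odd (ℓ + 1) ∧ 1 < ℓ + 1} {b₀ b₁ : ℝ} {Mstar : ℕ}
variable {𝔸 : Type} [NormedRing 𝔸] (P : RegExtraY d ℓ hd hL b₀ b₁ Mstar 𝔸) [NormedAlgebra ℂ 𝔸] [CompleteSpace 𝔸]

/-! ## §0 Devices -/

section Devices

variable {g : B6.Geometry} {X : Type} [Fintype X]

end Devices


/-! ## §0b The block carrier `BlkY × ι`: sup ⟹ `ℓ²`, blocks -/

section Carrier

variable (x : MemberY d ℓ hd hL b₀ b₁ Mstar) {ι : Type} [Fintype ι] (ιB : BlkY x.toKIdx → IBondY x.toKIdx) {Rr : ℝ} {Hp : Prop}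
  [Fintype (geo9Y x).Site]

omit [Fintype ι] [Fintype (geo9Y x).Site] in
/-- the (3.46) block of the coded family `KSC` AT A BASE is the record family's at the decoded base (`decY (base U) = U`, by `rfl`). [cite: Balaban1985BackgroundPropagators, Thm 3.1 (3.46) p.398, bookkeeping] -/
theorem l2Block_record_of_KSC_base (G : Subgroup 𝔸ˣ) (par : SiteParY 𝔸 x.toKIdx)
    (C37 C38 : ℝ → CfgY 𝔸 x.toKIdx → AfldY 𝔸 x.toKIdx → Prop) {B₀ δ₀ : ℝ} {U : CfgY 𝔸 x.toKIdx}
    (h : L2Block (KSC P G x par C37 C38) B₀ δ₀ (.base U)) :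
    L2Block (kernelFamilyS x.toKIdx (bg9YC 𝔸 G P x) (fun U => U) (GpY x.toKIdx par) par) B₀ δ₀ U :=
  fun n lam hh y y' hc hs => h n lam hh y y' hc hs

end Carrier

/-! ## §1 NODE 00's structured `ℓ²` readings of `Q′`, `Q′*`, `F′`, `F′*` in the brick shapes -/

section Readings

variable (G : Subgroup 𝔸ˣ) (x : MemberY d ℓ hd hL b₀ b₁ Mstar) (par : SiteParY 𝔸 x.toKIdx) {ι : Type} [Fintype ι] (b : Module.Basis ι ℝ 𝔸)
  (ιB : BlkY x.toKIdx → IBondY x.toKIdx) {Rr : ℝ} {Hp : Prop} [Fintype (geo9Y x).Site] [DecidableEq (geo9Y x).Site]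

end Readings

/-! ## §2 ★★★ (3.77) in block-`ℓ²` for the concrete `P₁(A)` at NODE 00's coded letters -/

section Main

variable [NormOneClass 𝔸] [FiniteDimensional ℝ 𝔸] {J : Type} (f : J → MemberY d ℓ hd hL b₀ b₁ Mstar)
  [∀ x : MemberY d ℓ hd hL b₀ b₁ Mstar, Fintype (geo9Y x).Site]
  [instDS : ∀ x : MemberY d ℓ hd hL b₀ b₁ Mstar, DecidableEq (geo9Y x).Site] [instNE : ∀ x : MemberY d ℓ hd hL b₀ b₁ Mstar, Nonempty (geo9Y x).Site]
  (c35 : ℝ) (G : Subgroup 𝔸ˣ) (par : ∀ j : J, SiteParY 𝔸 (f j).toKIdx) (parB : ∀ j : J, BondParY 𝔸 (f j).toKIdx)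
  {ι : Type} [Fintype ι] [DecidableEq ι] (b : Module.Basis ι ℝ 𝔸) (ιB : ∀ j : J, BlkY (f j).toKIdx → IBondY (f j).toKIdx)
  (C37 C38 : ∀ j : J, ℝ → CfgY 𝔸 (f j).toKIdx → AfldY 𝔸 (f j).toKIdx → Prop)

set_option maxHeartbeats 3200000 in
set_option maxRecDepth 2048 in
/-- ★★★ **(3.77) p. 406 FOR THE CONCRETE `P₁(A)`, IN BLOCK-`ℓ²`, AT NODE 00's CODED LETTERS** — the displayed law `Read377L2 (gFrame₅CodedOn …)` of gen 14's
`stepL2Pos_KACU_frame₈_on` is a THEOREM: for all inputs `(B₀, δ₀, B₁, δ₁) > 0` there are an M-threshold, an α₁-window, a constant `κ₇` and a rate `ρ₇` (before the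
member) such that at every (3.35)-regular coded base above the threshold carrying the (3.42), (3.46) blocks of `KSC` and the (3.48) kernel of
`pullS … (CinvY …)`, and every coded multiplier in (3.37) in the window, `pOneConc` at the frame's `R`-words has the block-`ℓ²` majorant `κ₇·α₁·(Lʲη)⁻²·e^{−ρ₇d}`.
Route: g6's `read377_of_l2GFrame₃` over the block carrier `BlkY × ι` (module header): the (3.46) input converted to gen 9's augmented readings `KSC₃` at rate
`δ₀/2` (plaquette law from `hreg335P`), the `G′(U′U)` block-`ℓ²` entries from `l2Frame₂CodedOn`, r06's `thm34_Gp_uniform` and `thm34_Cinv_uniform_blk` at the call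
rate, sup ⟹ `ℓ²` on `P` with `√|ι|`, (3.63) both sides, (3.65), the bricks `ineq368_l2_FP`, `ineq349_l2Hom_of_readingsP`, `ineq377_l2_concreteE`; the structured
`ℓ²` readings of `Q′, Q′*, F′, F′*` by §1 and the volume transfer of `w_c` by `transfer_wcY` (threshold `((d+1)/2)·log(ℓ+1)/((9/5000)δ_F)`).  (One long assembly:
the heartbeat limit is raised as for the template, and the recursion depth for the final unification of the bricks' word with the frame's.)
[cite: Balaban1985BackgroundPropagators, (3.77) p.406 + (3.76) p.405 + (3.49) p.399 + (3.68) p.403 + (3.57)–(3.67) pp.401–403 + Thm 3.2 (3.48) p.398 + Thm 3.1 (3.46) p.398 + Thm 3.4 p.400; Balaban1984PropagatorsII, Lemma 2.1 p.234 + (2.51) p.232 + (2.69) p.235 + Prop. 2.6 (2.140)–(2.141) p.247] -/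
theorem read377L2_gFrame₅CodedOn (hι : ∀ (j : J) (s : BlkY (f j).toKIdx), β (f j).toKIdx.hN (f j).toKIdx.D (f j).toKIdx.hk (ιB j s) = s)
    (hG1 : ∀ u : 𝔸ˣ, u ∈ G → ‖(u : 𝔸)‖ ≤ 1) (hpar : ∀ j (U : CfgY 𝔸 (f j).toKIdx), GVal G (f j).toKIdx U → ∀ z w, par j U z w ∈ G)
    (hunit : ∀ j (U : CfgY 𝔸 (f j).toKIdx), GVal G (f j).toKIdx U → IsUnit (deltaPrimeAY (f j).toKIdx (par j) U))
    (M₂ : ℝ) (hM₂ : 0 ≤ M₂) (hrepr : ∀ (v : 𝔸) (j : ι), |b.repr v j| ≤ M₂ * ‖v‖) (hcR : 0 < M₂ * ∑ j, ‖b j‖)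
    (Cq : ℝ) (hCq : 0 ≤ Cq) (hC37 : ∀ j β' U a, C37 j β' U a → GVal G (f j).toKIdx U ∧ CplxLettersY G (f j) (par j) (ιB j) Cq β' U a)
    (MInv aInv aW : ℝ) (hMInv : 0 < MInv) (haInv : 0 < aInv) (haW : 0 < aW)
    (hunitX : ∀ j (U : CfgY 𝔸 (f j).toKIdx), GVal G (f j).toKIdx U → IsUnit (XY (f j).toKIdx (par j) (GpY (f j).toKIdx (par j)) U))
    (hsym : ∀ j (U : CfgY 𝔸 (f j).toKIdx) (z w : SiteY (f j).toKIdx), par j U z w = (par j U w z)⁻¹)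
    (hunitA : ∀ j (α₀ : ℝ) (U : CfgY 𝔸 (f j).toKIdx), (bg9YC 𝔸 G P (f j)).Reg335 c35 α₀ U → IsUnit (deltaAY (f j).toKIdx (par j) (parB j) (GpY (f j).toKIdx (par j)) U))
    (hparB : ∀ j (U : CfgY 𝔸 (f j).toKIdx), GVal G (f j).toKIdx U → ∀ y f', parB j U y f' ∈ G) (hb₁ : 0 ≤ b₁)
    (C₀ : ℝ) (hC₀ : 0 ≤ C₀)
    (hreg335P : ∀ j (α₀ : ℝ) (U : CfgY 𝔸 (f j).toKIdx), MInv ≤ (geo9Y (f j)).M → 0 < α₀ → (geo9Y (f j)).M * α₀ ≤ aInv →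
      (bg9YC 𝔸 G P (f j)).Reg335 c35 α₀ U → Reg335PlaqY G (f j) (ιB j) C₀ U)
    (hC37G : ∀ j β' U a, C37 j β' U a → CplxLettersGY G (f j) (ιB j) β' U a)
    (cVar : ℝ) (hcVar : 0 ≤ cVar) (hvarB : ∀ j β' U a, C37 j β' U a → VarParBY (f j).toKIdx (parB j) cVar β' U a)
    (hMd : 2 * ((d : ℝ) + 1) < MInv) (mN : ℕ) (hnbr : ∀ (j : J) (y' : IBondY (f j).toKIdx), (nbr (geo9Y (f j)) (2 * ((d : ℝ) + 1)) y').card ≤ mN) :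
    Read377L2 (gFrame₅CodedOn P f c35 G par parB b ιB C37 C38 hι hG1 hpar hunit M₂ hM₂ hrepr hcR Cq hCq hC37 MInv aInv aW hMInv haInv haW hunitX hsym hunitA hparB hb₁ C₀
        hC₀ hreg335P hC37G cVar hcVar hvarB hMd mN hnbr) := by
  set F := gFrame₅CodedOn P f c35 G par parB b ιB C37 C38 hι hG1 hpar hunit M₂ hM₂ hrepr hcR Cq hCq hC37 MInv aInv aW hMInv haInv haW hunitX hsym hunitA hparB hb₁ C₀
        hC₀ hreg335P hC37G cVar hcVar hvarB hMd mN hnbr with hFdef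
  intro B₀ δ₀ B₁ δ₁ hB₀ hδ₀ hB₁ hδ₁
  classical
  -- the lineage's constants
  have hSb : 0 ≤ ∑ j, ‖b j‖ := Finset.sum_nonneg fun j _ => norm_nonneg _
  have hSb2 : 0 ≤ Real.sqrt (∑ j, ‖b j‖ ^ 2) := Real.sqrt_nonneg _
  have hne : Nonempty ι := by
    by_contra h
    rw [not_nonempty_iff] at h
    simp at hcR
  have hsq : 0 < Real.sqrt (Fintype.card ι : ℝ) := Real.sqrt_pos.2 (by exact_mod_cast Fintype.card_pos)
  have hcL : 0 < Real.sqrt (Fintype.card ι) * M₂ * ∑ j, ‖b j‖ := by rw [mul_assoc]; exact mul_pos hsq hcR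
  set cLY : ℝ := Real.sqrt (Fintype.card ι) * M₂ * ∑ j, ‖b j‖ with hcLY
  -- gen 9's `L²` frame at the augmented readings `KSC₃` (same root data as `F`)
  set FL := l2Frame₂CodedOn P f c35 G b C37 C38 par ιB hι hG1 hpar hunit (d + 1) M₂ hM₂ hrepr hcR hcL Cq hCq hC37 MInv aInv aW hMInv haInv haW with hFLdef
  -- the G′-side input conversion: rate `δh = δ₀/2`, the `KSC₃` block constant `BL3` (before the member)
  set δh : ℝ := δ₀ / 2 with hδh
  have hδh0 : 0 < δh := by positivity
  have hδhδ₀ : δh ≤ δ₀ := by rw [hδh]; linarith only [hδ₀]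
  set Λ4 : ℝ := ((ℓ : ℝ) + 1) ^ 4 with hΛ4
  have hΛ41 : (1 : ℝ) ≤ Λ4 := one_le_pow₀ (by have : (0 : ℝ) ≤ ℓ := Nat.cast_nonneg ℓ; linarith)
  set dL0 : ℕ := d261Y (d := d) (ℓ := ℓ) (hd := hd) (hL := hL) (b₀ := b₀) (b₁ := b₁) (Mstar := Mstar) δ₀ with hdL0
  set BL3 : ℝ := cLY * max (crossConstL2 M₂ (∑ j, ‖b j‖) (Real.sqrt (Fintype.card ι)) d dL0 δ₀ Λ4 B₀)
      (cross2ConstL2 (2 * C₀) M₂ (∑ j, ‖b j‖) (Real.sqrt (Fintype.card ι)) d dL0 δ₀ Λ4 B₀) with hBL3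
  have hBL30 : 0 ≤ BL3 :=
    mul_nonneg hcL.le (le_max_of_le_left (crossConstL2_nonneg hM₂ hSb hsq.le d dL0 δ₀ Λ4 hB₀.le))
  set B₀' : ℝ := max B₀ BL3 with hB₀'
  have hB₀'0 : 0 < B₀' := lt_max_of_lt_left hB₀
  -- the block-ℓ² entries of G′(U′U) (left: members 0, 1; right: member 2) from the `L²` frame at `KSC₃`, constants BEFORE the member
  obtain ⟨a₃, ha₃, B₃, hB₃, H3⟩ := l2entries_ext_of_l2Frame₂ FL hB₀'0 hδh0
  obtain ⟨a₄, ha₄, B₄, hB₄, H4⟩ := l2rightEntries_ext_of_l2Frame₂ FL (fun j α₀ c B δ _ _ _ hreg hB _ hL2 k => by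
      obtain ⟨U, rfl, hU⟩ := (codingYx P G (f j) (C37 j) (C38 j)).exists_of_bg_Reg335 hreg
      exact readL2_two_KSC₃ P G (f j) (par j) (C37 j) (C38 j) b (ιB j) (hι j) hM₂ hrepr hU.1.1 hB.le hL2 k) hB₀'0 hδh0
  -- the call rate δ′ (≤ δh, δ₁, δcap and ≤ both output rates of the G′(U′U) entries) and the assembly rate δF = 9δ′/25
  set δ' : ℝ := min (F.rate (min δh δ₁)) (rateR (FL.rate δh)) with hδ'
  have hrate0 : 0 < FL.rate δh := FL.rate_pos hδh0
  have hδ'0 : 0 < δ' := lt_min (F.rate_pos (lt_min hδh0 hδ₁)) (rateR_pos hrate0)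
  have hδ'c : δ' ≤ F.δcap := le_trans (min_le_left _ _) (F.rate_le_cap _)
  have hδ'δh : δ' ≤ δh := le_trans (min_le_left _ _) (le_trans (F.rate_le _) (min_le_left _ _))
  have hδ'δ₀ : δ' ≤ δ₀ := hδ'δh.trans hδhδ₀
  have hδ'δ₁ : δ' ≤ δ₁ := le_trans (min_le_left _ _) (le_trans (F.rate_le _) (min_le_right _ _))
  have hδ'R : δ' ≤ rateR (FL.rate δh) := min_le_right _ _
  have hδ'L : δ' ≤ (1 - 1 / 100) * (49 / 50 * FL.rate δh) := by
    refine hδ'R.trans ?_; unfold rateR; nlinarith only [hrate0]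
  set δF : ℝ := 9 / 25 * δ' with hδF
  have hδF0 : 0 < δF := by positivity
  have hδFc : δF ≤ F.δcap := by rw [hδF]; nlinarith only [hδ'c, hδ'0]
  have hδFδ' : δF ≤ δ' := by rw [hδF]; nlinarith only [hδ'0]
  -- r06's uniform clauses (R1) at the call rate: G′ (for the inverse identities) and C⁻¹ OVER THE BLOCK CARRIER
  have hBG : 0 < F.cR * B₀ := mul_pos F.cR_pos hB₀
  obtain ⟨a₁, ha₁, B', -, H⟩ := thm34_Gp_uniform b (Fin (d + 1)) (F.d261 δ') δ' (F.cR * B₀) F.Cq F.a₀ F.d₀ F.M₂ (F.Λf δ')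
    hBG F.Cq_nonneg F.a₀_nonneg F.M₂_nonneg hδ'0 (fun α hα => F.Λf_one_le _ α hδ'0 hα) F.hrepr
  obtain ⟨a₂, ha₂, H'⟩ := thm34_Cinv_uniform_blk b (Fin (d + 1)) (F.d261 δ') δ' F.κQ (F.cR * B₀) (F.cK * B₁) F.cF F.Cq F.a₀ F.d₀ F.M₂ (F.Λf δ')
    F.κQ_pos hBG (mul_pos F.cK_pos hB₁) F.cF_pos F.Cq_nonneg F.a₀_nonneg F.M₂_nonneg hδ'0 (fun α hα => F.Λf_one_le _ α hδ'0 hα) F.hrepr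
  -- frame-level constants of the assembly
  set BL : ℝ := cLY * BL3 with hBL
  have hBL0 : 0 ≤ BL := mul_nonneg hcL.le hBL30
  set BG : ℝ := BL + B₃ + B₄ with hBGdef
  have hBG0 : 0 ≤ BG := by positivity
  have hBLle : BL ≤ BG := by rw [hBGdef]; linarith only [hB₃, hB₄]
  have hB₃le : B₃ ≤ BG := by rw [hBGdef]; linarith only [hBL0, hB₄]
  have hB₄le : B₄ ≤ BG := by rw [hBGdef]; linarith only [hBL0, hB₃]
  set ΘV : ℝ := 2 * BL * F.Λf δ' (1 / 100) * B6.c1 (F.d261 δ') δ' (1 / 100) *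
    cVL2 (Fintype.card (Fin (d + 1))) (Fintype.card ι) 1 1 F.a₀ F.Cq F.M₂ (∑ j, ‖b j‖) (Real.sqrt (∑ j, ‖b j‖ ^ 2)) (Real.exp (δ' * F.d₀)) with hΘV
  set ΘW : ℝ := BL * F.Λf δ' (1 / 100) * B6.c1 (F.d261 δ') δ' (1 / 100) *
    (cVL2 (Fintype.card (Fin (d + 1))) (Fintype.card ι) 1 1 F.a₀ F.Cq F.M₂ (∑ j, ‖b j‖) (Real.sqrt (∑ j, ‖b j‖ ^ 2)) (Real.exp (δ' * F.d₀)) +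
      2 * Fintype.card (Fin (d + 1)) * (2 * (1 : ℝ) ^ 2 * F.M₂ * (∑ j, ‖b j‖) * Real.sqrt ((1 * Fintype.card ι : ℕ) : ℝ) * Real.exp (δ' * F.d₀))) with hΘW
  have hΛ'1 : 1 ≤ F.Λf δ' (1 / 100) := F.Λf_one_le δ' _ hδ'0 (by norm_num)
  have hΛ'0 : 0 ≤ F.Λf δ' (1 / 100) := zero_le_one.trans hΛ'1
  have hcV1 : 0 ≤ cVL2 (Fintype.card (Fin (d + 1))) (Fintype.card ι) 1 1 F.a₀ F.Cq F.M₂ (∑ j, ‖b j‖) (Real.sqrt (∑ j, ‖b j‖ ^ 2)) (Real.exp (δ' * F.d₀)) :=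
    cVL2_nonneg (d := Fintype.card (Fin (d + 1))) (nι := Fintype.card ι) (ρu := 1) zero_le_one F.a₀_nonneg F.Cq_nonneg F.M₂_nonneg hSb hSb2
      (Real.exp_nonneg (δ' * F.d₀))
  have hc1' : 0 ≤ B6.c1 (F.d261 δ') δ' (1 / 100) := B6RandomWalk.c1_nonneg (F.d261 δ') δ' (1 / 100)
  have hΘV0 : 0 ≤ ΘV := by rw [hΘV]; positivity
  have hΘW0 : 0 ≤ ΘW := by have := F.M₂_nonneg; rw [hΘW]; positivity
  set BC : ℝ := Real.sqrt (Fintype.card ι) * (F.cK * B₁) with hBC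
  have hBC0 : 0 ≤ BC := mul_nonneg hsq.le (mul_pos F.cK_pos hB₁).le
  set BC' : ℝ := Real.sqrt (Fintype.card ι) * (2 * (F.cK * B₁) * B6.c1 (F.d261 δ') (2 / 5 * δ') (1 / 10)) with hBC'
  have hBC'' : 0 ≤ 2 * (F.cK * B₁) * B6.c1 (F.d261 δ') (2 / 5 * δ') (1 / 10) := by
    have := B6RandomWalk.c1_nonneg (F.d261 δ') (2 / 5 * δ') (1 / 10); have := mul_pos F.cK_pos hB₁; positivity
  have hBC'0 : 0 ≤ BC' := mul_nonneg hsq.le hBC''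
  set ΛF : ℝ := F.Λf δF (1 / 100) with hΛF
  have hΛF1 : 1 ≤ ΛF := F.Λf_one_le δF _ hδF0 (by norm_num)
  set cFL : ℝ := B6.c1 (F.d261 δF) δF (1 / 100) with hcFL
  have hcFL0 : 0 ≤ cFL := B6RandomWalk.c1_nonneg _ _ _
  set ΛC0 : ℝ := ((ℓ : ℝ) + 1) ^ ((((d : ℝ)) + 1) / 2) with hΛC0
  have hΛC00 : 0 ≤ ΛC0 := Real.rpow_nonneg (by have : (0 : ℝ) ≤ ℓ := Nat.cast_nonneg ℓ; linarith) _
  -- the structured-reading constants of §1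
  set κc : ℝ := cLY * (1 + Cq) with hκc
  set θc : ℝ := cLY * Cq with hθc
  have hκc0 : 0 ≤ κc := by rw [hκc]; positivity
  have hθc0 : 0 ≤ θc := by rw [hθc]; positivity
  -- the (3.68) and (3.49) constants and the (3.77) constant at α₁ = 1
  set KPp : ℝ := (1 + Fintype.card (Fin (d + 1))) * kappa368F (F.Λf δF (1 / 100)) (B6.c1 (F.d261 δF) δF (1 / 100)) ΛC0 ΛC0 ΛC0 κc κc θc θc BG ΘV ΘW BC BC'
    with hKPp
  set KP : ℝ := (1 + Real.sqrt (Fintype.card (Fin (d + 1)))) * kappa349 1 BG (κc * κc * BC * ΛC0) ΛF cFL with hKP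
  have hKP0 : 0 ≤ KP := by rw [hKP]; unfold kappa349; positivity
  have hKPp0 : 0 ≤ KPp := by
    rw [hKPp]
    have hcard : (0 : ℝ) ≤ Fintype.card (Fin (d + 1)) := Nat.cast_nonneg _
    have : 0 ≤ kappa368F (F.Λf δF (1 / 100)) (B6.c1 (F.d261 δF) δF (1 / 100)) ΛC0 ΛC0 ΛC0 κc κc θc θc BG ΘV ΘW BC BC' := by
      have := zero_le_one.trans hΛF1
      unfold kappa368F B9Ineq368L2F.thetaM B9Ineq368L2F.thetaI B9Ineq368L2F.thetaC; positivity
    positivity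
  set cE : ℝ := Real.sqrt (((Fintype.card (Fin (d + 1)) + 1) * Fintype.card ι : ℕ) : ℝ) * (4 * (1 + Fintype.card (Fin (d + 1))) * (F.M₂ * ∑ j, ‖b j‖) *
    Real.exp (21 / 25 * δF * F.d₀)) with hcE
  have hcE0 : 0 ≤ cE := by rw [hcE]; have := F.M₂_nonneg; positivity
  set κ₇ : ℝ := kappa377 cE KP KPp ΛF cFL 1 with hκ₇
  have hκ₇0 : 0 ≤ κ₇ := kappa377_nonneg hcE0 hKP0 hKPp0 (zero_le_one.trans hΛF1) hcFL0 zero_le_one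
  -- thresholds and the α₁-window
  set a : ℝ := min (min a₁ a₂) (min (min a₃ a₄) (1 / 4)) with ha_def
  have ha0 : 0 < a := lt_min (lt_min ha₁ ha₂) (lt_min (lt_min ha₃ ha₄) (by norm_num))
  set MC : ℝ := (((d : ℝ)) + 1) / 2 * Real.log ((ℓ : ℝ) + 1) / (9 / 5000 * δF) with hMC
  refine ⟨max (max (max (F.Mthr δ') (F.Mthr δF)) (FL.Mthr (FL.rate δh)))
      (max (max (M261Y (d := d) (ℓ := ℓ) (hd := hd) (hL := hL) (b₀ := b₀) (b₁ := b₁) (Mstar := Mstar) δ₀) (4 * Real.log ((ℓ : ℝ) + 1) / (δ₀ / 12))) MC),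
    a, κ₇, 4 / 5 * δF, lt_max_of_lt_left (lt_max_of_lt_left (lt_max_of_lt_left (F.Mthr_pos _))), ha0, hκ₇0, by positivity, ?_⟩
  intro i α₀ U hM0 hα₀ hMa hU hE hL2 hKer α₁ U' hα₁ ha hU'
  have hM' : F.Mthr δ' ≤ (geo9Y (f i)).M := le_trans (le_trans (le_trans (le_max_left _ _) (le_max_left _ _)) (le_max_left _ _)) hM0
  have hMF : F.Mthr δF ≤ (geo9Y (f i)).M := le_trans (le_trans (le_trans (le_max_right _ _) (le_max_left _ _)) (le_max_left _ _)) hM0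
  have hM3 : FL.Mthr (FL.rate δh) ≤ (geo9Y (f i)).M := le_trans (le_trans (le_max_right _ _) (le_max_left _ _)) hM0
  have hM261 : M261Y (d := d) (ℓ := ℓ) (hd := hd) (hL := hL) (b₀ := b₀) (b₁ := b₁) (Mstar := Mstar) δ₀ ≤ (geo9Y (f i)).M :=
    le_trans (le_trans (le_trans (le_max_left _ _) (le_max_left _ _)) (le_max_right _ _)) hM0
  have hMST : 4 * Real.log ((ℓ : ℝ) + 1) / (δ₀ / 12) ≤ (geo9Y (f i)).M :=
    le_trans (le_trans (le_trans (le_max_right _ _) (le_max_left _ _)) (le_max_right _ _)) hM0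
  have hMCle : MC ≤ (geo9Y (f i)).M := le_trans (le_trans (le_max_right _ _) (le_max_right _ _)) hM0
  have hM : F.MInv ≤ (geo9Y (f i)).M := F.MInv_le_of_Mthr_le hM'
  have ha1 : α₁ ≤ a₁ := ha.trans ((min_le_left _ _).trans (min_le_left _ _))
  have ha2 : α₁ ≤ a₂ := ha.trans ((min_le_left _ _).trans (min_le_right _ _))
  have ha3 : α₁ ≤ a₃ := ha.trans ((min_le_right _ _).trans ((min_le_left _ _).trans (min_le_left _ _)))
  have ha4 : α₁ ≤ a₄ := ha.trans ((min_le_right _ _).trans ((min_le_left _ _).trans (min_le_right _ _)))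
  have haq : α₁ ≤ 1 / 4 := ha.trans ((min_le_right _ _).trans (min_le_right _ _))
  have hα1 : α₁ ≤ 1 := haq.trans (by norm_num)
  have hw2 : ∀ a : (geo9Y (f i)).Site, 0 ≤ (geo9Y (f i)).len a ^ 2 := fun a => sq_nonneg _
  have hw1 : ∀ a : (geo9Y (f i)).Site, 0 ≤ (geo9Y (f i)).len a := fun a => (F.len_pos i a).le
  -- decoding the configurations: `U = base V`, `U′ = mult aa` (the coded classes live at such pairs only)
  obtain ⟨V, rfl, hV335⟩ := (codingYx P G (f i) (C37 i) (C38 i)).exists_of_bg_Reg335 hU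
  obtain ⟨V₁, aa, hVV, rfl, hC1⟩ := (codingYx P G (f i) (C37 i) (C38 i)).exists_of_bg_Cplx337 hU'
  have hVV' : V = V₁ := by injection hVV
  subst hVV'
  set U : (codingYx P G (f i) (C37 i) (C38 i)).bg.Cfg := CCfg.base V with hUdef
  set U' : (codingYx P G (f i) (C37 i) (C38 i)).bg.Cfg := CCfg.mult aa with hU'def
  have hVval : GVal G (f i).toKIdx V := hV335.1.1
  -- ★ the G′-side input at U converted to the augmented readings `KSC₃` (Lemma 2.1, p. 398 transfers, the plaquette law)
  have hL2rec := l2Block_record_of_KSC_base P (f i) G (par i) (C37 i) (C38 i) hL2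
  have h261₀ := d261Y_spec (f i) hδ₀ (by norm_num : (9 : ℝ) / 5000 ≤ 1 / 12) (by norm_num) hM261
  have hκlo₀ : 0 < δ₀ / 12 := by positivity
  obtain ⟨hT1₀, -, -, hT2i₀, -, -⟩ := scaleTransfer6_window_geo9Y hκlo₀ (f i) (δ := δ₀) (α := 1 / 12) (by linarith only [hδ₀]) hMST
  have hTi2₀ : ScaleTransfer (geo9Y (f i)) δ₀ (1 / 12) Λ4 (fun a => ((geo9Y (f i)).len a)⁻¹ ^ 2) := by
    have e : (fun a => ((geo9Y (f i)).len a)⁻¹ ^ 2) = (fun a => ((geo9Y (f i)).len a ^ 2)⁻¹) := funext fun a => by rw [inv_pow]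
    rw [e]; exact hT2i₀
  have hplaq := plaqLawY_of_reg335PlaqY G (f i) (ιB i) hG1 hVval hC₀ (hreg335P i α₀ V hM hα₀ hMa hV335)
  have hC₀2 : 0 ≤ 2 * C₀ := by positivity
  have hK3 : L2Block (KSC₃ P G (f i) (par i) (C37 i) (C38 i)) BL3 δh U :=
    l2Block_KSC₃_base_of_record P G (f i) (par i) b (ιB i) (C37 i) (C38 i) (hι i) hG1 hM₂ hrepr hδ₀ h261₀ hΛ41 hT1₀ hTi2₀ hC₀2 hB₀.le hVval
      hplaq hL2rec
  have hE3 : EBlock (KSC₃ P G (f i) (par i) (C37 i) (C38 i)) B₀' δh U :=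
    (eBlock_KSC₃_iff P G (f i) (par i) (C37 i) (C38 i) B₀' δh U).2 (eBlock_weaken (f i) _ hB₀.le (le_max_left _ _) hδhδ₀ hE)
  have hK3' : L2Block (KSC₃ P G (f i) (par i) (C37 i) (C38 i)) B₀' δh U := l2Block_weaken (f i) _ hBL30 (le_max_right _ _) le_rfl hK3
  -- Theorem 3.1's `L²` members of G′ at U in the frame shapes (constant `BL`, rate `δh`) and the entries of G′(U′U)
  obtain ⟨l0, l1⟩ := readL2_KSC₃ P G (f i) (par i) (C37 i) (C38 i) b (ιB i) (hι i) hM₂ hrepr hVval hBL30 hK3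
  have r2 := readL2_two_KSC₃ P G (f i) (par i) (C37 i) (C38 i) b (ιB i) (hι i) hM₂ hrepr hVval hBL30 hK3
  -- the letters of the member ARE the frame's (by `rfl`); restate the readings in the frame's terms
  have eG : GopC (f i).toKIdx (par i) b (.base V) = F.Gop i U := rfl
  have eco : coordC G (f i).toKIdx (.base V) = F.coord i U := rfl
  have eT : Node00.shiftY (f i).toKIdx = F.T i := rfl
  rw [eG] at l0
  rw [eG, eco, eT] at l1 r2
  obtain ⟨e0, e1⟩ := H3 i α₀ U hM3 hα₀ hMa hU hE3 hK3' α₁ U' hα₁ ha3 hU'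
  have e2 := H4 i α₀ U hM3 hα₀ hMa hU hE3 hK3' α₁ U' hα₁ ha4 hU'
  have hδFδh : δF ≤ δh := hδFδ'.trans hδ'δh
  have hδFL : δF ≤ (1 - 1 / 100) * (49 / 50 * FL.rate δh) := hδFδ'.trans hδ'L
  have hδFR : δF ≤ rateR (FL.rate δh) := hδFδ'.trans hδ'R
  -- the letters at U: inverse identities, sup readings for r06, the class (3.37), (3.57)
  obtain ⟨hΔG, hGΔ⟩ := F.reg_inv i α₀ U hM hα₀ hMa hU
  obtain ⟨h1, h2, h3, -⟩ := F.read342_le i α₀ U hM hα₀ hMa hU hB₀ hδ₀ hδ'δ₀ hE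
  obtain ⟨hkF, hsF, h337s, h337F, h337B, hA, hAτ⟩ := F.cplx i α₁ U U' hα₁ hU'
  obtain ⟨hQm, hQsm⟩ := F.q_mul i α₁ U U' hα₁ hU'
  obtain ⟨hFc, hFcs⟩ := F.hF i α₁ U U' hα₁ hU'
  -- the G′ clause: the family's G′(U′U) is r06's extension
  obtain ⟨hinv1, hinv2, -, -⟩ := H (F.T i) (F.coord i U) (F.blk i) (F.kQ i U) (F.sQ i U) (F.cfun i) (F.w i U)
    (F.dist_nonneg i) (F.triangle i) (F.dist_self i) (F.dist_comm i) (F.len_pos i) (F.eta_le_len i) (F.eta_pos i)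
    (F.h261_of i hδ'0 hδ'c hM') (F.hST_of i hδ'0 hδ'c hM') (F.unitary i U)
    (F.stencilB i) (F.stencilF i) (F.stencil0 i) (F.w_nonneg i U) (F.card_w i U) (F.hkQ i U) (F.hsQ i U) (F.hcfun i)
    hΔG hGΔ h1 h2 h3 α₁ hα₁.le ha1 (F.expA i U U') (F.kF i U U') (F.sF i U U')
    hkF hsF h337s h337F h337B hA hAτ
  have hG := F.gop_eq i ((codingYx P G (f i) (C37 i) (C38 i)).bg.mul U' U) _ _ (F.mul_law i α₁ U U' hα₁ hU') hinv1 hinv2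
  -- the C⁻¹ clause OVER THE BLOCK CARRIER: the (3.48) kernel at U read as a block majorant (lowered to δ′), r06's inverse at U′U with its block majorant
  have hK := F.readKer i α₀ U B₁ δ₁ hM hα₀ hMa hU hB₁ hδ₁ hKer
  have hK' : HasMajorant (g := toB6 (geo9Y (f i)) (F.Rr i) (F.Hp i)) (F.blkP i) (F.Cop i U)
      (fun a a' => F.cK * B₁ * (geo9Y (f i)).len a ^ (-(4 : ℝ)) * Real.exp (-(δ' * (geo9Y (f i)).dist a a'))) := by
    refine hasMajorant_mono (g := toB6 (geo9Y (f i)) (F.Rr i) (F.Hp i)) (F.blkP i) hK fun a a' => ?_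
    refine mul_le_mul_of_nonneg_left (Real.exp_le_exp.2 ?_) ?_
    · nlinarith only [F.dist_nonneg i a a', hδ'δ₁]
    · exact mul_nonneg (mul_pos F.cK_pos hB₁).le (Real.rpow_nonneg (F.len_pos i a).le _)
  obtain ⟨Tinv, hT1, hT2, hker⟩ := H' (F.T i) (F.coord i U) (F.blk i) (F.blkP i) (F.kQ i U) (F.sQ i U) (F.cfun i) (F.w i U)
    (F.dist_nonneg i) (F.triangle i) (F.dist_self i) (F.dist_comm i) (F.len_pos i) (F.eta_le_len i) (F.eta_pos i)
    (F.h261_of i hδ'0 hδ'c hM') (F.hST_of i hδ'0 hδ'c hM') (F.unitary i U)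
    (F.stencilB i) (F.stencilF i) (F.stencil0 i) (F.w_nonneg i U) (F.card_w i U) (F.hkQ i U) (F.hsQ i U) (F.hcfun i)
    h1 h2 (F.hQc i α₀ U hM hα₀ hMa hU) (F.hQcs i α₀ U hM hα₀ hMa hU) (F.reg_cinv i α₀ U hM hα₀ hMa hU) hK' α₁ hα₁.le ha2
    (F.expA i U U') (F.kF i U U') (F.sF i U U') hkF hsF h337s hA hAτ hQm hQsm hFc hFcs
  rw [← hG] at hT1 hT2
  have hC := F.cop_eq i ((codingYx P G (f i) (C37 i) (C38 i)).bg.mul U' U) _ Tinv rfl hT1 hT2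
  rw [← hC] at hker hT1
  -- block-ℓ² majorants of C⁻¹(U), C⁻¹(U′U) on `P` at the assembly rate (sup ⟹ ℓ² with `√|ι|`)
  have hw4i : ∀ a : (geo9Y (f i)).Site, 0 ≤ ((geo9Y (f i)).len a ^ 4)⁻¹ := fun a => inv_nonneg.mpr (by positivity)
  have h348F : HasL2Majorant (g := toB6 (geo9Y (f i)) (F.Rr i) (F.Hp i)) (F.blkP i) (F.Cop i U)
      (fun a a' => BC * ((geo9Y (f i)).len a ^ 4)⁻¹ * Real.exp (-(δF * (geo9Y (f i)).dist a a'))) := by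
    have h := hasL2Majorant_blkP_of_hasMajorant (f i) (ιB i) (Rr := F.Rr i) (Hp := F.Hp i) (hι i) (mul_pos F.cK_pos hB₁).le hK'
    refine hasL2Majorant_mono (g := toB6 (geo9Y (f i)) (F.Rr i) (F.Hp i)) _ h fun a a' => ?_
    have hE' : Real.exp (-(δ' * (geo9Y (f i)).dist a a')) ≤ Real.exp (-(δF * (geo9Y (f i)).dist a a')) :=
      Real.exp_le_exp.2 (neg_le_neg (mul_le_mul_of_nonneg_right hδFδ' (F.dist_nonneg i a a')))
    calc Real.sqrt (Fintype.card ι) * (F.cK * B₁) * ((geo9Y (f i)).len a ^ 4)⁻¹ * Real.exp (-(δ' * (geo9Y (f i)).dist a a'))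
        ≤ Real.sqrt (Fintype.card ι) * (F.cK * B₁) * ((geo9Y (f i)).len a ^ 4)⁻¹ * Real.exp (-(δF * (geo9Y (f i)).dist a a')) :=
          mul_le_mul_of_nonneg_left hE' (mul_nonneg hBC0 (hw4i a))
      _ = _ := by rw [hBC]
  have h348F' : HasL2Majorant (g := toB6 (geo9Y (f i)) (F.Rr i) (F.Hp i)) (F.blkP i) (F.Cop i ((codingYx P G (f i) (C37 i) (C38 i)).bg.mul U' U))
      (fun a a' => BC' * ((geo9Y (f i)).len a ^ 4)⁻¹ * Real.exp (-(δF * (geo9Y (f i)).dist a a'))) := by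
    have h := hasL2Majorant_blkP_of_hasMajorant (f i) (ιB i) (Rr := F.Rr i) (Hp := F.Hp i) (hι i) hBC'' hker
    refine hasL2Majorant_mono (g := toB6 (geo9Y (f i)) (F.Rr i) (F.Hp i)) _ h fun a a' => le_of_eq ?_
    rw [hBC', hδF]
  -- the G′ entries lowered to the assembly rate and raised to the common constant `BG`
  have low := fun (A : ℝ) (w : (geo9Y (f i)).Site → ℝ) (hA : 0 ≤ A) (hw : ∀ a, 0 ≤ w a) {ρ r : ℝ} (h : ρ ≤ r)
      {T₀ : Module.End ℝ (SiteY (f i).toKIdx × ι → ℝ)}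
      (hT : HasL2Majorant (g := toB6 (geo9Y (f i)) (F.Rr i) (F.Hp i)) (fun p : SiteY (f i).toKIdx × ι => F.blk i p.1) T₀
        (fun a a' => A * w a * Real.exp (-(r * (geo9Y (f i)).dist a a')))) =>
    hasL2Majorant_rate_mono (R := F.Rr i) (H := F.Hp i) (fun p : SiteY (f i).toKIdx × ι => F.blk i p.1) A w hA hw h (F.dist_nonneg i) hT
  have up := fun {A : ℝ} (w : (geo9Y (f i)).Site → ℝ) (hw : ∀ a, 0 ≤ w a) (hA : A ≤ BG) {r : ℝ} {T₀ : Module.End ℝ (SiteY (f i).toKIdx × ι → ℝ)}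
      (hT : HasL2Majorant (g := toB6 (geo9Y (f i)) (F.Rr i) (F.Hp i)) (fun p : SiteY (f i).toKIdx × ι => F.blk i p.1) T₀
        (fun a a' => A * w a * Real.exp (-(r * (geo9Y (f i)).dist a a')))) =>
    hasL2Majorant_mono (g := toB6 (geo9Y (f i)) (F.Rr i) (F.Hp i)) _ hT fun a a' =>
      mul_le_mul_of_nonneg_right (mul_le_mul_of_nonneg_right hA (hw a)) (Real.exp_nonneg _)
  have g0m := up (fun a => (geo9Y (f i)).len a ^ 2) hw2 hBLle (low BL (fun a => (geo9Y (f i)).len a ^ 2) hBL0 hw2 hδFδh l0)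
  have g1m := fun μ : Fin (d + 1) => up (fun a => (geo9Y (f i)).len a) hw1 hBLle (low BL (fun a => (geo9Y (f i)).len a) hBL0 hw1 hδFδh (l1 (Sum.inl μ)))
  have g2m := fun ν : Fin (d + 1) => up (fun a => (geo9Y (f i)).len a) hw1 hBLle (low BL (fun a => (geo9Y (f i)).len a) hBL0 hw1 hδFδh (r2 (Sum.inr ν)))
  have hGt0 := up (fun a => (geo9Y (f i)).len a ^ 2) hw2 hB₃le (low B₃ (fun a => (geo9Y (f i)).len a ^ 2) hB₃ hw2 hδFL e0)
  have hGt1 := fun μ : Fin (d + 1) => up (fun a => (geo9Y (f i)).len a) hw1 hB₃le (low B₃ (fun a => (geo9Y (f i)).len a) hB₃ hw1 hδFL (e1 (Sum.inl μ)))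
  have hGt2 := fun ν : Fin (d + 1) => up (fun a => (geo9Y (f i)).len a) hw1 hB₄le (low B₄ (fun a => (geo9Y (f i)).len a) hB₄ hw1 hδFR (e2 (Sum.inr ν)))
  -- the block-ℓ² (3.63) both sides at the call rate δ′ (inputs lowered to δ′, output 49δ′/50 ≥ δF)
  have l0' := low BL (fun a => (geo9Y (f i)).len a ^ 2) hBL0 hw2 hδ'δh l0
  have l1' := fun k => low BL (fun a => (geo9Y (f i)).len a) hBL0 hw1 hδ'δh (l1 k)
  have r2' := fun k => low BL (fun a => (geo9Y (f i)).len a) hBL0 hw1 hδ'δh (r2 k)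
  have h261β : Ineq261 (F.d261 δ') (toB6 (geo9Y (f i)) (F.Rr i) (F.Hp i)) δ' (1 / 100) :=
    F.h261_of i hδ'0 hδ'c hM' (1 / 100) (by norm_num) (by norm_num)
  obtain ⟨sT1, sT2, sT1i, sT2i, -, -⟩ := F.hST_of i hδ'0 hδ'c hM' (1 / 100) (by norm_num)
  have hsmall4 : ∀ y : (geo9Y (f i)).Site, (geo9Y (f i)).eta * (α₁ * ((geo9Y (f i)).len y)⁻¹) ≤ 1 / 4 := by
    intro y
    have hl := F.len_pos i y
    have h1 : (geo9Y (f i)).eta * ((geo9Y (f i)).len y)⁻¹ ≤ 1 := by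
      rw [← div_eq_mul_inv]; exact (div_le_one hl).mpr (F.eta_le_len i y)
    calc (geo9Y (f i)).eta * (α₁ * ((geo9Y (f i)).len y)⁻¹) = α₁ * ((geo9Y (f i)).eta * ((geo9Y (f i)).len y)⁻¹) := by ring
      _ ≤ α₁ * 1 := mul_le_mul_of_nonneg_left h1 hα₁.le
      _ ≤ 1 / 4 := by rw [mul_one]; exact haq
  have hr : 49 / 50 * δ' + (1 / 100 + 1 / 100) * δ' ≤ δ' := by nlinarith only [hδ'0]
  have hW := ineq363_l2_vPrime (Rr := F.Rr i) (H := F.Hp i) b (F.T i) (F.coord i U) (F.blk i) (F.d261 δ') (F.eta_pos i)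
    (F.expA i U U') (F.kQ i U) (F.kF i U U') (F.sQ i U) (F.sF i U U') (F.cfun i) (F.w i U) 1 F.d₀ F.M₂ F.Cq F.a₀
    δ' δ' (1 / 100) (1 / 100) (49 / 50 * δ') (F.Λf δ' (1 / 100)) BL α₁
    hBL0 hα₁.le hΛ'0 (by positivity) (by norm_num) (by norm_num) hδ'0.le hδ'0.le hr
    (F.dist_nonneg i) (F.triangle i) (F.len_pos i) h261β sT1 sT2 F.M₂_nonneg F.hrepr hsmall4
    (fun μ x => ⟨hA μ x, hAτ μ μ x⟩) (fun μ x => h337s μ μ x) (fun μ x => F.unitary i U μ x)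
    (fun μ x => ⟨F.stencilF i μ x, F.stencilB i μ x⟩) (F.stencil0 i)
    (F.w_nonneg i U) (F.card_w i U) F.Cq_nonneg F.a₀_nonneg (F.hkQ i U) hkF (F.hsQ i U) hsF (F.hcfun i) l0' l1'
  have hMV := hasL2Majorant_gp_vPrime (Rr := F.Rr i) (H := F.Hp i) b (F.T i) (F.coord i U) (F.blk i) (F.d261 δ') (F.eta_pos i)
    (F.expA i U U') (F.kQ i U) (F.kF i U U') (F.sQ i U) (F.sF i U U') (F.cfun i) (F.w i U) 1 F.d₀ F.M₂ F.Cq F.a₀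
    δ' δ' (1 / 100) (1 / 100) (49 / 50 * δ') (F.Λf δ' (1 / 100)) BL α₁
    hBL0 hα₁.le hΛ'0 (by positivity) (by norm_num) (by norm_num) hδ'0.le hδ'0.le hr
    (F.dist_nonneg i) (F.triangle i) (F.len_pos i) h261β sT1i sT2i F.M₂_nonneg F.hrepr hsmall4
    (fun μ x => ⟨hA μ x, hAτ μ μ x⟩) (fun μ x => h337s μ μ x) (fun μ x => h337F μ μ x) h337B (fun μ x => F.unitary i U μ x)
    (fun μ x => ⟨F.stencilF i μ x, F.stencilB i μ x⟩) (F.stencil0 i)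
    (F.w_nonneg i U) (F.card_w i U) F.Cq_nonneg F.a₀_nonneg (F.hkQ i U) hkF (F.hsQ i U) hsF (F.hcfun i) l0' r2'
  -- θ ≤ Θ·α₁ on both sides (cVL2 monotone in α₁ ≤ 1), then lowered to δF
  have hcv := cVL2_le_one (dκ := Fintype.card (Fin (d + 1))) (nι := Fintype.card ι) (E₀ := Real.exp (δ' * F.d₀)) hα1 F.a₀_nonneg
    F.Cq_nonneg F.M₂_nonneg hSb hSb2 (Real.exp_nonneg _)
  have hρF : δF ≤ 49 / 50 * δ' := by rw [hδF]; nlinarith only [hδ'0]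
  have hVG : HasL2Majorant (g := toB6 (geo9Y (f i)) (F.Rr i) (F.Hp i)) (fun p : SiteY (f i).toKIdx × ι => F.blk i p.1)
      (conj b (vPrimeConc (F.T i) (F.coord i U) (geo9Y (f i)).eta (F.expA i U U') (F.blk i) (F.kQ i U) (F.kF i U U') (F.sQ i U)
        (F.sF i U U') (F.cfun i)) * F.Gop i U) (fun a a' => ΘV * α₁ * Real.exp (-(δF * (geo9Y (f i)).dist a a'))) := by
    refine hasL2Majorant_mono (g := toB6 (geo9Y (f i)) (F.Rr i) (F.Hp i)) _ hW fun a a' => ?_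
    have hpre : 0 ≤ 2 * BL * F.Λf δ' (1 / 100) * B6.c1 (F.d261 δ') δ' (1 / 100) := by positivity
    have hθ : 2 * BL * F.Λf δ' (1 / 100) * B6.c1 (F.d261 δ') δ' (1 / 100) *
        cVL2 (Fintype.card (Fin (d + 1))) (Fintype.card ι) 1 α₁ F.a₀ F.Cq F.M₂ (∑ j, ‖b j‖) (Real.sqrt (∑ j, ‖b j‖ ^ 2)) (Real.exp (δ' * F.d₀)) ≤ ΘV := by
      rw [hΘV]; exact mul_le_mul_of_nonneg_left hcv hpre
    have hE' : Real.exp (-(49 / 50 * δ' * (geo9Y (f i)).dist a a')) ≤ Real.exp (-(δF * (geo9Y (f i)).dist a a')) :=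
      Real.exp_le_exp.2 (neg_le_neg (mul_le_mul_of_nonneg_right hρF (F.dist_nonneg i a a')))
    calc _ ≤ ΘV * α₁ * Real.exp (-(49 / 50 * δ' * (geo9Y (f i)).dist a a')) :=
          mul_le_mul_of_nonneg_right (mul_le_mul_of_nonneg_right hθ hα₁.le) (Real.exp_nonneg _)
      _ ≤ _ := mul_le_mul_of_nonneg_left hE' (mul_nonneg hΘV0 hα₁.le)
  have hGV : HasL2Majorant (g := toB6 (geo9Y (f i)) (F.Rr i) (F.Hp i)) (fun p : SiteY (f i).toKIdx × ι => F.blk i p.1)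
      (F.Gop i U * conj b (vPrimeConc (F.T i) (F.coord i U) (geo9Y (f i)).eta (F.expA i U U') (F.blk i) (F.kQ i U) (F.kF i U U') (F.sQ i U)
        (F.sF i U U') (F.cfun i))) (fun a a' => ΘW * α₁ * Real.exp (-(δF * (geo9Y (f i)).dist a a'))) := by
    refine hasL2Majorant_mono (g := toB6 (geo9Y (f i)) (F.Rr i) (F.Hp i)) _ hMV fun a a' => ?_
    have hpre : 0 ≤ BL * F.Λf δ' (1 / 100) * B6.c1 (F.d261 δ') δ' (1 / 100) := by positivity
    have hθ : BL * F.Λf δ' (1 / 100) * B6.c1 (F.d261 δ') δ' (1 / 100) *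
        (cVL2 (Fintype.card (Fin (d + 1))) (Fintype.card ι) 1 α₁ F.a₀ F.Cq F.M₂ (∑ j, ‖b j‖) (Real.sqrt (∑ j, ‖b j‖ ^ 2)) (Real.exp (δ' * F.d₀)) +
          2 * Fintype.card (Fin (d + 1)) * (2 * (1 : ℝ) ^ 2 * F.M₂ * (∑ j, ‖b j‖) * Real.sqrt ((1 * Fintype.card ι : ℕ) : ℝ) * Real.exp (δ' * F.d₀))) ≤
        ΘW := by
      rw [hΘW]; exact mul_le_mul_of_nonneg_left (add_le_add hcv le_rfl) hpre
    have hE' : Real.exp (-(49 / 50 * δ' * (geo9Y (f i)).dist a a')) ≤ Real.exp (-(δF * (geo9Y (f i)).dist a a')) :=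
      Real.exp_le_exp.2 (neg_le_neg (mul_le_mul_of_nonneg_right hρF (F.dist_nonneg i a a')))
    calc _ ≤ ΘW * α₁ * Real.exp (-(49 / 50 * δ' * (geo9Y (f i)).dist a a')) :=
          mul_le_mul_of_nonneg_right (mul_le_mul_of_nonneg_right hθ hα₁.le) (Real.exp_nonneg _)
      _ ≤ _ := mul_le_mul_of_nonneg_left hE' (mul_nonneg hΘW0 hα₁.le)
  -- (3.65): the resolvent identities of the family's own G′(U′U)
  have h365 := eq365_of_inverse hΔG hinv2
  have h365' := eq365_first_of_inverse hGΔ hinv1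
  rw [← hG] at h365 h365'
  -- Lemma 2.1 and the transfers at the assembly rate; the volume transfer of `w_c`
  have h261F := F.h261_of i hδF0 hδFc hMF
  have hSTF : ∀ α : ℝ, 9 / 5000 ≤ α →
      ScaleTransfer (geo9Y (f i)) δF α (F.Λf δF α) (fun a => (geo9Y (f i)).len a) ∧
        ScaleTransfer (geo9Y (f i)) δF α (F.Λf δF α) (fun a => (geo9Y (f i)).len a ^ 2) ∧
        ScaleTransfer (geo9Y (f i)) δF α (F.Λf δF α) (fun a => ((geo9Y (f i)).len a ^ 4)⁻¹) := by
    intro α hα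
    obtain ⟨t1, t2, -, -, t4, -⟩ := F.hST_of i hδF0 hδFc hMF α hα
    exact ⟨t1, t2, t4⟩
  have hTCF : ∀ α : ℝ, 9 / 5000 ≤ α → ∀ a a' : (geo9Y (f i)).Site,
      Real.exp (-(α * δF * (geo9Y (f i)).dist a a')) * wcY (f i).toKIdx a' ≤ (fun _ : ℝ => ΛC0) α * wcY (f i).toKIdx a := by
    intro α hα a a'
    have hκlo : 0 < 9 / 5000 * δF := by positivity
    have hκ : 9 / 5000 * δF ≤ α * δF := mul_le_mul_of_nonneg_right hα hδF0.le
    exact transfer_wcY (f i) (ιB i) (hι i) hκlo hκ hMCle a a'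
  -- the structured ℓ² readings of Q′, Q′*, F′, F′* (§1) at the base and at the product
  obtain ⟨hQc, hQc₁, hQcs, hQcs₁, hFc2, hFcs2⟩ := l2ReadingsQ_pair G (f i) (par i) b (ιB i) (Rr := F.Rr i) (Hp := F.Hp i) (hι i) hG1
    (hpar i) (hsym i) hM₂ hrepr hCq hVval hα₁.le hα1 (hC37 i α₁ V aa hC1).2
  have eQc : QcC (f i).toKIdx (par i) b (.base V) = F.Qc i U := rfl
  have eQc1 : QcC (f i).toKIdx (par i) b (.prod V aa) = F.Qc i ((codingYx P G (f i) (C37 i) (C38 i)).bg.mul U' U) := rfl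
  have eQcs : QcsC (f i).toKIdx (par i) b (.base V) = F.Qcs i U := rfl
  have eQcs1 : QcsC (f i).toKIdx (par i) b (.prod V aa) = F.Qcs i ((codingYx P G (f i) (C37 i) (C38 i)).bg.mul U' U) := rfl
  rw [eQc] at hQc
  rw [eQc1] at hQc₁
  rw [eQcs] at hQcs
  rw [eQcs1] at hQcs₁
  rw [eQc1, eQc] at hFc2
  rw [eQcs1, eQcs] at hFcs2
  -- ★ the four (3.68) entries of F(A), C⁻¹ on the block carrier
  have h68 := ineq368_l2_FP (R := F.Rr i) (H := F.Hp i) b (F.T i) (F.coord i U) (F.blk i) (F.blkP i) (F.d261 δF) ((((geo9Y (f i)).eta : ℂ))⁻¹) δF BG ΘV ΘW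
    κc κc θc θc BC BC' α₁ (F.Λf δF) (fun _ => ΛC0) (wcY (f i).toKIdx) (wsY (f i).toKIdx) hδF0 hBG0 hΘV0 hΘW0 hκc0 hκc0 hθc0 hθc0
    hBC0 hBC'0 hα₁.le (fun α hα => F.Λf_one_le δF α hδF0 hα) (fun α => hΛC00) (wcY_nonneg (f i).toKIdx) (wsY_nonneg (f i).toKIdx)
    (fun a => (wsY_mul_wcY (f i).toKIdx a).le) (F.dist_nonneg i) (F.dist_comm i) (F.triangle i) (F.len_pos i) h261F hSTF hTCF h365 h365'
    g0m g1m hGt0 hGt1 hGt2 hVG hGV hQc hQc₁ hQcs hQcs₁ hFc2 hFcs2 h348F h348F' (F.reg_cinv i α₀ U hM hα₀ hMa hU) hT1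
  obtain ⟨hPp, hDPp, hPpDs, hDPpDs⟩ := h68
  -- ★ the three (3.49) entries of R₀(U) from the readings
  obtain ⟨f1, f2, -, -, f4, -⟩ := F.hST_of i hδF0 hδFc hMF (1 / 100) (by norm_num)
  have hr49 : 21 / 25 * δF + (2 * (1 / 100) + 1 / 100) * δF ≤ (1 - 1 / 100) * δF := by nlinarith only [hδF0]
  have hδC : (1 - 1 / 100) * δF ≤ (1 - 1 / 100) * δF := le_rfl
  have lowF := fun (A : ℝ) (w : (geo9Y (f i)).Site → ℝ) (hA : 0 ≤ A) (hw : ∀ a, 0 ≤ w a) {T₀ : Module.End ℝ (SiteY (f i).toKIdx × ι → ℝ)}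
      (hT : HasL2Majorant (g := toB6 (geo9Y (f i)) (F.Rr i) (F.Hp i)) (fun p : SiteY (f i).toKIdx × ι => F.blk i p.1) T₀
        (fun a a' => A * w a * Real.exp (-(δF * (geo9Y (f i)).dist a a')))) =>
    low A w hA hw (show (1 - 1 / 100) * δF ≤ δF by nlinarith only [hδF0]) hT
  have h49 := ineq349_l2Hom_of_readingsP (R := F.Rr i) (H := F.Hp i) b (F.T i) (F.coord i U) (F.blk i) (F.blkP i) (F.d261 δF)
    ((((geo9Y (f i)).eta : ℂ))⁻¹) δF ((1 - 1 / 100) * δF) (1 / 100) (1 / 100) (21 / 25 * δF) ΛF BG δF (1 / 100) ΛC0 κc κc BC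
    (wcY (f i).toKIdx) (wsY (f i).toKIdx)
    hBG0 hΛF1 (by positivity) (by norm_num) (by norm_num) hδF0.le hr49 hκc0 hκc0 hBC0 hΛC00 (wsY_nonneg (f i).toKIdx)
    (fun a => (wsY_mul_wcY (f i).toKIdx a).le) hδC
    (F.dist_nonneg i) (F.triangle i) (F.len_pos i) (h261F (1 / 100) (by norm_num) (by norm_num)) f1 f2 f4 (hTCF (1 / 100) (by norm_num))
    (lowF BG _ hBG0 hw2 g0m) (fun μ => lowF BG _ hBG0 hw1 (g1m μ)) (fun ν => lowF BG _ hBG0 hw1 (g2m ν)) hQc hQcs h348F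
  obtain ⟨hP, hDP, hPDs⟩ := h49
  -- ★ (3.77) for the concrete P₁(A)
  obtain ⟨-, -, f1i, -, -, -⟩ := F.hST_of i hδF0 hδFc hMF (1 / 100) (by norm_num)
  have hr77 : 4 / 5 * δF + 2 * ((1 / 100 + 1 / 100) * δF) ≤ 21 / 25 * δF := by nlinarith only [hδF0]
  have h77 := ineq377_l2_concreteE (Rr := F.Rr i) (H := F.Hp i) b (F.T i) (F.coord i U) (F.blk i) (F.d261 δF) δF (21 / 25 * δF) (1 / 100) (1 / 100)
    (4 / 5 * δF) ΛF KP KPp α₁ F.d₀ F.M₂ hKP0 hKPp0 hα₁.le hΛF1 (by positivity) (by norm_num) (by norm_num) hδF0.le (by positivity) F.M₂_nonneg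
    hr77 (F.dist_nonneg i) (F.triangle i) (F.len_pos i) (h261F (1 / 100) (by norm_num) (by norm_num)) f1i F.hrepr (F.eta_pos i) (F.unitary i U)
    (F.expA i U U') hA (fun ν x => hAτ ν ν x) hsmall4 (F.stencilF i) (F.stencilB i) hP hDP hPDs hPp hDPp hPpDs hDPpDs
  -- the word IS `pOneConc` at the frame's letters; the constant at α₁ ≦ 1
  refine hasL2Majorant_mono (g := toB6 (geo9Y (f i)) (F.Rr i) (F.Hp i)) _ h77 fun a a' => ?_
  have hk : kappa377 cE KP KPp ΛF cFL α₁ ≤ kappa377 cE KP KPp ΛF cFL 1 :=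
    kappa377_le_one hcE0 hKP0 hKPp0 (zero_le_one.trans hΛF1) hcFL0 hα₁.le hα1
  have h0 : 0 ≤ α₁ * ((geo9Y (f i)).len a ^ 2)⁻¹ * Real.exp (-(4 / 5 * δF * (geo9Y (f i)).dist a a')) := by
    have := inv_nonneg.mpr (hw2 a); positivity
  calc _ = kappa377 cE KP KPp ΛF cFL α₁ * (α₁ * ((geo9Y (f i)).len a ^ 2)⁻¹ * Real.exp (-(4 / 5 * δF * (geo9Y (f i)).dist a a'))) := by
        rw [hcE, hΛF, hcFL]; ring
    _ ≤ κ₇ * (α₁ * ((geo9Y (f i)).len a ^ 2)⁻¹ * Real.exp (-(4 / 5 * δF * (geo9Y (f i)).dist a a'))) := mul_le_mul_of_nonneg_right hk h0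
    _ = _ := by ring

end Main

end Literature.MathematicalPhysics.QuantumFieldTheory.Balaban1983to89.B9SectBL2GRead377YR

end
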